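import Literature.NumberTheory.LFunctions.Zhang2022.KnifeEdgeEllScales
import Literature.NumberTheory.LFunctions.Zhang2022.KnifeEdgeEq148DUniform
import Literature.NumberTheory.LFunctions.Zhang2022.MainTermFormEllPolar
import Literature.NumberTheory.LFunctions.Zhang2022.RepairFrakc3S
import Literature.NumberTheory.LFunctions.Zhang2022.RepairAdmissible
import Literature.NumberTheory.LFunctions.Zhang2022.SkeletonPropositions
import HarnessLib

/-!
# Zhang (2022) in the `ℓ`-regime `P = D^A`, `T = D^B`: the B-ell registry rows E-027, E-020, E-022
# (+ ell-E13, E-058) typed as `Prop`s over the free-scale block `EllScales`, and the POS and CS endgames at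
# fixed `A` PROVED as kernel implications (cell `landau-siegel`, family B-ell)

Topic `Literature/NumberTheory/LFunctions/Zhang2022` (Landau–Siegel audit tree; verdict-neutral).
Y. Zhang, *Discrete mean estimates and the Landau–Siegel zero*, arXiv:2211.02515v1
[Zhang2022LandauSiegel] — an unrefereed manuscript under adjudication. **WHAT THIS IS NOT: not a claim
about Theorems 1–2 of arXiv:2211.02515, about Landau–Siegel zeros, or about Parity. The programme
SEARCHES and TYPES: every `def … : Prop` below is a NAMED STATEMENT (a registry row of the cell's
`obj/EDREGISTRY.md`, status «derivation, in-house, not started / unreviewed»), asserted by no one; the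
`theorem`s are elementary bookkeeping consequences of the definitions (exponent arithmetic, unfolding),
not estimates.**

WHY THIS FILE. The knife edge `ℓ₀ = 1` (`mainTermFormEll_neg_of_one_lt`; custodians' KNIFE-EDGES §1,
LEVERS L11, ELL-CENSUS v1.0a) lives in the regime `P = D^A`, `T = D^B` with `A, B` FIXED, where the
manuscript's printed error terms, zero model and main-term dictionary must be RE-READ `D`-uniformly. The
free-scale vocabulary for that regime is `EllScales` (`KnifeEdgeEllScales.lean`, p456970): the record
`Scales`, the family `Chr S`, `zeroSet`/`prodZeroSet`, `cstar`, `omegaW`, `profPoly`, `discMean`, `discPolar`,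
`normaliser`, the three lengths `LDelta/LRefl/ell`.  This file states, over that vocabulary and the class-`R`
design record `Repair.Theta` (`RepairTheta.lean`), the three rows the B-ell planner assigned to typer-1
(B-ell/EDLIST.md v1.2; TYPING ORDER v2, cell INBOX 2026-08-26T16:49:11Z):

* **Part 0 — the regime.** `Scales.tauT = log T/log P` (`= B/A`), `Scales.taut0 = log t₀/log P`
  (`τ_{Dt₀} = log(Dt₀)/log P` is the block's `Scales.alphaTilde`), `Scales.ellP = ℓ(P)`, the frame factor
  `Scales.shrink = L_M/L_R(P)` and the reflection-frame design `thetaRefl S θ`, the predicates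
  `Scales.IsEllRegimeP S A` (`log P = A·log D`, secondary scales `t₀, 𝓛₁, 𝓛₂, η` pinned as in the manuscript —
  ELL-CENSUS §1 «E*-ℓ substitution») and `Scales.IsEllRegime S A B` (also `log T = B·log D`), and the
  PHYSICAL design `thetaPhys S θ` (`ν₂ ↦ ν₂ − 10τ_T`: the exponent of `P₂ = P^{ν₂}T⁻¹⁰`, (2.21)).
  (That ls-obj-eng-3's constructor `KnifeEdge.scalesAt A B D` is a scale record of the regime is
  `EllRegime.isEllRegime_scalesAt` in typer-2's `EllRegimeFloors.lean`, by `rfl`.)  PROVED regime limits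
  (§ RegimeLimits): in the regime `L_R(P) = (A+1)log D + 519 log log D − log 2π`, `L_Δ(P) = (A+½)log D +
  519 log log D` (`IsEllRegimeP.LRefl_P/LDelta_P/ellP_eq/shrink_eq`), `ℓ(P) → (A+1)/(A+½) = 1 + 1/(2A+1)` and
  `L_M/L_R → A/(A+1)` (`tendsto_ellRatio`, `tendsto_shrinkRatio`), packaged as
  `eventually_ellP_shrink_near : 0 < A → 0 < δ → ∃ D₁, ∀ S, D₁ ≤ S.D → S.IsEllRegimeP A →
  |S.ellP − (A+1)/(A+½)| < δ ∧ |S.shrink − A/(A+1)| < δ` — the bridge from a certificate at the LIMIT regime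
  point (the cell's `ε(A)` with `τ₀ → 0`) to the `D`-uniform hypothesis of Part 5's endgame.
* **Part 1 — E-027 «T-exponent constraints / is `B > ½` free?»** `TExponentConstraints θ τT τt0 τDt0`:
  the conjunction of the PRINTED occurrences of `T` in the manuscript's hypotheses, as inequalities in
  the design exponents and `(τ_T, τ_{t₀}, τ_{Dt₀})` — (2.21) ordering with `P₂`'s `T⁻¹⁰` [tex l.574–576],
  (7.2) `a(n) = 0` for `n ≥ PT⁻²` per sequence [l.1813–1815], (15.2) `b(n) = 0` for `n > PT⁻²η₊` [l.3984],
  (14.2) `a*(n) = 0` for `n > 2P₄ = 2PT⁻²t₀` [l.3831] (wall (R-a)), Lemma 12.3's range `P″₁ < dr < P₂`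
  [l.3556] (wall (R-e)) — located line by line in the custodians' PARAMS.md §7 (i)–(vi) / KS2-DERIVATION.md
  §D′; `TExponentConstraintsAt S θ` (the same at a scale record) and `BFreeAboveHalf θ A τt0 :=
  ∃ B > ½, TExponentConstraints θ (B/A) τt0 (1/A + τt0)`.  PROVED bookkeeping (the row's «decisive» content,
  now kernel-checked): `tExponentConstraints_gap` (`10τ_T ≤ ν₂ − ν₃`), `bFreeAboveHalf_lower_bound`
  (`B > ½` admissible ⇒ `A·(ν₂ − ν₃) > 5`), `bFreeAboveHalf_theta0` (at the printed exponents `ν₂ − ν₃ =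
  0.002`: `A > 2500` — the ELL-CENSUS «print-exact ceiling `B ≤ 2·10⁻⁴A`» as a theorem), and the sharp
  converse for the printed design `bFreeAboveHalf_theta0_iff : BFreeAboveHalf θ₀ A 0 ↔ 2500 < A`.
* **Part 2 — E-020 «EllZeroModelFixedA (c_Z, A₀)» (alias E-007Z).** The shapes `OnLineSimple` (Prop. 2.2
  (i)(ii) at scale `S` on a sub-family `F`), `ZeroGapModel` (consecutive zeros of `L(s,ψ)L(s,ψχ)` in the
  window satisfy `|γ′ − γ − π/L_Δ(p)| ≤ (c/A)·π/L_Δ(p)`, Prop. 2.2 (iii)'s encoding of «consecutive»),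
  `SubfamilyDense` (Prop. 2.1's shape: `F` misses at most `C·𝔓·𝓛⁻⁷³⁹` members of `Ψ`) — bodies of the
  first two = ls-knife-typer-2's kit `Shapes.{OnLineSimple, ZeroModel}` (HOME/ls-knife-typer-2/EllKitB.lean,
  kit-only, not in the tree; credited) — and the row itself `EllZeroModelFixedA Fam cZ A₀`: for every
  `A ≥ A₀`, eventually in `D`, under (A), at every scale record of the regime, the selected sub-family
  `Fam S` is dense, on the line and simple, and obeys the gap model with precision `c_Z/A`.
* **Part 3 — E-022 «EllDictFirstOrder (G, K)» (alias dict-1).** The three discrete means of the design at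
  scale `S` — `diagMean1` (`Ξ₁₁/(𝔞𝔓)`, (8.3)), `diagMean2` (`Ξ₁₂/(𝔞𝔓)`, (8.4)), `crossMean2Re`
  (`2Re Ξ₁₃/(𝔞𝔓)`, (8.5), with the root-number factor `ZAt = Z(s,ψχ)` of (2.2)) — built from the block's
  `profPoly/discMean` on the physical profiles `Repair.h1Profile/h2Profile (thetaPhys S θ)`; the
  `ℓ`-dictionary blocks `ellBlock1/ellBlock2/ellCross2Re ℓ θ` = the polar blocks of `F_ℓ = mainTermFormEll ℓ`
  on the split `𝔤_θ = h₁ + R̃h₂` (the cell's convention of record for «the F_ℓ blocks»: ls-Bell-plan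
  2026-08-26T16:47:53Z, lineage-B SCAN-G1-B; at `ℓ = 1` they are the class-`R` dictionary's blocks); and the
  row `EllDictFirstOrder c' Fam Adm G K A₀`: means `=` `F_ℓ`-blocks (on the REFLECTION-FRAME design
  `thetaRefl S θ`: lengths `× L_M/L_R = Scales.shrink`, ls-theory's frame rule 17:10:30Z) `+ G_j(θ,B)/A` up
  to `K(θ,B)/A²`, with
  the first-order functional `G = (G₁, G₂, G₃)` and the constant `K` as VISIBLE PARAMETERS (definition
  request D-ell-1: ls-theory supplies `G`; until then a design citing E-022 has an «INCOMPLETE main term»,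
  OBJECTIVE.md §2.5); the `λ`-form `EllDictFirstOrderLam G₀ G₁ Λ` of ls-theory's ruling Q3 (`∃ λ(χ)`,
  `|λ| ≤ Λ`; `…Lam G₀ G₁ 0 ↔ EllDictFirstOrder G₀`, PROVED), the one-profile form `EllDictFirstOrderProfile`
  and the planner's `K₀` form `EllDictFirstOrderK0 k u G₀ G₁ Λ K A₀` (one-piece exponentials `expComb`);
  PROVED `ellBlocks_one_sum` / `ellBlocks_sum`: the three blocks sum to `Repair.C232S θ` at `ℓ = 1` and to
  `C232Ell ℓ θ` at every `ℓ`.  E-021 (the XL budget form) is deliberately NOT typed (planner's order).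

* **Part 4 — EDLIST ell-E13 «Lemma23FixedA (A₀)» and ell-E12 = E-058 «EllZeroFloorRetune».** Shapes
  `Lemma23At` (Lemma 2.3 at scale `S` on `F`), `WeightsNonnegAt`; the row `Lemma23FixedA c' Fam A₀` (under (A),
  at every fixed `A ≥ A₀`, Lemma 2.3's conclusion on the selected sub-family); PROVED `weightsNonnegAt_of`
  (Lemma 2.3 + on-the-line ⇒ weights `≥ 0`, needs `𝓛₂ > 0`) and `discMean_nonneg_of_weights` (then every
  discrete mean is `≥ 0`: the positivity endgame's first step at free scale).  The free-window regime
  `Scales.IsEllRegimePW S A c₁` (`𝓛₁ = 𝓛^{c₁}`; `isEllRegimePW_405_iff`), `EllZeroModelFixedAW Fam cZ c₁ A₀`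
  (`…AW … 405 … ↔ EllZeroModelFixedA …`, PROVED) and the row's shape `EllZeroFloorRetune Fam cZ I A₀Z`.
  PROVED for the tie/CS endgame: `RealWeightsAt` + `realWeightsAt_of` (Lemma 2.3 + on-the-line ⇒ `𝔠*`, `ω`
  real) and the weighted discrete Cauchy–Schwarz at scale `S`, `norm_sq_discPolar_le :
  WeightsNonnegAt → RealWeightsAt → ‖discPolar u v‖² ≤ discMean u · discMean v` (free-scale twin of
  `KnifeEdge.norm_sq_discPolar_le`), and the CS closing criterion `sq_le_of_cs` (design mean `≤ M_D𝔞𝔓`,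
  probe mean `≤ M_J𝔞𝔓`, cross `≥ X𝔞𝔓`, `𝔞𝔓 > 0` ⇒ `X² ≤ M_D M_J`).

* **Part 5 — PROVED: the positivity endgame at fixed `A`** (free-scale twin of
  `KnifeEdge.theorem1_of_eStarLen`): `forAllLarge_not_assumptionA_of_profile` — one-profile dictionary
  (E-022) + `Lemma23FixedA` (ell-E13) + the zero model's «on the line» (E-020) + a NEGATIVE completed main term
  `F_{ℓ(P)} + (G₀ + λG₁)/A + K/A² < 0 ∀|λ| ≤ Λ` at some fixed `A` ⇒ `¬(A)` eventually; hence
  `theorem1_of_ellDictProfile`, `theorem2_of_ellDictProfile`, `theorem1_of_ellDictK0` (Theorems 1–2 of the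
  manuscript as CONDITIONAL kernel implications from the named rows — the rows themselves asserted by no one).

* **Part 6 — bookkeeping the cell reads designs through:** `TExponentConstraints.caps` (the two (15.2)
  support caps `2e₂ ≤ 1 − 2τ_T`, `cut₁ + e₂ ≤ 1 − 2τ_T` in physical exponents are inside E-027, PROVED);
  the first-order robust closing test `ClosesK0FirstOrder gain G₀ G₁ Λ` (the `A → ∞` proxy of Part 5's
  hypothesis) with `closesK0FirstOrder_iff` (decided at `λ = ±Λ`, PROVED); the MODEL-CONSISTENCY GATE
  `ModelConsistentK0 gain G₀ G₁ λ_model` (ls-ref-1 / ls-theory acceptance test #1) with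
  `not_closesK0FirstOrder_of_modelConsistent` (a model-consistent dict-1 with `|λ_model| ≤ Λ` fails the
  robust test, PROVED — ref-1's §7b in the kernel); and the SET form of KILL-draft v0.2 F5/F6:
  `firstOrderValue gain G₀ G₁ G₂ (λ, c′)`, `ClosesFirstOrderOn M`, `ModelConsistentOn 𝓜`,
  `not_closesFirstOrderOn_of_modelConsistentOn` (𝓜 ∩ M ≠ ∅ ⇒ ¬ closes, PROVED),
  `closesK0FirstOrder_iff_closesFirstOrderOn` (PROVED), `FirstOrderEmptyOn designs data M` (the certificate's
  kernel target) with `firstOrderEmptyOn_of_modelConsistentOn` (PROVED).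

* **Part 7 — the `C`-regime `t₀ = D^C·𝓛⁵¹⁹`** (`C = 0` = the printed `t₀ = 𝓛⁵¹⁹` of Parts 0–5; `C = 2B` =
  the cell's «`t₀ = T²`» sheet, ls-Bell-plan RULING-2 18:12:09Z: `α̃ = (1+2B)/A`, frame factor `A/(A+1+2B)`):
  `Scales.IsEllRegimePC S A C` / `IsEllRegimeC S A B C` (+ `isEllRegimePC_zero_iff`, `isEllRegimeC_zero_iff`),
  the constructor `Scales.scalesAtC A C D`, PROVED `C`-limits (`IsEllRegimePC.LRefl_P/LDelta_P/ellP_eq/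
  shrink_eq`, `eventually_ellP_shrink_nearC`: `ℓ(P) → (A+C+1)/(A+C+½) = 1 + 1/(2A+1+2C)`, `L_M/L_R →
  A/(A+C+1)`), the row variants `Lemma23FixedAC`, `EllZeroModelFixedAC`, `EllDictFirstOrderLamC … (Cof : ℝ → ℝ)`
  (`C = Cof B`), `EllDictFirstOrderProfileC`, `EllDictFirstOrderK0C` (each `↔` its `C = 0` row, PROVED), and
  the PROVED endgame `forAllLarge_not_assumptionA_of_profileC` / `theorem1_of_ellDictProfileC` /
  `theorem1_of_ellDictK0C`; glue `hneg_of_box` / `hneg_of_boxC` (a bound on a `δ`-box around the limit regime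
  point discharges the `D`-uniform hypothesis) and `theorem1_of_ellDictK0C_box` (Theorem 1 from the three rows
  + a box certificate).

* **Part 8 — the tie/CS sheet at fixed `A` (the B-ell «OBJ_CS» currency as a kernel implication; free-scale twin
  of the skeleton's `eventually_not_assumptionA_of_props`).**  Objects: the probe tables `J1At` (tent `f_θ` on the
  tied window `[ν₂, ν₁]`, (2.28)–(2.29)) and `J2At` (its functional-equation dual `z ↦ f_θ(1 + α̃ − z)`, (2.30)),
  the two-sided table `twoSided = u₁ + Zū₂` and the AFE defect `afeDefect = v₁ − Zv̄₂`, `xiStar1At` (2.17),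
  `absPairing`/`xiStar2At`/`xiStar3At` (2.19)–(2.20), `UnitRootAt` (`|Z(ρ,ψχ)| = 1` at the sampled zeros), the
  normalised quantities `designMeanCS = Ξ₁/(𝔞𝔓)`, `probeMean = Ξ_J/(𝔞𝔓)`, `crossStar = Ξ₁*/(𝔞𝔓)`,
  `defectMean = (11.1)/(𝔞𝔓)`.  PROVED: `absPairing_sq_le` (Cauchy: `Ξ₂*² ≤ Ξ₁Ξ_J`, `Ξ₃*² ≤ (11.1)·Ξ₁₂`),
  `norm_xiStar1At_le` ((2.18) `|Ξ₁*| ≤ Ξ₂* + Ξ₃*`), `discMean_twoSided` / `designMeanCS_eq` ((8.2): the CS design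
  mean is the SUM of E-022's three blocks — one dictionary row serves both sheets), `unitRootAt_scalesAt`
  (`|Z| = 1` from Prop. 2.2 (i): `Im ρ > 0`, `p > D^A ≥ D` prime so `ψχ (mod Dp)` primitive), and the whole §2
  skeleton in one normalised inequality `norm_crossStar_le : ‖Ξ₁*‖/𝔞𝔓 ≤ √(Ξ₁Ξ_J)/𝔞𝔓 + √((11.1)·Ξ₁₂)/𝔞𝔓`.
  Rows (shapes, asserted by no one): the reflection-frame probe `thetaReflJ` (tent window `× L_M/L_R`), the
  zeroth-order slots `probeSlot = C₂₃₃^{(ℓ(P))}` and `crossSlot = (𝔡′+𝔡)^{(ℓ(P))}` (polar `F_ℓ` of the frame-rule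
  `H`-profile against the frame-rule tent; `= dSumEll/C233Ell` of `thetaRefl` when `τ_T = 0`,
  `crossSlot_eq_dSumEll`), `CSProbeDictAt` (probe (2.33)/(18.3), cross (10.17), defect (11.1) at first order with
  slots `g_J, g_X, δ`) and the fixed-`A` row `EllCSDictLam` = E-022's `DictAt` ∧ `CSProbeDictAt` under ONE `λ`
  (`EllCSDictLam.dictLam`: it projects to `EllDictFirstOrderLam`).  Certificate `CSClosesAt`
  (`√(M_D⁺M_J⁺) + √(δ⁺M₂⁺) < X` with `csMD/csMJ/csM2/csX` the dictionary values incl. `K/A²` tolerances) and the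
  PROVED endgame `forAllLarge_not_assumptionA_of_csDict` (rows + ell-E13 + E-020 + certificate `∀|λ| ≤ Λ` at one
  `A ≥ 1` ⇒ `¬(A)` eventually), `theorem1_of_ellCSDict`, `theorem2_of_ellCSDict`; glue `CSClosesWith` (the same
  inequality as a function of the frame point `(ℓ, r, τ)`), `csClosesAt_iff`, `csCert_of_box`,
  `theorem1_of_ellCSDict_box` (Theorem 1 from the rows + a box certificate around `((A+1)/(A+½), A/(A+1))`, `τ = B/A`).

* **Part 9 — the tie/CS sheet in the `C`-regime `t₀ = D^C·𝓛⁵¹⁹`** (twin of Part 7 for Part 8; `C = Cof B = 2B` =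
  RULING-2's T-room sheets): the record `scalesAtBC A B C D` (`isEllRegimeC_scalesAtBC`), `IsEllRegimeC.tauT_eq`,
  PROVED `unitRootAt_of_regimePC` (`|Z| = 1` at any record of the `C`-regime, `C ≥ 0`), the row `EllCSDictLamC … Cof`
  (`ellCSDictLamC_zero_iff`, projection `EllCSDictLamC.dictLamC` to `EllDictFirstOrderLamC`), and the PROVED endgame
  `forAllLarge_not_assumptionA_of_csDictC` / `theorem1_of_ellCSDictC` / `theorem2_of_ellCSDictC`, glue
  `csCert_of_boxC` (box around `((A+C+1)/(A+C+½), A/(A+C+1))`) and `theorem1_of_ellCSDictC_box`.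

Deliberately NOT here: E-016 `Eq148DUniform` (ls-obj-eng-3, `KnifeEdgeEq148DUniform.lean`), E-019/E-023/
E-024 (printed (14.8) at fixed `A` and the two census re-tunes — typer-2's file), E-026 (the (T)-floors —
typer-2), any numerical value of record, and any claim that a row holds.  Registry prices of record
(ls-ref-1 VERDICTS.md §3, 2026-08-26T16:46:18Z): E-027 M («decisive»), E-020 L (→ M), E-022 L as a
derivation / S numerics under evidence (i)–(iii).

## References
* Y. Zhang, arXiv:2211.02515v1 (2022): §2 (2.2), (2.6)–(2.10), (2.13)–(2.21), (2.23)–(2.30), (2.31)–(2.33),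
  (2.16)–(2.20) p. 5, Props. 2.4–2.6 p. 6, Prop. 2.1, Prop. 2.2, p. 4–6; §7 (7.2); §8 (8.1)–(8.5), (8.23); §9 (9.7);
  §10 (10.17) p. 22; §11 (11.1) p. 23; §12 (12.1), Lemma 12.3; §14 (14.2); §15 (15.2); §18 (18.1), (18.3).
  [cite: Zhang2022LandauSiegel, §2, §7 (7.2), §8 (8.1)–(8.5), §10 (10.17), §11 (11.1), §12 Lemma 12.3, §14 (14.2), §15 (15.2)]

«The programme SEARCHES and TYPES; no claim about Landau–Siegel zeros, Theorems 1–2 of arXiv:2211.02515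
or a repaired Margin232 until a kernel theorem says so.»
-/

noncomputable section

open Complex Real ComplexConjugate

namespace Literature.NumberTheory.LFunctions.Zhang2022

/-! ## Part 0 — the `ℓ`-regime at a scale record -/

namespace EllScales

namespace Scales

variable (S : Scales)

/-- `τ_T = log T/log P` — in the regime `P = D^A`, `T = D^B` this is `B/A` (ELL-CENSUS §1; PARAMS §7:
«rooms are powers of `τ_T = log T/log P`», at print `𝓛^{−7.9}`). [cite: Zhang2022LandauSiegel, §2 (2.6), §6] -/
def tauT : ℝ := S.logT / S.logP

/-- `τ_{t₀} = log t₀/log P` (the `T⁻²`-slack of `P₄ = PT⁻²t₀` in exponent units; `τ_{Dt₀} = log(Dt₀)/log P`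
is `Scales.alphaTilde`). [cite: Zhang2022LandauSiegel, §2 (2.8), (2.30); §6] -/
def taut0 : ℝ := Real.log S.t0 / S.logP

/-- `ℓ(P) = L_R(P)/L_Δ(P)`: the edge parameter of the regime read at the left end `p = P` of the prime
window (`Scales.ell`; `≈ 1 + 1/(2A+1)`). [cite: Zhang2022LandauSiegel, §2 (2.10), (2.30)] -/
def ellP : ℝ := S.ell S.P

/-- **The frame factor `L_M/L_R(P) = log P/log(PDt₀/2π)`** (`≈ A/(A + 1 + τ₀/2)`, `τ₀ = 2 log t₀/log D`): the
form `mainTermFormEll (1+ε)` lives on the REFLECTION frame `y = log n/L_R ∈ [0,1]`, so a length `P^ν` of the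
design (`ν` in `L_M = log P` units) enters it as `ν·L_M/L_R` — ls-theory's FRAME RULE of record (cell INBOX
2026-08-26T17:10:30Z (1); KNIFE-EDGES §1 R1), a support shrink of relative size `≈ 1/A`, the same order as `ε`.
[cite: Zhang2022LandauSiegel, §2 (2.10), (2.30); §5 Lemma 5.2] -/
def shrink : ℝ := S.logP / S.LRefl S.P

/-- **The `ℓ`-regime on the `P`-side**: `log P = A·log D` with the manuscript's secondary scales kept
(`t₀ = 𝓛⁵¹⁹`, `𝓛₁ = 𝓛⁴⁰⁵`, `𝓛₂ = 𝓛⁴⁰⁰`, `η = 𝓛⁻⁶⁸`: the values of `Scales.pinned`) — the «E*-ℓ substitution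
`P = D^A`» of ELL-CENSUS §1. [cite: Zhang2022LandauSiegel, §2 (2.6), (2.8), (2.15)] -/
def IsEllRegimeP (A : ℝ) : Prop :=
  S.logP = A * Real.log S.D ∧ S.t0 = (pinned S.D).t0 ∧ S.L1 = (pinned S.D).L1 ∧
    S.L2 = (pinned S.D).L2 ∧ S.eta = (pinned S.D).eta

/-- **The `ℓ`-regime**: `log P = A·log D`, `log T = B·log D`, secondary scales pinned (ELL-CENSUS §1
«`P = D^A`, `T = D^B`»). [cite: Zhang2022LandauSiegel, §2 (2.6); §6] -/
def IsEllRegime (A B : ℝ) : Prop :=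
  S.IsEllRegimeP A ∧ S.logT = B * Real.log S.D

/-- **The `P`-side regime with a FREE window exponent `c₁`** (`𝓛₁ = 𝓛^{c₁}`; the manuscript's `c₁ = 405`,
(2.8) `Ω₁: |t − 2πt₀| < 𝓛₁`): the regime of registry row E-058 «zero-model floor re-tune `A₀^{(Z)}(c₁)`», whose
question is the admissible range of `c₁` after re-reading every printed use of `𝓛₁`.
[cite: Zhang2022LandauSiegel, §2 (2.6), (2.8), (2.15)] -/
def IsEllRegimePW (A c₁ : ℝ) : Prop :=
  S.logP = A * Real.log S.D ∧ S.t0 = (pinned S.D).t0 ∧ S.L1 = Real.log S.D ^ c₁ ∧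
    S.L2 = (pinned S.D).L2 ∧ S.eta = (pinned S.D).eta

/-- At the printed window exponent `c₁ = 405` the free-window regime is the regime.
[cite: Zhang2022LandauSiegel, §2 (2.8)] -/
theorem isEllRegimePW_405_iff (A : ℝ) : S.IsEllRegimePW A 405 ↔ S.IsEllRegimeP A := by
  have h : Real.log S.D ^ (405 : ℝ) = Real.log S.D ^ (405 : ℕ) := by
    rw [show (405 : ℝ) = ((405 : ℕ) : ℝ) by norm_num, Real.rpow_natCast]
  unfold IsEllRegimePW IsEllRegimeP
  rw [h]
  rfl

/-- In the regime, `Scales.A = A` and `Scales.B = B` (for `log D ≠ 0`). [cite: Zhang2022LandauSiegel, §2 (2.6); §6] -/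
theorem IsEllRegime.A_eq_and_B_eq {S : Scales} {A B : ℝ} (h : S.IsEllRegime A B) (hD : Real.log S.D ≠ 0) :
    S.A = A ∧ S.B = B := by
  obtain ⟨⟨hP, -, -, -, -⟩, hT⟩ := h
  refine ⟨?_, ?_⟩
  · rw [Scales.A, hP]; field_simp
  · rw [Scales.B, hT]; field_simp

/-- In the regime, `τ_T = B/A` (for `log D ≠ 0`, `A ≠ 0`). [cite: Zhang2022LandauSiegel, §2 (2.6); §6] -/
theorem IsEllRegime.tauT_eq {S : Scales} {A B : ℝ} (h : S.IsEllRegime A B) (hD : Real.log S.D ≠ 0)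
    (hA : A ≠ 0) : S.tauT = B / A := by
  obtain ⟨⟨hP, -, -, -, -⟩, hT⟩ := h
  rw [tauT, hP, hT]
  field_simp

/-! ### The regime's `ℓ(P)` and `L_M/L_R` as explicit functions of `D`, and their limits
`ℓ(P) → (A+1)/(A+½) = 1 + 1/(2A+1)`, `L_M/L_R → A/(A+1)` (so that a certificate computed at the limit
regime point with a margin discharges the endgame's `D`-uniform hypothesis) -/

section RegimeLimits

open Filter Topology

variable {S : Scales} {A : ℝ}

/-- In the regime, `L_R(P) = (A+1)·log D + 519·log log D − log 2π` (`t₀ = 𝓛⁵¹⁹`; `D ≥ 2`).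
[cite: Zhang2022LandauSiegel, §2 (2.6), (2.8), (2.30)] -/
theorem IsEllRegimeP.LRefl_P (h : S.IsEllRegimeP A) (hD : 2 ≤ S.D) :
    S.LRefl S.P = (A + 1) * Real.log S.D + 519 * Real.log (Real.log S.D) - Real.log (2 * π) := by
  obtain ⟨hP, ht0, -, -, -⟩ := h
  have hD1 : (1 : ℝ) < S.D := by exact_mod_cast lt_of_lt_of_le one_lt_two hD
  have hD0 : (0 : ℝ) < S.D := lt_trans zero_lt_one hD1
  have hlog : 0 < Real.log S.D := Real.log_pos hD1
  have hE : Real.exp (A * Real.log S.D) ≠ 0 := (Real.exp_pos _).ne'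
  have hL : Real.log S.D ^ 519 ≠ 0 := pow_ne_zero _ hlog.ne'
  have h2π : (2 * π : ℝ) ≠ 0 := by positivity
  have ht : S.t0 = Real.log S.D ^ 519 := ht0
  rw [LRefl, P, hP, ht, Real.log_div (mul_ne_zero (mul_ne_zero hE hD0.ne') hL) h2π,
    Real.log_mul (mul_ne_zero hE hD0.ne') hL, Real.log_mul hE hD0.ne', Real.log_exp, Real.log_pow]
  push_cast
  ring

/-- In the regime, `L_Δ(P) = (A+½)·log D + 519·log log D` (`D ≥ 2`). [cite: Zhang2022LandauSiegel, §2 (2.6), (2.8), (2.10)] -/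
theorem IsEllRegimeP.LDelta_P (h : S.IsEllRegimeP A) (hD : 2 ≤ S.D) :
    S.LDelta S.P = (A + 1 / 2) * Real.log S.D + 519 * Real.log (Real.log S.D) := by
  obtain ⟨hP, ht0, -, -, -⟩ := h
  have hD1 : (1 : ℝ) < S.D := by exact_mod_cast lt_of_lt_of_le one_lt_two hD
  have hD0 : (0 : ℝ) < S.D := lt_trans zero_lt_one hD1
  have hlog : 0 < Real.log S.D := Real.log_pos hD1
  have hE : Real.exp (A * Real.log S.D) ≠ 0 := (Real.exp_pos _).ne'
  have hL : Real.log S.D ^ 519 ≠ 0 := pow_ne_zero _ hlog.ne'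
  have hsq : Real.sqrt (S.D : ℝ) ≠ 0 := Real.sqrt_ne_zero'.mpr hD0
  have ht : S.t0 = Real.log S.D ^ 519 := ht0
  rw [LDelta, P, hP, ht, Real.log_mul (mul_ne_zero hE hsq) hL, Real.log_mul hE hsq, Real.log_exp,
    Real.log_sqrt hD0.le, Real.log_pow]
  push_cast
  ring

/-- `ℓ(P)` in the regime as a function of `log D`. [cite: Zhang2022LandauSiegel, §2 (2.10), (2.30)] -/
theorem IsEllRegimeP.ellP_eq (h : S.IsEllRegimeP A) (hD : 2 ≤ S.D) :
    S.ellP = ((A + 1) * Real.log S.D + 519 * Real.log (Real.log S.D) - Real.log (2 * π)) /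
      ((A + 1 / 2) * Real.log S.D + 519 * Real.log (Real.log S.D)) := by
  rw [ellP, ell, h.LRefl_P hD, h.LDelta_P hD]

/-- `L_M/L_R(P)` in the regime as a function of `log D`. [cite: Zhang2022LandauSiegel, §2 (2.6), (2.30)] -/
theorem IsEllRegimeP.shrink_eq (h : S.IsEllRegimeP A) (hD : 2 ≤ S.D) :
    S.shrink = A * Real.log S.D /
      ((A + 1) * Real.log S.D + 519 * Real.log (Real.log S.D) - Real.log (2 * π)) := by
  rw [shrink, h.LRefl_P hD, h.1]

/-- `((A+1)u + 519 log u − log 2π)/((A+½)u + 519 log u) → (A+1)/(A+½)` as `u → ∞` (`log u/u → 0`).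
[cite: Zhang2022LandauSiegel, §2 (2.10)] -/
theorem tendsto_ellRatio (hA : 0 < A) :
    Tendsto (fun u : ℝ => ((A + 1) * u + 519 * Real.log u - Real.log (2 * π)) /
      ((A + 1 / 2) * u + 519 * Real.log u)) atTop (nhds ((A + 1) / (A + 1 / 2))) := by
  have hg : Tendsto (fun u : ℝ => Real.log u / u) atTop (nhds 0) := by
    simpa using Real.tendsto_pow_log_div_mul_add_atTop 1 0 1 one_ne_zero
  have hk : Tendsto (fun u : ℝ => u⁻¹) atTop (nhds 0) := tendsto_inv_atTop_zero
  have hnum : Tendsto (fun u : ℝ => (A + 1) + 519 * (Real.log u / u) - Real.log (2 * π) * u⁻¹) atTop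
      (nhds ((A + 1) + 519 * 0 - Real.log (2 * π) * 0)) :=
    (tendsto_const_nhds.add (hg.const_mul _)).sub (hk.const_mul _)
  have hden : Tendsto (fun u : ℝ => (A + 1 / 2) + 519 * (Real.log u / u)) atTop
      (nhds ((A + 1 / 2) + 519 * 0)) :=
    tendsto_const_nhds.add (hg.const_mul _)
  have hlim := hnum.div hden (by linarith)
  simp only [mul_zero, add_zero, sub_zero] at hlim
  refine hlim.congr' ?_
  filter_upwards [eventually_gt_atTop (0 : ℝ)] with u hu
  simp only [Pi.div_apply]
  have hu' : u ≠ 0 := hu.ne'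
  have e1 : (A + 1) * u + 519 * Real.log u - Real.log (2 * π) =
      u * ((A + 1) + 519 * (Real.log u / u) - Real.log (2 * π) * u⁻¹) := by
    field_simp
  have e2 : (A + 1 / 2) * u + 519 * Real.log u = u * ((A + 1 / 2) + 519 * (Real.log u / u)) := by
    field_simp
  rw [e1, e2, mul_div_mul_left _ _ hu']

/-- `Au/((A+1)u + 519 log u − log 2π) → A/(A+1)` as `u → ∞`. [cite: Zhang2022LandauSiegel, §2 (2.30)] -/
theorem tendsto_shrinkRatio (hA : 0 < A) :
    Tendsto (fun u : ℝ => A * u / ((A + 1) * u + 519 * Real.log u - Real.log (2 * π))) atTop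
      (nhds (A / (A + 1))) := by
  have hg : Tendsto (fun u : ℝ => Real.log u / u) atTop (nhds 0) := by
    simpa using Real.tendsto_pow_log_div_mul_add_atTop 1 0 1 one_ne_zero
  have hk : Tendsto (fun u : ℝ => u⁻¹) atTop (nhds 0) := tendsto_inv_atTop_zero
  have hden : Tendsto (fun u : ℝ => (A + 1) + 519 * (Real.log u / u) - Real.log (2 * π) * u⁻¹) atTop
      (nhds ((A + 1) + 519 * 0 - Real.log (2 * π) * 0)) :=
    (tendsto_const_nhds.add (hg.const_mul _)).sub (hk.const_mul _)
  have hlim := (tendsto_const_nhds (x := A)).div hden (by linarith)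
  simp only [mul_zero, add_zero, sub_zero] at hlim
  refine hlim.congr' ?_
  filter_upwards [eventually_gt_atTop (0 : ℝ)] with u hu
  simp only [Pi.div_apply]
  have hu' : u ≠ 0 := hu.ne'
  have e1 : (A + 1) * u + 519 * Real.log u - Real.log (2 * π) =
      u * ((A + 1) + 519 * (Real.log u / u) - Real.log (2 * π) * u⁻¹) := by
    field_simp
  rw [e1, show A * u = u * A by ring, mul_div_mul_left _ _ hu']

/-- **The regime point converges**: for every `δ > 0` there is `D₁` such that every scale record of the
`P`-side regime with `D ≥ D₁` has `|ℓ(P) − (A+1)/(A+½)| < δ` and `|L_M/L_R − A/(A+1)| < δ`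
(`(A+1)/(A+½) = 1 + 1/(2A+1)`: the cell's `ε(A)` with `τ₀ → 0`).  This is the lemma a certificate computed
at the LIMIT regime point (with a margin and a modulus of continuity in `(ℓ, r)`) needs to discharge the
`D`-uniform hypothesis of `forAllLarge_not_assumptionA_of_profile`. [cite: Zhang2022LandauSiegel, §2 (2.10), (2.30)] -/
theorem eventually_ellP_shrink_near (hA : 0 < A) {δ : ℝ} (hδ : 0 < δ) :
    ∃ D₁ : ℕ, ∀ S : Scales, D₁ ≤ S.D → S.IsEllRegimeP A →
      |S.ellP - (A + 1) / (A + 1 / 2)| < δ ∧ |S.shrink - A / (A + 1)| < δ := by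
  have hlog : Tendsto (fun D : ℕ => Real.log (D : ℝ)) atTop atTop :=
    Real.tendsto_log_atTop.comp tendsto_natCast_atTop_atTop
  obtain ⟨N₁, hN₁⟩ := Metric.tendsto_atTop.mp ((tendsto_ellRatio hA).comp hlog) δ hδ
  obtain ⟨N₂, hN₂⟩ := Metric.tendsto_atTop.mp ((tendsto_shrinkRatio hA).comp hlog) δ hδ
  refine ⟨max (max N₁ N₂) 2, fun S hD h => ?_⟩
  have hD2 : 2 ≤ S.D := le_trans (le_max_right _ _) hD
  have hD₁ : N₁ ≤ S.D := le_trans (le_trans (le_max_left _ _) (le_max_left _ _)) hD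
  have hD₂ : N₂ ≤ S.D := le_trans (le_trans (le_max_right _ _) (le_max_left _ _)) hD
  refine ⟨?_, ?_⟩
  · rw [h.ellP_eq hD2]
    simpa [Function.comp, Real.dist_eq] using hN₁ S.D hD₁
  · rw [h.shrink_eq hD2]
    simpa [Function.comp, Real.dist_eq] using hN₂ S.D hD₂

end RegimeLimits

/-! ### The regime with a FREE `t₀`-exponent `C` (`t₀ = D^C·𝓛⁵¹⁹`): `C = 0` is the printed `t₀ = 𝓛⁵¹⁹`
(`IsEllRegimeP`), `C = 2B` is the cell's «`t₀ = T²`» sheet (ls-Bell-plan RULING-2: `α̃ = τ_{Dt₀} = (1+2B)/A`,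
frame factor `λ = A/(A+1+2B)`; ls-theory: `ε(A) = 1/(2A+1+τ₀)`, `τ₀ = 2 log t₀/log D`) -/

/-- **The `P`-side regime with `t₀ = D^C·𝓛⁵¹⁹`**: `log P = A·log D`, `t₀ = e^{C log D}·(log D)⁵¹⁹`, `𝓛₁, 𝓛₂, η`
pinned. [cite: Zhang2022LandauSiegel, §2 (2.6), (2.8), (2.15)] -/
def IsEllRegimePC (A C : ℝ) : Prop :=
  S.logP = A * Real.log S.D ∧ S.t0 = Real.exp (C * Real.log S.D) * Real.log S.D ^ 519 ∧
    S.L1 = (pinned S.D).L1 ∧ S.L2 = (pinned S.D).L2 ∧ S.eta = (pinned S.D).eta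

/-- **The regime `(P, T, t₀) = (D^A, D^B, D^C·𝓛⁵¹⁹)`**. [cite: Zhang2022LandauSiegel, §2 (2.6), (2.8); §6] -/
def IsEllRegimeC (A B C : ℝ) : Prop :=
  S.IsEllRegimePC A C ∧ S.logT = B * Real.log S.D

/-- `C = 0` is the printed `t₀`: `IsEllRegimePC A 0 ↔ IsEllRegimeP A`. [cite: Zhang2022LandauSiegel, §2 (2.8)] -/
theorem isEllRegimePC_zero_iff (A : ℝ) : S.IsEllRegimePC A 0 ↔ S.IsEllRegimeP A := by
  unfold IsEllRegimePC IsEllRegimeP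
  simp [pinned]

/-- `IsEllRegimeC A B 0 ↔ IsEllRegime A B`. [cite: Zhang2022LandauSiegel, §2 (2.8); §6] -/
theorem isEllRegimeC_zero_iff (A B : ℝ) : S.IsEllRegimeC A B 0 ↔ S.IsEllRegime A B := by
  unfold IsEllRegimeC IsEllRegime
  rw [isEllRegimePC_zero_iff]

/-- **The scale record `(D^A, 1, D^C·𝓛⁵¹⁹)`** (a constructor for the `C`-regime; `T` plays no role on the
`P`-side). [cite: Zhang2022LandauSiegel, §2 (2.6), (2.8), (2.15)] -/
def scalesAtC (A C : ℝ) (D : ℕ) : Scales where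
  D := D
  logP := A * Real.log D
  logT := 0
  t0 := Real.exp (C * Real.log D) * Real.log D ^ 519
  L1 := Real.log D ^ 405
  L2 := Real.log D ^ 400
  eta := (Real.log D ^ 68)⁻¹

/-- `scalesAtC A C D` is a record of the `C`-regime. [cite: Zhang2022LandauSiegel, §2 (2.6), (2.8)] -/
theorem isEllRegimePC_scalesAtC (A C : ℝ) (D : ℕ) : (scalesAtC A C D).IsEllRegimePC A C :=
  ⟨rfl, rfl, rfl, rfl, rfl⟩

section RegimeLimitsC

open Filter Topology

variable {S : Scales} {A C : ℝ}

/-- In the `C`-regime, `L_R(P) = (A+1+C)·log D + 519·log log D − log 2π` (`D ≥ 2`).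
[cite: Zhang2022LandauSiegel, §2 (2.6), (2.8), (2.30)] -/
theorem IsEllRegimePC.LRefl_P (h : S.IsEllRegimePC A C) (hD : 2 ≤ S.D) :
    S.LRefl S.P = (A + 1 + C) * Real.log S.D + 519 * Real.log (Real.log S.D) - Real.log (2 * π) := by
  obtain ⟨hP, ht0, -, -, -⟩ := h
  have hD1 : (1 : ℝ) < S.D := by exact_mod_cast lt_of_lt_of_le one_lt_two hD
  have hD0 : (0 : ℝ) < S.D := lt_trans zero_lt_one hD1
  have hlog : 0 < Real.log S.D := Real.log_pos hD1
  have hE : Real.exp (A * Real.log S.D) ≠ 0 := (Real.exp_pos _).ne'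
  have hEC : Real.exp (C * Real.log S.D) ≠ 0 := (Real.exp_pos _).ne'
  have hL : Real.log S.D ^ 519 ≠ 0 := pow_ne_zero _ hlog.ne'
  have ht0' : Real.exp (C * Real.log S.D) * Real.log S.D ^ 519 ≠ 0 := mul_ne_zero hEC hL
  have h2π : (2 * π : ℝ) ≠ 0 := by positivity
  rw [LRefl, P, hP, ht0, Real.log_div (mul_ne_zero (mul_ne_zero hE hD0.ne') ht0') h2π,
    Real.log_mul (mul_ne_zero hE hD0.ne') ht0', Real.log_mul hE hD0.ne', Real.log_mul hEC hL,
    Real.log_exp, Real.log_exp, Real.log_pow]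
  push_cast
  ring

/-- In the `C`-regime, `L_Δ(P) = (A+½+C)·log D + 519·log log D` (`D ≥ 2`). [cite: Zhang2022LandauSiegel, §2 (2.6), (2.8), (2.10)] -/
theorem IsEllRegimePC.LDelta_P (h : S.IsEllRegimePC A C) (hD : 2 ≤ S.D) :
    S.LDelta S.P = (A + 1 / 2 + C) * Real.log S.D + 519 * Real.log (Real.log S.D) := by
  obtain ⟨hP, ht0, -, -, -⟩ := h
  have hD1 : (1 : ℝ) < S.D := by exact_mod_cast lt_of_lt_of_le one_lt_two hD
  have hD0 : (0 : ℝ) < S.D := lt_trans zero_lt_one hD1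
  have hlog : 0 < Real.log S.D := Real.log_pos hD1
  have hE : Real.exp (A * Real.log S.D) ≠ 0 := (Real.exp_pos _).ne'
  have hEC : Real.exp (C * Real.log S.D) ≠ 0 := (Real.exp_pos _).ne'
  have hL : Real.log S.D ^ 519 ≠ 0 := pow_ne_zero _ hlog.ne'
  have ht0' : Real.exp (C * Real.log S.D) * Real.log S.D ^ 519 ≠ 0 := mul_ne_zero hEC hL
  have hsq : Real.sqrt (S.D : ℝ) ≠ 0 := Real.sqrt_ne_zero'.mpr hD0
  rw [LDelta, P, hP, ht0, Real.log_mul (mul_ne_zero hE hsq) ht0', Real.log_mul hE hsq, Real.log_mul hEC hL,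
    Real.log_exp, Real.log_exp, Real.log_sqrt hD0.le, Real.log_pow]
  push_cast
  ring

/-- `ℓ(P)` in the `C`-regime. [cite: Zhang2022LandauSiegel, §2 (2.10), (2.30)] -/
theorem IsEllRegimePC.ellP_eq (h : S.IsEllRegimePC A C) (hD : 2 ≤ S.D) :
    S.ellP = ((A + C + 1) * Real.log S.D + 519 * Real.log (Real.log S.D) - Real.log (2 * π)) /
      ((A + C + 1 / 2) * Real.log S.D + 519 * Real.log (Real.log S.D)) := by
  rw [ellP, ell, h.LRefl_P hD, h.LDelta_P hD]
  ring_nf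

/-- `L_M/L_R(P)` in the `C`-regime. [cite: Zhang2022LandauSiegel, §2 (2.6), (2.30)] -/
theorem IsEllRegimePC.shrink_eq (h : S.IsEllRegimePC A C) (hD : 2 ≤ S.D) :
    S.shrink = (A / (A + C)) * ((A + C) * Real.log S.D /
      ((A + C + 1) * Real.log S.D + 519 * Real.log (Real.log S.D) - Real.log (2 * π))) ∨ A + C = 0 := by
  by_cases hAC : A + C = 0
  · exact Or.inr hAC
  · left
    rw [shrink, h.LRefl_P hD, h.1]
    have : (A + 1 + C) = (A + C + 1) := by ring
    rw [this, ← mul_div_assoc, ← mul_assoc, div_mul_cancel₀ _ hAC]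

/-- **The `C`-regime point converges**: `ℓ(P) → (A+C+1)/(A+C+½) = 1 + 1/(2A+1+2C)` (`= ε(A)` with `τ₀ = 2C`)
and `L_M/L_R → A/(A+C+1)`; for every `δ > 0` both are within `δ` at every record of the `C`-regime with
`D ≥ D₁`. [cite: Zhang2022LandauSiegel, §2 (2.10), (2.30)] -/
theorem eventually_ellP_shrink_nearC (hA : 0 < A) (hC : 0 ≤ C) {δ : ℝ} (hδ : 0 < δ) :
    ∃ D₁ : ℕ, ∀ S : Scales, D₁ ≤ S.D → S.IsEllRegimePC A C →
      |S.ellP - (A + C + 1) / (A + C + 1 / 2)| < δ ∧ |S.shrink - A / (A + C + 1)| < δ := by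
  have hAC : 0 < A + C := by linarith
  have hlog : Tendsto (fun D : ℕ => Real.log (D : ℝ)) atTop atTop :=
    Real.tendsto_log_atTop.comp tendsto_natCast_atTop_atTop
  have h2 : Tendsto (fun u : ℝ => (A / (A + C)) * ((A + C) * u /
      ((A + C + 1) * u + 519 * Real.log u - Real.log (2 * π)))) atTop (nhds ((A / (A + C)) * ((A + C) / (A + C + 1)))) :=
    (tendsto_shrinkRatio hAC).const_mul _
  have hlim2 : (A / (A + C)) * ((A + C) / (A + C + 1)) = A / (A + C + 1) := by
    field_simp
  rw [hlim2] at h2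
  obtain ⟨N₁, hN₁⟩ := Metric.tendsto_atTop.mp ((tendsto_ellRatio hAC).comp hlog) δ hδ
  obtain ⟨N₂, hN₂⟩ := Metric.tendsto_atTop.mp (h2.comp hlog) δ hδ
  refine ⟨max (max N₁ N₂) 2, fun S hD h => ?_⟩
  have hD2 : 2 ≤ S.D := le_trans (le_max_right _ _) hD
  have hD₁ : N₁ ≤ S.D := le_trans (le_trans (le_max_left _ _) (le_max_left _ _)) hD
  have hD₂ : N₂ ≤ S.D := le_trans (le_trans (le_max_right _ _) (le_max_left _ _)) hD
  refine ⟨?_, ?_⟩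
  · rw [h.ellP_eq hD2]
    simpa [Function.comp, Real.dist_eq] using hN₁ S.D hD₁
  · rcases h.shrink_eq hD2 with hs | hs
    · rw [hs]
      simpa [Function.comp, Real.dist_eq] using hN₂ S.D hD₂
    · exact absurd hs hAC.ne'

end RegimeLimitsC

end Scales

end EllScales

namespace EllRegime

open EllScales Repair Skeleton

/-- **The PHYSICAL design at scale `S`**: the exponent of `P₂ = P^{ν₂}T⁻¹⁰` (2.21) is `ν₂ − 10τ_T`; every
other coordinate of `θ` is `T`-free.  At print `τ_T = 𝓛^{−7.9}` and the shift is invisible at main order;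
in the regime `T = D^B` it is the first-order design shift `10B/A` (the cell's design family «G4 T-shift»).
[cite: Zhang2022LandauSiegel, §2 (2.21)] -/
def thetaPhys (S : Scales) (θ : Theta) : Theta :=
  { θ with nu2 := θ.nu2 - 10 * S.tauT }

/-- `thetaPhys` only moves `ν₂`, by `−10τ_T`. [cite: Zhang2022LandauSiegel, §2 (2.21)] -/
theorem thetaPhys_nu2 (S : Scales) (θ : Theta) : (thetaPhys S θ).nu2 = θ.nu2 - 10 * S.tauT := rfl

/-- **The design in the REFLECTION frame at scale `S`** (ls-theory's frame rule, 2026-08-26T17:10:30Z (1);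
B-ell D-ell-1a «exact scales»): every `L_M`-length of the physical design — `ν₁`, `ν₂ − 10τ_T`, `ν₃`, `cut₁` —
multiplied by `L_M/L_R(P) = Scales.shrink`; shifts `k` and coefficients `ι` unchanged.  THIS is the design the
`ℓ`-dictionary `mainTermFormEll ℓ(P)` is evaluated on (reflection `R̃` at `y = 1` = `log n = L_R`).
TWIST CONVENTION (stated, on ls-obj-eng-3's FRAME CHECK 2026-08-26T21:32:26Z): keeping `k` unchanged means the
design's twists are quoted in R-LATTICE units (phase `πk` per unit `y = log n/L_R`).  A piece quoted at the
manuscript's `L_M`-frame twist (`(P_j/n)^{ikα}`, `α = π/log P`, (2.23)–(2.25)) re-reads FAITHFULLY in the reflection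
frame with twist `k/shrink` (`rescale r (kappaP ν k) = kappaP (rν) (k/r)`: ls-obj-eng-3's `thetaFrame`,
`thetaFrame_thetaPhys_eq`, `thetaFrame_shrink_eq_thetaRefl_retwisted` in `ObjectiveTwinEllFrameTwist.lean`), i.e.
on `thetaFrame S.shrink (thetaPhys S θ) = {thetaRefl S θ with k_j := k_j/S.shrink}`; the two zeroth-order values differ
at order `1/A` (relative detuning `1 − shrink`), a difference the rows below absorb in their FREE first-order slot
`G₀` — so every row and endgame of this file is convention-proof, while every per-design first-order TABLE must say
which twist units it uses.  The `K₀` rows (`rescale S.shrink (expComb k u)`) are the faithful re-read.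
[cite: Zhang2022LandauSiegel, §2 (2.10), (2.21), (2.23)–(2.25), (2.30); §5 Lemma 5.2] -/
def thetaRefl (S : Scales) (θ : Theta) : Theta :=
  { θ with
    nu1 := S.shrink * θ.nu1
    nu2 := S.shrink * (θ.nu2 - 10 * S.tauT)
    nu3 := S.shrink * θ.nu3
    cut1 := S.shrink * θ.cut1 }

/-- In the frame `L_M = L_R` (`shrink = 1`) the reflection-frame design is the physical design.
[cite: Zhang2022LandauSiegel, §2 (2.10), (2.21)] -/
theorem thetaRefl_of_shrink_eq_one {S : Scales} (h : S.shrink = 1) (θ : Theta) :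
    thetaRefl S θ = thetaPhys S θ := by
  simp [thetaRefl, thetaPhys, h]

/-! ## Part 1 — registry row E-027: the printed `T`-occurrences as exponent constraints -/

/-- **E-027, the constraint list `TExponentConstraints θ τ_T τ_{t₀} τ_{Dt₀}`**: the conjunction of the
manuscript's PRINTED hypotheses in which `T` occurs, written in the design exponents `(ν₁, ν₂, ν₃, cut₁)` of
`Repair.Theta` and the regime exponents `τ_T = log T/log P`, `τ_{t₀} = log t₀/log P`, `τ_{Dt₀} = log(Dt₀)/log P`
(PHYSICAL exponent of `P₂`: `ν₂ − 10τ_T`):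
(T-i) the ordering `P₃ ≤ P₂ = P^{ν₂}T⁻¹⁰` of (2.21) [tex l.574–576; ELL-CENSUS §1 «print-exact ceiling
`T¹⁰ ≤ P^{ν₂−ν₃}`»]: `ν₃ ≤ ν₂ − 10τ_T`;
(T-ii) (7.2) «`a(n) = 0` for `n ≥ PT⁻²`» for each single polynomial of Prop. 7.1 [l.1813–1815; PARAMS §7 (vi),
KS2 §D′ (R-b) per sequence]: `ν₁ < 1 − 2τ_T`, `ν₂ − 10τ_T < 1 − 2τ_T`, `ν₃ < 1 − 2τ_T`;
(T-iii) (15.2) «`b(n) = 0` for `n > PT⁻²η₊`», `b` = coefficients of `B = (H₁₄ + ι₂H₁₂)H₂` supported below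
`max(P^{cut₁}, P₂)·max(P₃, P₂)` [l.3984; PARAMS §7 (i): `2ν₂ ≤ 1 + 18τ_T` and `cut₁ + ν₂ ≤ 1 + 8τ_T`]:
`max(cut₁, ν₂ − 10τ_T) + max(ν₃, ν₂ − 10τ_T) ≤ 1 − 2τ_T`;
(T-iv) (14.2) «`a*(n) = 0` for `n > 2P₄`», `P₄ = PT⁻²t₀`, `a* = b` [l.3831; KS2 §D′ wall (R-a)]: the same
support `≤ 1 − 2τ_T + τ_{t₀}` (implied by (T-iii) when `τ_{t₀} ≥ 0`; kept because it is the printed wall);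
(T-v) Lemma 12.3's range `P″₁ = P^{1−ν₁}Dt₀ < dr < P₂` non-empty [l.3556; PARAMS §7 (iii), KS2 §D′ (R-e)]:
`1 + 10τ_T + τ_{Dt₀} < ν₁ + ν₂`.
The `T`-FREE side conditions (`ν₃ < ν₂ < ν₁`, `cut₁ + ν₃ < 1`, the shift box `0 < k < 5`, …) are
`Repair.AdmissibleTheta`'s business and are NOT repeated; the internal summation-range facts with `T` that
constrain no design exponent (PARAMS §7 (vii): `dk < 2P₄`, `P₄/d > T`, `n₁ < T`, `dl < P₂²`) belong to the
(T)-class floors (registry E-026) and are NOT listed.  Registry: E-027 («which printed steps force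
`T ≤ P^{2·10⁻⁴}` and is `T = D^B`, `B > ½` admissible at `A ∈ [900, 1700]`?»; price M, decisive — ls-ref-1
VERDICTS.md §3).  A DEFINITION (a predicate); nothing is asserted.
[cite: Zhang2022LandauSiegel, §2 (2.21); §7 (7.2); §12 Lemma 12.3; §14 (14.2); §15 (15.2)] -/
def TExponentConstraints (θ : Theta) (τT τt0 τDt0 : ℝ) : Prop :=
  θ.nu3 ≤ θ.nu2 - 10 * τT ∧
  (θ.nu1 < 1 - 2 * τT ∧ θ.nu2 - 10 * τT < 1 - 2 * τT ∧ θ.nu3 < 1 - 2 * τT) ∧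
  max θ.cut1 (θ.nu2 - 10 * τT) + max θ.nu3 (θ.nu2 - 10 * τT) ≤ 1 - 2 * τT ∧
  max θ.cut1 (θ.nu2 - 10 * τT) + max θ.nu3 (θ.nu2 - 10 * τT) ≤ 1 - 2 * τT + τt0 ∧
  1 + 10 * τT + τDt0 < θ.nu1 + θ.nu2

/-- E-027 at a scale record: `TExponentConstraints θ τ_T(S) τ_{t₀}(S) α̃(S)` (`α̃ = log(Dt₀)/log P = τ_{Dt₀}`).
[cite: Zhang2022LandauSiegel, §2 (2.21), (2.30); §7 (7.2); §14 (14.2); §15 (15.2)] -/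
def TExponentConstraintsAt (S : Scales) (θ : Theta) : Prop :=
  TExponentConstraints θ S.tauT S.taut0 S.alphaTilde

/-- **E-027, the named question «is `B > ½` free?»** for the design `θ` at `P = D^A` with `t₀ = P^{τ_{t₀}}`:
some `B > ½` satisfies every printed `T`-constraint at `τ_T = B/A`, `τ_{Dt₀} = 1/A + τ_{t₀}`
(`log(Dt₀)/log P = (log D + log t₀)/(A log D)`).  Registry E-027; a DEFINITION, asserted for no `θ`.
[cite: Zhang2022LandauSiegel, §2 (2.21); §7 (7.2); §12 Lemma 12.3; §14 (14.2); §15 (15.2)] -/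
def BFreeAboveHalf (θ : Theta) (A τt0 : ℝ) : Prop :=
  ∃ B : ℝ, 1 / 2 < B ∧ TExponentConstraints θ (B / A) τt0 (1 / A + τt0)

/-- **Bookkeeping (T-i): the `T`-power of `P₂` is paid out of the gap `ν₂ − ν₃`** — `10τ_T ≤ ν₂ − ν₃`
(`Repair.Theta.s23`).  [cite: Zhang2022LandauSiegel, §2 (2.21)] -/
theorem tExponentConstraints_gap {θ : Theta} {τT τt0 τDt0 : ℝ}
    (h : TExponentConstraints θ τT τt0 τDt0) : 10 * τT ≤ θ.s23 := by
  obtain ⟨h1, -⟩ := h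
  unfold Theta.s23
  linarith

/-- **E-027's decisive arithmetic, kernel-checked: `B > ½` is admissible only if `A·(ν₂ − ν₃) > 5`**
(from (T-i) alone: `10B/A ≤ ν₂ − ν₃` with `B > ½`).  For the cell's tie family this is the planner's
«`δ·A > 10`-type» squeeze (B-ell/PLAN §1); the other four conjuncts can only shrink the admissible set.
[cite: Zhang2022LandauSiegel, §2 (2.21)] -/
theorem bFreeAboveHalf_lower_bound {θ : Theta} {A τt0 : ℝ} (h : BFreeAboveHalf θ A τt0) (hA : 0 < A) :
    5 < A * θ.s23 := by
  obtain ⟨B, hB, hT⟩ := h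
  have hgap := tExponentConstraints_gap hT
  -- `10·(B/A) ≤ s23`, so `10B ≤ A·s23`, and `10B > 5`.
  have h10 : 10 * B ≤ A * θ.s23 := by
    have := mul_le_mul_of_nonneg_left hgap hA.le
    calc 10 * B = A * (10 * (B / A)) := by field_simp
      _ ≤ A * θ.s23 := this
  linarith

/-- **At the PRINTED exponents** (`Repair.theta0`: `ν₂ − ν₃ = 0.5 − 0.498 = 0.002`) the `B > ½` sheet needs
`A > 2500` — the ELL-CENSUS v1.0 «print-exact ceiling `B ≤ 2·10⁻⁴A`» / «`A > 2500`» as a theorem of the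
typed constraint list (census: DESK; here: kernel).  The same bound holds for every design with the
printed gap `ν₂ − ν₃ = 1/500`. [cite: Zhang2022LandauSiegel, §2 (2.21)] -/
theorem bFreeAboveHalf_theta0 {θ : Theta} (hgap : θ.s23 = 1 / 500) {A τt0 : ℝ}
    (h : BFreeAboveHalf θ A τt0) (hA : 0 < A) : 2500 < A := by
  have := bFreeAboveHalf_lower_bound h hA
  rw [hgap] at this
  linarith

/-- `Repair.theta0` has the printed gap `ν₂ − ν₃ = 1/500`. [cite: Zhang2022LandauSiegel, §2 (2.21)] -/
theorem theta0_s23 : theta0.s23 = 1 / 500 := by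
  unfold Theta.s23 theta0
  norm_num

/-- **… and conversely: for the printed design `θ₀` the `B > ½` sheet is EXACTLY `A > 2500`** (at
`τ_{t₀} = 0`): for `A > 2500` the value `B = ¼ + A/10⁴ ∈ (½, A/5000)` satisfies all five printed
`T`-constraints (`10B/A < 0.002 = ν₂ − ν₃`, `2B/A < 4·10⁻⁴`, `10B/A + 1/A < 0.004 = ν₁ + ν₂ − 1`).  So, for
`θ₀`, E-027's question «is `B > ½` admissible at `A ∈ [900, 1700]`?» has the kernel answer NO, and YES from
`A > 2500` on. [cite: Zhang2022LandauSiegel, §2 (2.21); §7 (7.2); §12 Lemma 12.3; §14 (14.2); §15 (15.2)] -/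
theorem bFreeAboveHalf_theta0_iff {A : ℝ} (hA : 0 < A) : BFreeAboveHalf theta0 A 0 ↔ 2500 < A := by
  refine ⟨fun h => bFreeAboveHalf_theta0 theta0_s23 h hA, fun h => ?_⟩
  refine ⟨1 / 4 + A / 10000, by linarith, ?_⟩
  -- work with `u = 1/A ∈ (0, 1/2500)`
  have hu : 0 < 1 / A := by positivity
  have hu' : 1 / A < 1 / 2500 := one_div_lt_one_div_of_lt (by norm_num) h
  have hBA : (1 / 4 + A / 10000) / A = (1 / A) / 4 + 1 / 10000 := by
    field_simp
  unfold TExponentConstraints theta0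
  simp only
  rw [hBA]
  set u : ℝ := 1 / A with hu_def
  have hm1 : max (0.5 : ℝ) (0.5 - 10 * (u / 4 + 1 / 10000)) = 0.5 := by
    apply max_eq_left; linarith
  have hm2 : max (0.498 : ℝ) (0.5 - 10 * (u / 4 + 1 / 10000)) = 0.5 - 10 * (u / 4 + 1 / 10000) := by
    apply max_eq_right; linarith
  rw [hm1, hm2]
  refine ⟨?_, ⟨?_, ?_, ?_⟩, ?_, ?_, ?_⟩ <;> norm_num <;> linarith

/-! ## Part 2 — registry row E-020 (alias E-007Z): the zero model at fixed `A` -/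

section ZeroModel

variable {D : ℕ} [NeZero D] (χ : DirichletCharacter ℂ D)

/-- SHAPE **«on the line and simple»** at scale `S` on the sub-family `F` — Prop. 2.2 (i)(ii) read at free
scales: every zero of `L(s,ψ)L(s,ψχ)` in the window (`EllScales.prodZeroSet`) has `Re ρ = ½` and is simple.
(Body = ls-knife-typer-2's kit `Shapes.OnLineSimple`, cell landau-siegel HOME/ls-knife-typer-2/EllKitB.lean.)
[cite: Zhang2022LandauSiegel, §2 Prop. 2.2 (i)(ii)] -/
def OnLineSimple (S : Scales) (F : Finset (Chr S)) : Prop :=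
  ∀ x ∈ F, ∀ ρ ∈ prodZeroSet χ x, ρ.re = 1 / 2 ∧ deriv (fun w => x.L w * x.Lchi χ w) ρ ≠ 0

/-- SHAPE **«zero-gap model with precision `c/A`»** at scale `S` on `F` — Prop. 2.2 (iii) («for consecutive
zeros `½ + iγ`, `½ + iγ′`: `|γ′ − γ − α| < c′α²𝓛`», encoding of «consecutive» as in `Skeleton.Prop22iii`) read
at free scales with the zero-spacing unit `π/L_Δ(p)` (`Scales.LDelta`; (2.10): gap `≃ 2π/log(Dp²t₀²)`) and
RELATIVE precision `c/A`, `A = Scales.A`.  (Body = ls-knife-typer-2's kit `Shapes.ZeroModel`.)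
[cite: Zhang2022LandauSiegel, §2 Prop. 2.2 (iii), (2.10)] -/
def ZeroGapModel (c : ℝ) (S : Scales) (F : Finset (Chr S)) : Prop :=
  ∀ x ∈ F, ∀ ρ ∈ prodZeroSet χ x, ∀ ρ' ∈ prodZeroSet χ x, ρ.im < ρ'.im →
    (∀ ρ'' ∈ prodZeroSet χ x, ¬ (ρ.im < ρ''.im ∧ ρ''.im < ρ'.im)) →
      |ρ'.im - ρ.im - π / S.LDelta x.p| ≤ c / S.A * (π / S.LDelta x.p)

/-- SHAPE **«the sub-family is dense»** — Prop. 2.1 at scale `S`: «Let `Ψ₂` be the complement of `Ψ₁` in `Ψ`.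
If (A) holds, then `Σ_{ψ∈Ψ₂} 1 ≪ 𝔓𝓛⁻⁷³⁹`»: `F ⊆ Ψ` misses at most `C·𝔓·𝓛⁻⁷³⁹` members (`Chr S` is finite,
`EllScales.Chr.finite`; `𝔓 = Scales.frakP`, `𝓛 = log D`). [cite: Zhang2022LandauSiegel, §2 Prop. 2.1] -/
def SubfamilyDense (S : Scales) (F : Finset (Chr S)) (C : ℝ) : Prop :=
  (Nat.card (Chr S) : ℝ) - (F.card : ℝ) ≤ C * S.frakP / Real.log S.D ^ 739

end ZeroModel

/-- **E-020 «EllZeroModelFixedA (c_Z, A₀)»** (registry E-020 = alias E-007Z; half of the custodians'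
sketch `EStarEll c A₀`, LEVERS §2): for a SELECTED sub-family `Fam S ⊆ Ψ` at each scale record — the
free-scale stand-in for `Ψ₁` of §3, whose defining inequalities (3.4)–(3.6) carry pinned exponents — and
every `A ≥ A₀`: eventually in `D` (Skeleton's `ForAllLarge`: all real primitive `χ (mod D)`, `D ≥ D₀(A)`),
under (A), at EVERY scale record with `log P = A·log D` (secondary scales pinned), the sub-family is dense
(Prop. 2.1 shape, one absolute `C`), its product zeros are on the line and simple (Prop. 2.2 (i)(ii)), and
consecutive ones obey the gap model with relative precision `c_Z/A` in units `π/L_Δ` (Prop. 2.2 (iii) re-read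
at `P = D^A`).  Status: derivation target, in print only at the pinned scales (`Skeleton.Prop21/Prop22`);
failing range `A < A₀` (custodians: `A₀^{(Z)} ≈ 920`, HEURISTIC); price L (→ M) [ls-ref-1 VERDICTS.md §3].
A DEFINITION; asserted by no one. [cite: Zhang2022LandauSiegel, §2 Prop. 2.1, Prop. 2.2, (2.10)] -/
def EllZeroModelFixedA (Fam : (S : Scales) → Finset (Chr S)) (cZ A₀ : ℝ) : Prop :=
  ∃ C : ℝ, ∀ A : ℝ, A₀ ≤ A →
    ForAllLarge fun D _ χ => AssumptionA D χ →
      ∀ S : Scales, S.D = D → S.IsEllRegimeP A →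
        SubfamilyDense S (Fam S) C ∧ OnLineSimple χ S (Fam S) ∧ ZeroGapModel χ cZ S (Fam S)

/-! ## Part 3 — registry row E-022 (alias dict-1): the first-order main-term dictionary -/

section Dictionary

variable {D : ℕ} [NeZero D] (χ : DirichletCharacter ℂ D)

/-- **`Z(s,ψχ)` at scale `S`**: the root-number factor of the functional equation (2.2) for `ψχ (mod Dp)`
(`GammaFactor.Zfac`, as `Skeleton.Zpc`; the character built as in `EllScales.Chr.Lchi`).
[cite: Zhang2022LandauSiegel, §2 (2.2)] -/
def ZAt {S : Scales} (x : Chr S) (s : ℂ) : ℂ :=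
  haveI : NeZero (D * x.p) := ⟨mul_ne_zero (NeZero.ne D) x.prime.ne_zero⟩
  GammaFactor.Zfac (DirichletCharacter.changeLevel (dvd_mul_right D x.p) χ *
    DirichletCharacter.changeLevel (dvd_mul_left x.p D) x.ψ) s

/-- **`H₁(s,ψ)` at scale `S` for the design `θ`** ((2.23), (2.24), (2.27)): `Σ_{n<P^{ν₁}} ψχ(n)𝔥₁(log n/log P)n^{−s}`
with the physical side-1 profile `𝔥₁ = ϰ_{ν₁,k₁} + ι₂ϰ_{ν₂−10τ_T,k₂}` (`Repair.h1Profile (thetaPhys S θ)`;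
`ϰ_{ν,k}(y) = (1 − y/ν)e^{iπk(ν−y)}𝟙_{y≤ν}` = the coefficient `(1 − log n/log P_j)(P_j/n)^{ikα}` of (8.6), so the
shorter component self-truncates at `P₂ = P^{ν₂}T⁻¹⁰`).  At the pinned scales and `θ = θ₀` this is
`Skeleton.H1` up to the invisible `T`-shift. [cite: Zhang2022LandauSiegel, §2 (2.23), (2.24), (2.27); §8 (8.6)] -/
def H1At (S : Scales) (θ : Theta) (x : Chr S) (s : ℂ) : ℂ :=
  profPoly χ x (h1Profile (thetaPhys S θ)) ⌈S.P ^ θ.nu1⌉₊ s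

/-- **`H₂(s,ψ)` at scale `S` for the design `θ`** ((2.24), (2.25), (2.27)): `Σ_{n<P₂} ψχ(n)𝔥₂(log n/log P)n^{−s}`,
`𝔥₂ = ῑ₄ϰ_{ν₂−10τ_T,k₂} + ῑ₃ϰ_{ν₃,k₃}` (`Repair.h2Profile (thetaPhys S θ)`), length `P₂ = P^{ν₂−10τ_T}`.
[cite: Zhang2022LandauSiegel, §2 (2.24), (2.25), (2.27); §8 (8.6)] -/
def H2At (S : Scales) (θ : Theta) (x : Chr S) (s : ℂ) : ℂ :=
  profPoly χ x (h2Profile (thetaPhys S θ)) ⌈S.P ^ (θ.nu2 - 10 * S.tauT)⌉₊ s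

/-- **`Ξ₁₁/(𝔞𝔓)` at scale `S` on `F`** — the normalised discrete mean of `|H₁|²` ((8.3); `EllScales.discMean`,
`normaliser = 𝔞·𝔓`). [cite: Zhang2022LandauSiegel, §8 (8.3); §2 (2.31)] -/
def diagMean1 (c' : ℝ) (S : Scales) (F : Finset (Chr S)) (θ : Theta) : ℝ :=
  discMean c' S F (H1At χ S θ) / normaliser χ S

/-- **`Ξ₁₂/(𝔞𝔓)` at scale `S` on `F`** — the normalised discrete mean of `|H₂|²` ((8.4)).
[cite: Zhang2022LandauSiegel, §8 (8.4); §2 (2.31)] -/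
def diagMean2 (c' : ℝ) (S : Scales) (F : Finset (Chr S)) (θ : Theta) : ℝ :=
  discMean c' S F (H2At χ S θ) / normaliser χ S

/-- **`Ξ₁₃` at scale `S` on `F`**: `Σ_{ψ∈F} Σ_{ρ∈𝔷(ψ)} 𝔠*(ρ,ψ)·Z(ρ,ψχ)⁻¹·H₁(ρ,ψ)H₂(ρ,ψ)·ω(ρ)` ((8.5); the shape
of `Skeleton.xi13`). [cite: Zhang2022LandauSiegel, §8 (8.5)] -/
def crossSum (c' : ℝ) (S : Scales) (F : Finset (Chr S)) (θ : Theta) : ℂ :=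
  ∑ x ∈ F, ∑ ρ ∈ Skeleton.finsetOf (zeroSet x),
    cstar c' S x ρ * (ZAt χ x ρ)⁻¹ * (H1At χ S θ x ρ * H2At χ S θ x ρ) * omegaW S ρ

/-- **`2Re(Ξ₁₃/(𝔞𝔓))` at scale `S` on `F`** — the cross block as it enters the §18 total
`𝔠₁ + 𝔠₂ + 2Re 𝔠₃` ((18.1), (2.32)). [cite: Zhang2022LandauSiegel, §8 (8.5); §18 (18.1)] -/
def crossMean2Re (c' : ℝ) (S : Scales) (F : Finset (Chr S)) (θ : Theta) : ℝ :=
  2 * (crossSum χ c' S F θ / (normaliser χ S : ℂ)).re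

end Dictionary

/-- **The `ℓ`-dictionary, block 1**: `F_ℓ` on the side-1 profile `𝔥₁` (`mainTermFormEll ℓ (h1Profile θ)`;
at `ℓ = 1` the class-`R` dictionary value of `Ξ₁₁/(𝔞𝔓)`, (8.23)).  Convention of record of the cell for «the
`F_ℓ` blocks» (polar blocks of `F_ℓ` on the split `𝔤_θ = 𝔥₁ + R̃𝔥₂`). [cite: Zhang2022LandauSiegel, §8 (8.23); §2 (2.10)] -/
def ellBlock1 (ℓ : ℝ) (θ : Theta) : ℝ :=
  mainTermFormEll ℓ (h1Profile θ) (h1Profile' θ)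

/-- **The `ℓ`-dictionary, block 2**: `F_ℓ` on the REFLECTED side-2 profile `R̃𝔥₂` (`Repair.reflProfile`; at
`ℓ = 1` the dictionary value of `Ξ₁₂/(𝔞𝔓)`, (9.7), by the reflection invariance of `𝔅`).
[cite: Zhang2022LandauSiegel, §9 (9.7); §2 (2.10), (2.32)] -/
def ellBlock2 (ℓ : ℝ) (θ : Theta) : ℝ :=
  mainTermFormEll ℓ (reflProfile (h2Profile θ)) (reflDeriv (h2Profile' θ))

/-- **The `ℓ`-dictionary, cross block `2Re 𝔠₃^{(ℓ)}`** by polarisation of `F_ℓ` on the glued profile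
`𝔤_θ = 𝔥₁ + R̃𝔥₂` (`Repair.gluedS`): `F_ℓ(𝔤_θ) − F_ℓ(𝔥₁) − F_ℓ(R̃𝔥₂)` (at `ℓ = 1`: `2Re` of the cross slot of
record `Repair.frakc3S`, (18.1)). [cite: Zhang2022LandauSiegel, §18 (18.1); §2 (2.32)] -/
def ellCross2Re (ℓ : ℝ) (θ : Theta) : ℝ :=
  mainTermFormEll ℓ (gluedS θ) (gluedS' θ) - ellBlock1 ℓ θ - ellBlock2 ℓ θ

/-- **The dictionary inequalities at one scale record** (the common body of E-022's forms): on the sub-family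
`F`, the three normalised discrete means of the physical design `thetaPhys S θ` (`Ξ₁₁/(𝔞𝔓)`, `Ξ₁₂/(𝔞𝔓)`,
`2Re Ξ₁₃/(𝔞𝔓)`) differ from their `ℓ`-dictionary blocks — `F_ℓ` at `ℓ = ℓ(P)` on the REFLECTION-FRAME design
`thetaRefl S θ` (frame rule) — PLUS the first-order terms `g_j/A`, by at most `K/A²`.
[cite: Zhang2022LandauSiegel, §8 (8.23), (8.3)–(8.5); §9 (9.7); §18 (18.1); §2 (2.10), (2.32)] -/
def DictAt {D : ℕ} [NeZero D] (χ : DirichletCharacter ℂ D) (c' : ℝ) (S : Scales) (F : Finset (Chr S))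
    (θ : Theta) (g₁ g₂ g₃ K A : ℝ) : Prop :=
  |diagMean1 χ c' S F θ - (ellBlock1 S.ellP (thetaRefl S θ) + g₁ / A)| ≤ K / A ^ 2 ∧
  |diagMean2 χ c' S F θ - (ellBlock2 S.ellP (thetaRefl S θ) + g₂ / A)| ≤ K / A ^ 2 ∧
  |crossMean2Re χ c' S F θ - (ellCross2Re S.ellP (thetaRefl S θ) + g₃ / A)| ≤ K / A ^ 2

/-- **E-022 «EllDictFirstOrder (G, K)»** (registry E-022 = alias dict-1; companion of the definition request
D-ell-1 «the functional `G`»): for every design `θ` of the class `Adm` (the registry's designs are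
`Repair.AdmissibleTheta`-type records), every `A ≥ A₀` and every `B`: eventually in `D`, under (A), at every
scale record of the regime `(D^A, D^B)`, on the selected sub-family `Fam S`, the three normalised discrete
means of the PHYSICAL design equal their `ℓ`-dictionary blocks at `ℓ = ℓ(P)` — evaluated on the
REFLECTION-FRAME design `thetaRefl S θ` (ls-theory's frame rule of record, 2026-08-26T17:10:30Z (1): lengths
`× L_M/L_R`, a same-order-as-`ε` term that must not be dropped) — PLUS an explicit first-order term
`G_j(θ,B)/A`, up to `K(θ,B)/A²` (`DictAt`):
`|Ξ₁₁/(𝔞𝔓) − (F_ℓ-block₁ + G₁/A)| ≤ K/A²`, `|Ξ₁₂/(𝔞𝔓) − (F_ℓ-block₂ + G₂/A)| ≤ K/A²`,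
`|2Re Ξ₁₃/(𝔞𝔓) − (F_ℓ-cross + G₃/A)| ≤ K/A²`.
`G = (G₁, G₂, G₃)` and `K` are VISIBLE PARAMETERS (functions of the design and of `B`): the registry's
first-order sources (three log-scales `L_M/L_Δ/L_R`, residue weights at `jℓ_Δ`, the detuned shifts (2.13),
Lemma 2.3's sign pattern at `ℓ_Δ ≠ 1`, first-order zero displacement under (A) — ls-theory 17:10:30Z (2)(a)–(g))
are what a derivation of `G` must itemise — «the Prop must make `G`'s slot visible» (planner, TYPING ORDER v2).
This is the `λ`-FREE form (`= EllDictFirstOrderLam … G 0 0`, `ellDictFirstOrderLam_zero_iff`); theory's ruling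
Q3/(2)(e) (the dipole term carries an ADVERSARIAL `λ(χ) = (H′/H)(1,χ)/log D`, `|λ| ≤ Λ`) is the form
`EllDictFirstOrderLam`.  The pinned-scale, zeroth-order ancestors are `Skeleton.Eval823`, `Eval97`, `Eval181`.
Status: derivation, not started; price L / S-numerics under evidence (i)–(iii) [ls-ref-1 VERDICTS.md §3].
A DEFINITION; asserted for no `(G, K)`.
[cite: Zhang2022LandauSiegel, §8 (8.23), (8.3)–(8.5); §9 (9.7); §18 (18.1); §2 (2.10), (2.13), (2.32)] -/
def EllDictFirstOrder (c' : ℝ) (Fam : (S : Scales) → Finset (Chr S)) (Adm : Theta → Prop)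
    (G : Theta → ℝ → ℝ × ℝ × ℝ) (K : Theta → ℝ → ℝ) (A₀ : ℝ) : Prop :=
  ∀ θ : Theta, Adm θ → ∀ A B : ℝ, A₀ ≤ A →
    ForAllLarge fun D _ χ => AssumptionA D χ →
      ∀ S : Scales, S.D = D → S.IsEllRegime A B →
        DictAt χ c' S (Fam S) θ (G θ B).1 (G θ B).2.1 (G θ B).2.2 (K θ B) A

/-- **E-022 in ls-theory's `λ`-form «dict-1 = explicit `G₀(d) + λ·G₁(d)`, `|λ| ≤ Λ`»** (rulings Q3 16:51:20Z and
17:10:30Z (2)(e): the dipole displays' first-order correction carries `λ(χ) := (H′/H)(1,χ)/log D`,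
`H(s) = L(s,χ)/(s − β₁)`, an `O(1)` parameter set by the low zeros of `L(s,χ)` — bounded (`|λ| ≤ Λ`, zero counting
+ Deuring–Heilbronn repulsion under (A)), NOT small, and acting on the diagonal blocks too): as
`EllDictFirstOrder`, but the first-order triple is `G₀(θ,B) + λ·G₁(θ,B)` for SOME `λ = λ(D,χ)` with `|λ| ≤ Λ`
(the existential sits inside the standing quantifier, after `χ`).  The planner's decision test reads
«closes iff `sup_{|λ|≤Λ} hi(OBJ(d,A;λ)) < 0`» against this form.  A DEFINITION; asserted for no `(G₀, G₁, Λ, K)`.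
[cite: Zhang2022LandauSiegel, §8 (8.23), Lemmas 8.2–8.4; §4 Lemma 4.7, (4.10); §2 (2.13)] -/
def EllDictFirstOrderLam (c' : ℝ) (Fam : (S : Scales) → Finset (Chr S)) (Adm : Theta → Prop)
    (G₀ G₁ : Theta → ℝ → ℝ × ℝ × ℝ) (Λ : ℝ) (K : Theta → ℝ → ℝ) (A₀ : ℝ) : Prop :=
  ∀ θ : Theta, Adm θ → ∀ A B : ℝ, A₀ ≤ A →
    ForAllLarge fun D _ χ => AssumptionA D χ → ∃ lam : ℝ, |lam| ≤ Λ ∧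
      ∀ S : Scales, S.D = D → S.IsEllRegime A B →
        DictAt χ c' S (Fam S) θ ((G₀ θ B).1 + lam * (G₁ θ B).1) ((G₀ θ B).2.1 + lam * (G₁ θ B).2.1)
          ((G₀ θ B).2.2 + lam * (G₁ θ B).2.2) (K θ B) A

/-- `Λ = 0` of the `λ`-form is the `λ`-free form with `G = G₀`. [cite: Zhang2022LandauSiegel, §8 (8.23)] -/
theorem ellDictFirstOrderLam_zero_iff {c' : ℝ} {Fam : (S : Scales) → Finset (Chr S)} {Adm : Theta → Prop}
    {G₀ G₁ : Theta → ℝ → ℝ × ℝ × ℝ} {K : Theta → ℝ → ℝ} {A₀ : ℝ} :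
    EllDictFirstOrderLam c' Fam Adm G₀ G₁ 0 K A₀ ↔ EllDictFirstOrder c' Fam Adm G₀ K A₀ := by
  refine ⟨fun h θ hθ A B hA => ?_, fun h θ hθ A B hA => ?_⟩
  · refine (h θ hθ A B hA).mono fun D _ χ _ _ hD hAss => ?_
    obtain ⟨lam, hlam, hS⟩ := hD hAss
    have hl : lam = 0 := abs_nonpos_iff.mp hlam
    subst hl
    simpa only [zero_mul, add_zero] using hS
  · refine (h θ hθ A B hA).mono fun D _ χ _ _ hD hAss => ⟨0, by simp, ?_⟩
    simpa only [zero_mul, add_zero] using hD hAss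

/-! ### E-022 restricted to one-piece profiles: `EllDictFirstOrderProfile`, `EllDictFirstOrderK0` -/

/-- A profile of the `L_M`-frame re-read in the reflection frame: `y ↦ g(y/r)`, `r = L_M/L_R` (support `[0, ν]`
becomes `[0, rν]`). [cite: Zhang2022LandauSiegel, §2 (2.10), (2.30)] -/
def rescale (r : ℝ) (g : ℝ → ℂ) : ℝ → ℂ := fun y => g (y / r)

/-- Right derivative of `rescale r g`: `y ↦ r⁻¹·g′(y/r)`. [cite: Zhang2022LandauSiegel, §2 (2.10), (2.30)] -/
def rescale' (r : ℝ) (g' : ℝ → ℂ) : ℝ → ℂ := fun y => ((1 / r : ℝ) : ℂ) * g' (y / r)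

/-- **The one-piece exponential profile `Σ_j u_j e^{iπk_j(1−y)}𝟙_{y≤1}`** — the manuscript's `ϰ`-components
((2.23)–(2.25): `(P/n)^{ik_jα} = e^{iπk_j(1−y)}`, full length `P`) WITHOUT the tent factor `(1 − y)`; for
`Σ_j u_j = 0` it vanishes at the wall `y = 1` (the cell's «kernel-plane wall-vanishing vectors» `K₀`:
`u ∈ {k₁−k₃, k₁+k₂, k₂+k₃}` name the coefficient patterns of B-ell/designs/ell-K0-pos.json).
[cite: Zhang2022LandauSiegel, §2 (2.23)–(2.25)] -/
def expComb (k : Fin 3 → ℝ) (u : Fin 3 → ℂ) (y : ℝ) : ℂ :=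
  if y ≤ 1 then ∑ j, u j * cexp ((k j : ℂ) * π * I * ((1 - y : ℝ) : ℂ)) else 0

/-- Right derivative of `expComb k u`: `−iπ Σ_j k_j u_j e^{iπk_j(1−y)}` for `y < 1`, `0` for `y ≥ 1`.
[cite: Zhang2022LandauSiegel, §2 (2.23)–(2.25)] -/
def expComb' (k : Fin 3 → ℝ) (u : Fin 3 → ℂ) (y : ℝ) : ℂ :=
  if y < 1 then ∑ j, u j * (-((k j : ℂ) * π * I)) * cexp ((k j : ℂ) * π * I * ((1 - y : ℝ) : ℂ)) else 0

/-- **E-022 for ONE profile `g` of full length `P`** (the shape the `K₀` sub-family needs; no `T`-length, so the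
`P`-side regime `IsEllRegimeP` suffices): for every `A ≥ A₀`, eventually in `D`, under (A), for SOME
`λ = λ(D,χ)` with `|λ| ≤ Λ`, at every scale record with `log P = A·log D`: the normalised discrete mean of the
profile polynomial of length `⌈P⌉` on `Fam S` (`EllScales.profileMean`) equals `F_{ℓ(P)}` of the
reflection-frame profile `rescale (L_M/L_R) g` PLUS `(G₀ + λG₁)/A`, up to `K/A²`.  A DEFINITION; asserted for
no `(g, G₀, G₁, Λ, K)`. [cite: Zhang2022LandauSiegel, §8 (8.23), (8.3); §2 (2.10), (2.23)] -/
def EllDictFirstOrderProfile (c' : ℝ) (Fam : (S : Scales) → Finset (Chr S)) (g g' : ℝ → ℂ)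
    (G₀ G₁ Λ K A₀ : ℝ) : Prop :=
  ∀ A : ℝ, A₀ ≤ A →
    ForAllLarge fun D _ χ => AssumptionA D χ → ∃ lam : ℝ, |lam| ≤ Λ ∧
      ∀ S : Scales, S.D = D → S.IsEllRegimeP A →
        |profileMean χ c' S (Fam S) g ⌈S.P⌉₊ -
            (mainTermFormEll S.ellP (rescale S.shrink g) (rescale' S.shrink g') + (G₀ + lam * G₁) / A)|
          ≤ K / A ^ 2

/-- **E-022∣K₀ «EllDictFirstOrderK0»** (ls-Bell-plan 2026-08-26T17:09:53Z «PRIORITY INSIDE D-ell-1: D-ell-1∣K₀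
FIRST»; ls-lead 17:12:14Z): the first-order dictionary for the one-piece exponential profile `expComb k u`
(shifts `k = (k₁,k₂,k₃)`, coefficient pattern `u ∈ ℂ³`; the three `K₀` patterns have `Σ u_j = 0`), with
constants `G₀, G₁, Λ, K` — «`K₀`-POS closes iff `G₀(u) + λG₁(u) + 〈gain〉 < 0 ∀ |λ| ≤ Λ`» is read against this
`Prop`.  A DEFINITION; asserted for no `(k, u, G₀, G₁, Λ, K)`. [cite: Zhang2022LandauSiegel, §8 (8.23); §2 (2.23)–(2.25)] -/
def EllDictFirstOrderK0 (c' : ℝ) (Fam : (S : Scales) → Finset (Chr S)) (k : Fin 3 → ℝ) (u : Fin 3 → ℂ)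
    (G₀ G₁ Λ K A₀ : ℝ) : Prop :=
  EllDictFirstOrderProfile c' Fam (expComb k u) (expComb' k u) G₀ G₁ Λ K A₀

/-- At `ℓ = 1` the three dictionary blocks sum to the §18 total functional of record
`C₂₃₂(θ) = 𝔅(𝔤_θ)` (`Repair.C232S`) — the block split is a split of the class-`R` dictionary.
[cite: Zhang2022LandauSiegel, §2 (2.32); §18 (18.1)] -/
theorem ellBlocks_one_sum (θ : Theta) :
    ellBlock1 1 θ + ellBlock2 1 θ + ellCross2Re 1 θ = C232S θ := by
  unfold ellCross2Re
  rw [mainTermFormEll_one]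
  unfold C232S
  ring

/-- At every `ℓ` the three blocks sum to the deformed §18 total `C₂₃₂^{(ℓ)}(θ) = F_ℓ(𝔤_θ)` (`C232Ell`,
`MainTermFormEllPolar`). [cite: Zhang2022LandauSiegel, §2 (2.32); §18 (18.1)] -/
theorem ellBlocks_sum (ℓ : ℝ) (θ : Theta) :
    ellBlock1 ℓ θ + ellBlock2 ℓ θ + ellCross2Re ℓ θ = C232Ell ℓ θ := by
  unfold ellCross2Re C232Ell
  ring

/-! ## Part 4 — EDLIST rows ell-E13 «Lemma23FixedA» (positivity at fixed `A`) and ell-E12 = E-058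
«EllZeroFloorRetune» (the zero model with a free window exponent) -/

section Positivity

variable {D : ℕ} [NeZero D] (χ : DirichletCharacter ℂ D)

/-- SHAPE **Lemma 2.3 at scale `S` on the sub-family `F`**: «Suppose `ψ ∈ Ψ₁` and `ρ ∈ 𝔷(ψ)`. Then
`𝔠*(ρ,ψ) ≥ 0`» (with `𝔠*(ρ,ψ) ∈ ℝ` by (2.11)–(2.12)) — the body of `Skeleton.Lemma23` with the pinned `Ψ₁`, `𝔷`
replaced by `F`, `EllScales.zeroSet`. [cite: Zhang2022LandauSiegel, §2 Lemma 2.3, (2.11)–(2.12)] -/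
def Lemma23At (c' : ℝ) (S : Scales) (F : Finset (Chr S)) : Prop :=
  ∀ x ∈ F, ∀ ρ ∈ zeroSet x, (cstar c' S x ρ).im = 0 ∧ 0 ≤ (cstar c' S x ρ).re

/-- SHAPE **non-negative weights** `Re 𝔠*(ρ,ψ)·Re ω(ρ) ≥ 0` at every index of a discrete mean at scale `S` on
`F` (the positivity (B1) of LEVERS §0.6 that makes every `EllScales.discMean` non-negative,
`discMean_nonneg_of_weights`). [cite: Zhang2022LandauSiegel, §2 Lemma 2.3, (2.15)] -/
def WeightsNonnegAt (c' : ℝ) (S : Scales) (F : Finset (Chr S)) : Prop :=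
  ∀ x ∈ F, ∀ ρ ∈ Skeleton.finsetOf (zeroSet x), 0 ≤ (cstar c' S x ρ).re * (omegaW S ρ).re

/-- **ell-E13 «Lemma23FixedA (A₀)»** (B-ell/EDLIST v1.3 row ell-E13, proposed by ls-B-ref-2 REF.md v0 (a); «gate
row on all ELL designs»; pre-price M): under (A), at `P = D^A` for every FIXED `A ≥ A₀` (secondary scales
pinned), eventually in `D`, Lemma 2.3's conclusion holds on the selected sub-family: `𝔠*(ρ,ψ)` is real and
`≥ 0` at every sampled zero.  In print only at the pinned scales (`Skeleton.Lemma23`, from Prop. 2.2 (ii)(iii)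
by two mean-value sign steps, tex l.475–489, l.663–684); failing range `A < A₀` (then every discrete-mean sign
argument at that `A` is void).  Together with `OnLineSimple` it yields `WeightsNonnegAt`
(`weightsNonnegAt_of`), hence the positivity endgame at fixed `A`.  A DEFINITION; asserted by no one.
[cite: Zhang2022LandauSiegel, §2 Lemma 2.3, Prop. 2.2 (ii)(iii)] -/
def Lemma23FixedA (c' : ℝ) (Fam : (S : Scales) → Finset (Chr S)) (A₀ : ℝ) : Prop :=
  ∀ A : ℝ, A₀ ≤ A →
    ForAllLarge fun D _ χ => AssumptionA D χ →
      ∀ S : Scales, S.D = D → S.IsEllRegimeP A → Lemma23At c' S (Fam S)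

variable {χ}

/-- **Lemma 2.3 + Prop. 2.2 (i) give non-negative weights at scale `S`**: a zero of `L(s,ψ)` in the window is a
zero of the product, hence on the line by `OnLineSimple`, where `ω` is a positive real
(`SmoothWeight.omega_re_pos_of_re_eq_half`, (2.15), needs `𝓛₂ > 0`). Free-scale twin of
`KnifeEdge.weights_nonneg_of`. [cite: Zhang2022LandauSiegel, §2 Lemma 2.3, Prop. 2.2 (i), (2.15)] -/
theorem weightsNonnegAt_of {c' : ℝ} {S : Scales} {F : Finset (Chr S)} (hL2 : 0 < S.L2)
    (h23 : Lemma23At c' S F) (h22 : OnLineSimple χ S F) : WeightsNonnegAt c' S F := by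
  intro x hx ρ hρ
  have hz : ρ ∈ zeroSet x := Skeleton.mem_of_mem_finsetOf hρ
  have hprod : ρ ∈ prodZeroSet χ x := by
    obtain ⟨h1, h2, h3⟩ := hz
    exact ⟨h1, h2, by rw [h3, zero_mul]⟩
  have hre : ρ.re = 1 / 2 := (h22 x hx ρ hprod).1
  exact mul_nonneg (h23 x hx ρ hz).2 (SmoothWeight.omega_re_pos_of_re_eq_half hL2 S.t0 hre).1.le

/-- **The positivity (B1) at scale `S`**: with non-negative weights every discrete mean is `≥ 0` — the first
step of the B-ell POS endgame (free-scale twin of `KnifeEdge.discMean_nonneg`).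
[cite: Zhang2022LandauSiegel, §2 Lemma 2.3, (2.15)] -/
theorem discMean_nonneg_of_weights {c' : ℝ} {S : Scales} {F : Finset (Chr S)} (h : WeightsNonnegAt c' S F)
    (u : Chr S → ℂ → ℂ) : 0 ≤ discMean c' S F u := by
  unfold discMean
  refine Finset.sum_nonneg fun x hx => Finset.sum_nonneg fun ρ hρ => ?_
  have hw := h x hx ρ hρ
  calc (0 : ℝ) ≤ (cstar c' S x ρ).re * (omegaW S ρ).re * ‖u x ρ‖ ^ 2 := mul_nonneg hw (by positivity)
    _ = (cstar c' S x ρ).re * ‖u x ρ‖ ^ 2 * (omegaW S ρ).re := by ring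

end Positivity

section ZeroFloor

variable {D : ℕ} [NeZero D] (χ : DirichletCharacter ℂ D)

/-- **E-020 with a FREE window exponent `c₁`** (`𝓛₁ = 𝓛^{c₁}`, regime `IsEllRegimePW`): the zero model at fixed
`A ≥ A₀` exactly as `EllZeroModelFixedA`, at the scale records with `log P = A·log D`, `𝓛₁ = (log D)^{c₁}`,
`t₀, 𝓛₂, η` pinned.  At `c₁ = 405` these are the regime's records (`Scales.isEllRegimePW_405_iff`).
A DEFINITION; asserted by no one. [cite: Zhang2022LandauSiegel, §2 Prop. 2.1, Prop. 2.2, (2.8), (2.10)] -/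
def EllZeroModelFixedAW (Fam : (S : Scales) → Finset (Chr S)) (cZ c₁ A₀ : ℝ) : Prop :=
  ∃ C : ℝ, ∀ A : ℝ, A₀ ≤ A →
    ForAllLarge fun D _ χ => AssumptionA D χ →
      ∀ S : Scales, S.D = D → S.IsEllRegimePW A c₁ →
        SubfamilyDense S (Fam S) C ∧ OnLineSimple χ S (Fam S) ∧ ZeroGapModel χ cZ S (Fam S)

end ZeroFloor

/-- **E-058 «EllZeroFloorRetune `A₀^{(Z)}(c₁)`»** (registry E-058 = B-ell/EDLIST ell-E12; «typer-1 with E-020»;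
price M, ls-ref-1 16:5xZ, with the coupled-exponent table requirement): the SHAPE of the row's deliverable —
a floor function `A₀Z : ℝ → ℝ` and an admissible window-exponent range `I` such that, for every `c₁ ∈ I`, the
zero model with window `𝓛₁ = 𝓛^{c₁}` holds from `A ≥ A₀Z(c₁)` on.  The custodians' heuristic
`A₀^{(Z)}(c₁) ≈ 2.2(c₁ + C + 1)` (`= 920` at the printed `c₁ = 405`) is a CANDIDATE value of `A₀Z`, of record
nowhere in this file; the admissible `I` is what the re-read of every printed use of `𝓛₁` (Gaussian decay of
`ω` on horizontal segments, the §13 window, Lemma 2.3's shifts) must deliver.  A DEFINITION; asserted for no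
`(A₀Z, I)`. [cite: Zhang2022LandauSiegel, §2 Prop. 2.1, Prop. 2.2, (2.8), (2.15); §13] -/
def EllZeroFloorRetune (Fam : (S : Scales) → Finset (Chr S)) (cZ : ℝ) (I : Set ℝ) (A₀Z : ℝ → ℝ) : Prop :=
  ∀ c₁ ∈ I, EllZeroModelFixedAW Fam cZ c₁ (A₀Z c₁)

/-- At the printed window exponent the free-window zero model is E-020's.
[cite: Zhang2022LandauSiegel, §2 Prop. 2.2, (2.8)] -/
theorem ellZeroModelFixedAW_405_iff (Fam : (S : Scales) → Finset (Chr S)) (cZ A₀ : ℝ) :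
    EllZeroModelFixedAW Fam cZ 405 A₀ ↔ EllZeroModelFixedA Fam cZ A₀ := by
  unfold EllZeroModelFixedAW EllZeroModelFixedA
  simp only [Scales.isEllRegimePW_405_iff]

/-! ### PROVED: the weighted discrete Cauchy–Schwarz at scale `S` (free-scale twin of
`KnifeEdge.norm_sq_discPolar_le`, for the tie/CS endgame of ELL designs) -/

section DiscreteCS

variable {D : ℕ} [NeZero D] {χ : DirichletCharacter ℂ D}

/-- SHAPE **real weights**: `𝔠*(ρ,ψ)` and `ω(ρ)` are REAL at every index (Lemma 2.3's `𝔠* ∈ ℝ` by (2.11)–(2.12);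
`ω(ρ) ∈ ℝ` on the line, (2.15)). [cite: Zhang2022LandauSiegel, §2 Lemma 2.3, (2.11)–(2.12), (2.15)] -/
def RealWeightsAt (c' : ℝ) (S : Scales) (F : Finset (Chr S)) : Prop :=
  ∀ x ∈ F, ∀ ρ ∈ Skeleton.finsetOf (zeroSet x), (cstar c' S x ρ).im = 0 ∧ (omegaW S ρ).im = 0

/-- Lemma 2.3 + on-the-line ⇒ real weights (`𝓛₂ > 0`). [cite: Zhang2022LandauSiegel, §2 Lemma 2.3, Prop. 2.2 (i), (2.15)] -/
theorem realWeightsAt_of {c' : ℝ} {S : Scales} {F : Finset (Chr S)} (hL2 : 0 < S.L2)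
    (h23 : Lemma23At c' S F) (h22 : OnLineSimple χ S F) : RealWeightsAt c' S F := by
  intro x hx ρ hρ
  have hz : ρ ∈ zeroSet x := Skeleton.mem_of_mem_finsetOf hρ
  have hprod : ρ ∈ prodZeroSet χ x := by
    obtain ⟨h1, h2, h3⟩ := hz
    exact ⟨h1, h2, by rw [h3, zero_mul]⟩
  exact ⟨(h23 x hx ρ hz).1, (SmoothWeight.omega_re_pos_of_re_eq_half hL2 S.t0 (h22 x hx ρ hprod).1).2⟩

/-- A complex number with zero imaginary part has norm `|re|`. [cite: Zhang2022LandauSiegel, §2 (2.11)] -/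
theorem norm_eq_abs_re_of_im_eq_zero {z : ℂ} (hz : z.im = 0) : ‖z‖ = |z.re| := by
  have : z = ((z.re : ℝ) : ℂ) := Complex.ext (by simp) (by simp [hz])
  rw [this, Complex.norm_real, Real.norm_eq_abs, Complex.ofReal_re]

/-- **Weighted Cauchy–Schwarz for the discrete pairing at scale `S`:** with real, non-negative weights
`Re 𝔠*·Re ω` on `F × zeros`, `‖Σ 𝔠* u v̄ ω‖² ≤ (Σ Re𝔠*‖u‖²Reω)(Σ Re𝔠*‖v‖²Reω)`, i.e.
`‖discPolar u v‖² ≤ discMean u · discMean v` — at EVERY scale record, for arbitrary value tables; no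
asymptotics, no (A).  Free-scale twin of `KnifeEdge.norm_sq_discPolar_le` (B-multi typer-1, p459102).
[cite: Zhang2022LandauSiegel, §2 Lemma 2.3, (2.15)–(2.17)] -/
theorem norm_sq_discPolar_le {c' : ℝ} {S : Scales} {F : Finset (Chr S)} (hw : WeightsNonnegAt c' S F)
    (hr : RealWeightsAt c' S F) (u v : Chr S → ℂ → ℂ) :
    ‖discPolar c' S F u v‖ ^ 2 ≤ discMean c' S F u * discMean c' S F v := by
  set I : Finset ((_ : Chr S) × ℂ) := F.sigma fun x => Skeleton.finsetOf (zeroSet x) with hI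
  set w : ((_ : Chr S) × ℂ) → ℝ := fun i => (cstar c' S i.1 i.2).re * (omegaW S i.2).re with hw_def
  have hwI : ∀ i ∈ I, 0 ≤ w i := fun i hi => by
    obtain ⟨hx, hρ⟩ := Finset.mem_sigma.mp hi
    exact hw i.1 hx i.2 hρ
  have hrI : ∀ i ∈ I, (cstar c' S i.1 i.2).im = 0 ∧ (omegaW S i.2).im = 0 := fun i hi => by
    obtain ⟨hx, hρ⟩ := Finset.mem_sigma.mp hi
    exact hr i.1 hx i.2 hρ
  have hPol : discPolar c' S F u v =
      ∑ i ∈ I, cstar c' S i.1 i.2 * u i.1 i.2 * conj (v i.1 i.2) * omegaW S i.2 := by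
    unfold discPolar
    exact Finset.sum_sigma' _ _ _
  have hMu : discMean c' S F u = ∑ i ∈ I, w i * ‖u i.1 i.2‖ ^ 2 := by
    unfold discMean
    rw [Finset.sum_sigma']
    exact Finset.sum_congr rfl fun i _ => by simp only [hw_def]; ring
  have hMv : discMean c' S F v = ∑ i ∈ I, w i * ‖v i.1 i.2‖ ^ 2 := by
    unfold discMean
    rw [Finset.sum_sigma']
    exact Finset.sum_congr rfl fun i _ => by simp only [hw_def]; ring
  -- termwise norm identity
  have h1 : ‖discPolar c' S F u v‖ ≤ ∑ i ∈ I, w i * ‖u i.1 i.2‖ * ‖v i.1 i.2‖ := by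
    rw [hPol]
    refine (norm_sum_le _ _).trans (le_of_eq (Finset.sum_congr rfl fun i hi => ?_))
    obtain ⟨hc, ho⟩ := hrI i hi
    rw [norm_mul, norm_mul, norm_mul, Complex.norm_conj, norm_eq_abs_re_of_im_eq_zero hc,
      norm_eq_abs_re_of_im_eq_zero ho]
    have hwi : |(cstar c' S i.1 i.2).re| * |(omegaW S i.2).re| = w i := by
      rw [← abs_mul, hw_def]
      exact abs_of_nonneg (hwI i hi)
    calc |(cstar c' S i.1 i.2).re| * ‖u i.1 i.2‖ * ‖v i.1 i.2‖ * |(omegaW S i.2).re|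
        = (|(cstar c' S i.1 i.2).re| * |(omegaW S i.2).re|) * ‖u i.1 i.2‖ * ‖v i.1 i.2‖ := by ring
      _ = w i * ‖u i.1 i.2‖ * ‖v i.1 i.2‖ := by rw [hwi]
  have h2 : (∑ i ∈ I, w i * ‖u i.1 i.2‖ * ‖v i.1 i.2‖) ^ 2 ≤
      (∑ i ∈ I, w i * ‖u i.1 i.2‖ ^ 2) * ∑ i ∈ I, w i * ‖v i.1 i.2‖ ^ 2 := by
    refine Finset.sum_sq_le_sum_mul_sum_of_sq_le_mul I
      (fun i hi => mul_nonneg (hwI i hi) (sq_nonneg _)) (fun i hi => mul_nonneg (hwI i hi) (sq_nonneg _))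
      (fun i _ => le_of_eq ?_)
    ring
  have h3 : ‖discPolar c' S F u v‖ ^ 2 ≤ (∑ i ∈ I, w i * ‖u i.1 i.2‖ * ‖v i.1 i.2‖) ^ 2 :=
    pow_le_pow_left₀ (norm_nonneg _) h1 2
  calc ‖discPolar c' S F u v‖ ^ 2 ≤ (∑ i ∈ I, w i * ‖u i.1 i.2‖ * ‖v i.1 i.2‖) ^ 2 := h3
    _ ≤ (∑ i ∈ I, w i * ‖u i.1 i.2‖ ^ 2) * ∑ i ∈ I, w i * ‖v i.1 i.2‖ ^ 2 := h2
    _ = discMean c' S F u * discMean c' S F v := by rw [hMu, hMv]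

/-- **The Cauchy–Schwarz closing criterion at scale `S`, PROVED** (the tie/CS endgame's last step, free-scale
twin of the skeleton's §2 assembly): with real non-negative weights and `𝔞𝔓 > 0`, if the design mean is
`≤ M_D·𝔞𝔓`, the probe mean is `≤ M_J·𝔞𝔓` and the cross pairing is `≥ X·𝔞𝔓` in norm (`X ≥ 0`), then
`X² ≤ M_D·M_J`.  Contrapositive: dictionary values with `X² > M_D M_J` (the cell's «ratio ≥ 1» in OBJ_CS
currency, with margins) contradict (A) at that scale record.  No asymptotics here; the dictionary rows supply
the three bounds. [cite: Zhang2022LandauSiegel, §2 (2.16)–(2.20), (2.32)–(2.34), Lemma 2.3] -/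
theorem sq_le_of_cs {c' : ℝ} {S : Scales} {F : Finset (Chr S)} (hw : WeightsNonnegAt c' S F)
    (hr : RealWeightsAt c' S F) {u v : Chr S → ℂ → ℂ} {N MD MJ X : ℝ} (hN : 0 < N)
    (hD : discMean c' S F u ≤ MD * N) (hJ : discMean c' S F v ≤ MJ * N) (hX0 : 0 ≤ X)
    (hX : X * N ≤ ‖discPolar c' S F u v‖) : X ^ 2 ≤ MD * MJ := by
  have hcs := norm_sq_discPolar_le hw hr u v
  have hu0 := discMean_nonneg_of_weights hw u
  have hv0 := discMean_nonneg_of_weights hw v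
  have h1 : (X * N) ^ 2 ≤ ‖discPolar c' S F u v‖ ^ 2 := pow_le_pow_left₀ (by positivity) hX 2
  have h2 : discMean c' S F u * discMean c' S F v ≤ (MD * N) * (MJ * N) :=
    mul_le_mul hD hJ hv0 (hu0.trans hD)
  have h3 : X ^ 2 * N ^ 2 ≤ (MD * MJ) * N ^ 2 := by nlinarith
  exact le_of_mul_le_mul_right h3 (by positivity)

end DiscreteCS

/-! ## Part 5 — PROVED: the positivity endgame at fixed `A` (the B-ell «POS» currency as a kernel
implication, free-scale twin of `KnifeEdge.theorem1_of_eStarLen`) -/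

section Endgame

variable {D : ℕ} [NeZero D] (χ : DirichletCharacter ℂ D)

/-- `𝔞·𝔓 ≥ 0` at every scale record (`𝔞 ≥ 0`: `Skeleton.frakA_nonneg`; `𝔓` is a sum of primes).
[cite: Zhang2022LandauSiegel, §2 (2.9), (2.31)] -/
theorem normaliser_nonneg (S : Scales) : 0 ≤ normaliser χ S :=
  mul_nonneg (Skeleton.frakA_nonneg χ) (Finset.sum_nonneg fun p _ => Nat.cast_nonneg p)

variable {χ}

/-- With non-negative weights every NORMALISED profile mean is `≥ 0` (also when `𝔞𝔓 = 0`, where it is `0`).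
[cite: Zhang2022LandauSiegel, §2 Lemma 2.3, (2.15), (2.31)] -/
theorem profileMean_nonneg {c' : ℝ} {S : Scales} {F : Finset (Chr S)} (h : WeightsNonnegAt c' S F)
    (g : ℝ → ℂ) (N : ℕ) : 0 ≤ profileMean χ c' S F g N :=
  div_nonneg (discMean_nonneg_of_weights h _) (normaliser_nonneg χ S)

/-- **THE POSITIVITY ENDGAME AT FIXED `A`, PROVED.** If, for ONE profile `g`, the first-order dictionary
(`EllDictFirstOrderProfile`, registry E-022 in its one-profile form) holds from `A₀`, Lemma 2.3 at fixed `A`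
(`Lemma23FixedA`, ell-E13) from `A₁`, and the zero model (`EllZeroModelFixedA`, E-020 — only its «on the line»
conjunct is used) from `A₂`, all on the same sub-family selector `Fam`, and if at some `A ≥ A₀, A₁, A₂` the
completed main term is NEGATIVE for every admissible `λ` at all large-`D` scale records of the regime —
`F_{ℓ(P)}(rescaled g) + (G₀ + λG₁)/A + K/A² < 0` for `|λ| ≤ Λ` — then (A) fails for every real primitive
character to every large modulus: the normalised mean is `≥ 0` (`profileMean_nonneg`) yet within `K/A²` of a
number `< −K/A²`.  No Cauchy–Schwarz, no §18 margin; the scale record used is `KnifeEdge.scalesAt A 0 D`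
(`T` plays no role for a one-piece profile).  The three `Prop` hypotheses are registry rows asserted by no one;
this theorem is what the cell's «K₀-POS closes iff `G₀(u) + λG₁(u) + 〈gain〉 < 0 ∀|λ| ≤ Λ`» means in the kernel.
[cite: Zhang2022LandauSiegel, §2 p. 6, Lemma 2.3, Prop. 2.2 (i), (2.15), (2.31)–(2.32)] -/
theorem forAllLarge_not_assumptionA_of_profile {c' : ℝ} {Fam : (S : Scales) → Finset (Chr S)}
    {g g' : ℝ → ℂ} {G₀ G₁ Λ K A₀ A₁ cZ A₂ A : ℝ}
    (hdict : EllDictFirstOrderProfile c' Fam g g' G₀ G₁ Λ K A₀) (h23 : Lemma23FixedA c' Fam A₁)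
    (hZ : EllZeroModelFixedA Fam cZ A₂) (h0 : A₀ ≤ A) (h1 : A₁ ≤ A) (h2 : A₂ ≤ A)
    (hneg : ∃ D₁ : ℕ, ∀ S : Scales, D₁ ≤ S.D → S.IsEllRegimeP A → ∀ lam : ℝ, |lam| ≤ Λ →
      mainTermFormEll S.ellP (rescale S.shrink g) (rescale' S.shrink g') + (G₀ + lam * G₁) / A
        + K / A ^ 2 < 0) :
    ForAllLarge fun D _ χ => ¬ AssumptionA D χ := by
  obtain ⟨C, hZ⟩ := hZ
  obtain ⟨D₁, hneg⟩ := hneg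
  have hev := (((hdict A h0).and (h23 A h1)).and (hZ A h2)).and
    (ForAllLarge.of_le (S := fun D _ _ => max D₁ 2 ≤ D) (max D₁ 2) fun D _ χ hD _ _ => hD)
  refine hev.mono fun D _ χ _ _ hall hA => ?_
  obtain ⟨⟨⟨hd, h23D⟩, hZD⟩, hD⟩ := hall
  have hD2 : 2 ≤ D := le_trans (le_max_right _ _) hD
  have hreg : (KnifeEdge.scalesAt A 0 D).IsEllRegimeP A := ⟨rfl, rfl, rfl, rfl, rfl⟩
  have hSD : (KnifeEdge.scalesAt A 0 D).D = D := rfl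
  have hD1 : D₁ ≤ (KnifeEdge.scalesAt A 0 D).D := le_trans (le_max_left _ _) hD
  have hL2 : 0 < (KnifeEdge.scalesAt A 0 D).L2 := by
    show 0 < Real.log (D : ℝ) ^ 400
    exact pow_pos (Real.log_pos (by exact_mod_cast lt_of_lt_of_le one_lt_two hD2)) _
  obtain ⟨lam, hlam, hdS⟩ := hd hA
  have habs := hdS _ hSD hreg
  have hw : WeightsNonnegAt c' (KnifeEdge.scalesAt A 0 D) (Fam _) :=
    weightsNonnegAt_of hL2 (h23D hA _ hSD hreg) (hZD hA _ hSD hreg).2.1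
  have hpos := profileMean_nonneg (χ := χ) hw g ⌈(KnifeEdge.scalesAt A 0 D).P⌉₊
  have hlt := hneg _ hD1 hreg lam hlam
  have hup := (abs_le.mp habs).2
  linarith

/-- **… hence Theorem 1 of the manuscript** (`L(1,χ) > c₁(log D)⁻²⁰²²`), via
`Skeleton.theorem1_of_eventually_not_assumptionA`. [cite: Zhang2022LandauSiegel, §1 Theorem 1; §2 p. 6] -/
theorem theorem1_of_ellDictProfile {c' : ℝ} {Fam : (S : Scales) → Finset (Chr S)}
    {g g' : ℝ → ℂ} {G₀ G₁ Λ K A₀ A₁ cZ A₂ A : ℝ}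
    (hdict : EllDictFirstOrderProfile c' Fam g g' G₀ G₁ Λ K A₀) (h23 : Lemma23FixedA c' Fam A₁)
    (hZ : EllZeroModelFixedA Fam cZ A₂) (h0 : A₀ ≤ A) (h1 : A₁ ≤ A) (h2 : A₂ ≤ A)
    (hneg : ∃ D₁ : ℕ, ∀ S : Scales, D₁ ≤ S.D → S.IsEllRegimeP A → ∀ lam : ℝ, |lam| ≤ Λ →
      mainTermFormEll S.ellP (rescale S.shrink g) (rescale' S.shrink g') + (G₀ + lam * G₁) / A
        + K / A ^ 2 < 0) :
    Theorem1 :=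
  Skeleton.theorem1_of_eventually_not_assumptionA
    (forAllLarge_not_assumptionA_of_profile hdict h23 hZ h0 h1 h2 hneg)

/-- **… and Theorem 2** (`L(σ,χ) ≠ 0` for `σ > 1 − c₂(log D)⁻²⁰²⁴`). [cite: Zhang2022LandauSiegel, §1 Theorem 2] -/
theorem theorem2_of_ellDictProfile {c' : ℝ} {Fam : (S : Scales) → Finset (Chr S)}
    {g g' : ℝ → ℂ} {G₀ G₁ Λ K A₀ A₁ cZ A₂ A : ℝ}
    (hdict : EllDictFirstOrderProfile c' Fam g g' G₀ G₁ Λ K A₀) (h23 : Lemma23FixedA c' Fam A₁)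
    (hZ : EllZeroModelFixedA Fam cZ A₂) (h0 : A₀ ≤ A) (h1 : A₁ ≤ A) (h2 : A₂ ≤ A)
    (hneg : ∃ D₁ : ℕ, ∀ S : Scales, D₁ ≤ S.D → S.IsEllRegimeP A → ∀ lam : ℝ, |lam| ≤ Λ →
      mainTermFormEll S.ellP (rescale S.shrink g) (rescale' S.shrink g') + (G₀ + lam * G₁) / A
        + K / A ^ 2 < 0) :
    Theorem2 :=
  Skeleton.theorem2_of_theorem1 (theorem1_of_ellDictProfile hdict h23 hZ h0 h1 h2 hneg)

/-- **The `K₀` instance**: the endgame for the planner's one-piece exponential profile `expComb k u`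
(`EllDictFirstOrderK0` is `EllDictFirstOrderProfile` on it). [cite: Zhang2022LandauSiegel, §1 Theorem 1; §2 p. 6, (2.23)–(2.25)] -/
theorem theorem1_of_ellDictK0 {c' : ℝ} {Fam : (S : Scales) → Finset (Chr S)} {k : Fin 3 → ℝ}
    {u : Fin 3 → ℂ} {G₀ G₁ Λ K A₀ A₁ cZ A₂ A : ℝ}
    (hdict : EllDictFirstOrderK0 c' Fam k u G₀ G₁ Λ K A₀) (h23 : Lemma23FixedA c' Fam A₁)
    (hZ : EllZeroModelFixedA Fam cZ A₂) (h0 : A₀ ≤ A) (h1 : A₁ ≤ A) (h2 : A₂ ≤ A)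
    (hneg : ∃ D₁ : ℕ, ∀ S : Scales, D₁ ≤ S.D → S.IsEllRegimeP A → ∀ lam : ℝ, |lam| ≤ Λ →
      mainTermFormEll S.ellP (rescale S.shrink (expComb k u)) (rescale' S.shrink (expComb' k u))
        + (G₀ + lam * G₁) / A + K / A ^ 2 < 0) :
    Theorem1 :=
  theorem1_of_ellDictProfile hdict h23 hZ h0 h1 h2 hneg

end Endgame

/-! ## Part 7 — the rows and the endgame in the `C`-regime `t₀ = D^C·𝓛⁵¹⁹` (`C = 0`: the rows above;
`C = 2B`: the cell's «`t₀ = T²`» sheet, ls-Bell-plan RULING-2 18:12:09Z, `α̃ = (1+2B)/A`, `λ = A/(A+1+2B)`) -/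

section CRegime

/-- **ell-E13 in the `C`-regime**: Lemma 2.3's conclusion on `Fam S` at every record with `log P = A·log D`,
`t₀ = D^C·𝓛⁵¹⁹`, `A ≥ A₀` fixed, under (A), eventually in `D`.  `C = 0` is `Lemma23FixedA`
(`lemma23FixedAC_zero_iff`).  A DEFINITION. [cite: Zhang2022LandauSiegel, §2 Lemma 2.3, Prop. 2.2 (ii)(iii)] -/
def Lemma23FixedAC (c' : ℝ) (Fam : (S : Scales) → Finset (Chr S)) (A₀ C : ℝ) : Prop :=
  ∀ A : ℝ, A₀ ≤ A →
    ForAllLarge fun D _ χ => AssumptionA D χ →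
      ∀ S : Scales, S.D = D → S.IsEllRegimePC A C → Lemma23At c' S (Fam S)

/-- **E-020 in the `C`-regime** (`t₀ = D^C·𝓛⁵¹⁹`; window `𝓛₁` pinned): as `EllZeroModelFixedA`.  `C = 0` is
`EllZeroModelFixedA` (`ellZeroModelFixedAC_zero_iff`).  A DEFINITION. [cite: Zhang2022LandauSiegel, §2 Prop. 2.1, Prop. 2.2, (2.10)] -/
def EllZeroModelFixedAC (Fam : (S : Scales) → Finset (Chr S)) (cZ A₀ C : ℝ) : Prop :=
  ∃ Cd : ℝ, ∀ A : ℝ, A₀ ≤ A →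
    ForAllLarge fun D _ χ => AssumptionA D χ →
      ∀ S : Scales, S.D = D → S.IsEllRegimePC A C →
        SubfamilyDense S (Fam S) Cd ∧ OnLineSimple χ S (Fam S) ∧ ZeroGapModel χ cZ S (Fam S)

/-- **E-022 (`λ`-form) in the `C`-regime with `C = Cof B`** (`Cof B = 2B`: «`t₀ = T²`»; `Cof = 0`: the rows
above): as `EllDictFirstOrderLam`, at the records `(D^A, D^B, D^{Cof B}·𝓛⁵¹⁹)`.  A DEFINITION.
[cite: Zhang2022LandauSiegel, §8 (8.23), (8.3)–(8.5); §9 (9.7); §18 (18.1); §2 (2.10), (2.13), (2.32)] -/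
def EllDictFirstOrderLamC (c' : ℝ) (Fam : (S : Scales) → Finset (Chr S)) (Adm : Theta → Prop)
    (G₀ G₁ : Theta → ℝ → ℝ × ℝ × ℝ) (Λ : ℝ) (K : Theta → ℝ → ℝ) (A₀ : ℝ) (Cof : ℝ → ℝ) : Prop :=
  ∀ θ : Theta, Adm θ → ∀ A B : ℝ, A₀ ≤ A →
    ForAllLarge fun D _ χ => AssumptionA D χ → ∃ lam : ℝ, |lam| ≤ Λ ∧
      ∀ S : Scales, S.D = D → S.IsEllRegimeC A B (Cof B) →
        DictAt χ c' S (Fam S) θ ((G₀ θ B).1 + lam * (G₁ θ B).1) ((G₀ θ B).2.1 + lam * (G₁ θ B).2.1)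
          ((G₀ θ B).2.2 + lam * (G₁ θ B).2.2) (K θ B) A

/-- **E-022 for one profile in the `C`-regime**: as `EllDictFirstOrderProfile`, at the records with
`t₀ = D^C·𝓛⁵¹⁹`.  `C = 0` is `EllDictFirstOrderProfile` (`ellDictFirstOrderProfileC_zero_iff`).  A DEFINITION.
[cite: Zhang2022LandauSiegel, §8 (8.23), (8.3); §2 (2.10), (2.23)] -/
def EllDictFirstOrderProfileC (c' : ℝ) (Fam : (S : Scales) → Finset (Chr S)) (g g' : ℝ → ℂ)
    (G₀ G₁ Λ K A₀ C : ℝ) : Prop :=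
  ∀ A : ℝ, A₀ ≤ A →
    ForAllLarge fun D _ χ => AssumptionA D χ → ∃ lam : ℝ, |lam| ≤ Λ ∧
      ∀ S : Scales, S.D = D → S.IsEllRegimePC A C →
        |profileMean χ c' S (Fam S) g ⌈S.P⌉₊ -
            (mainTermFormEll S.ellP (rescale S.shrink g) (rescale' S.shrink g') + (G₀ + lam * G₁) / A)|
          ≤ K / A ^ 2

/-- **E-022∣K₀ in the `C`-regime**. A DEFINITION. [cite: Zhang2022LandauSiegel, §8 (8.23); §2 (2.23)–(2.25)] -/
def EllDictFirstOrderK0C (c' : ℝ) (Fam : (S : Scales) → Finset (Chr S)) (k : Fin 3 → ℝ) (u : Fin 3 → ℂ)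
    (G₀ G₁ Λ K A₀ C : ℝ) : Prop :=
  EllDictFirstOrderProfileC c' Fam (expComb k u) (expComb' k u) G₀ G₁ Λ K A₀ C

/-- `C = 0`: `Lemma23FixedAC … 0 ↔ Lemma23FixedA …`. [cite: Zhang2022LandauSiegel, §2 Lemma 2.3] -/
theorem lemma23FixedAC_zero_iff (c' : ℝ) (Fam : (S : Scales) → Finset (Chr S)) (A₀ : ℝ) :
    Lemma23FixedAC c' Fam A₀ 0 ↔ Lemma23FixedA c' Fam A₀ := by
  unfold Lemma23FixedAC Lemma23FixedA
  simp only [Scales.isEllRegimePC_zero_iff]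

/-- `C = 0`: `EllZeroModelFixedAC … 0 ↔ EllZeroModelFixedA …`. [cite: Zhang2022LandauSiegel, §2 Prop. 2.2] -/
theorem ellZeroModelFixedAC_zero_iff (Fam : (S : Scales) → Finset (Chr S)) (cZ A₀ : ℝ) :
    EllZeroModelFixedAC Fam cZ A₀ 0 ↔ EllZeroModelFixedA Fam cZ A₀ := by
  unfold EllZeroModelFixedAC EllZeroModelFixedA
  simp only [Scales.isEllRegimePC_zero_iff]

/-- `C = 0`: `EllDictFirstOrderProfileC … 0 ↔ EllDictFirstOrderProfile …`. [cite: Zhang2022LandauSiegel, §8 (8.23)] -/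
theorem ellDictFirstOrderProfileC_zero_iff (c' : ℝ) (Fam : (S : Scales) → Finset (Chr S)) (g g' : ℝ → ℂ)
    (G₀ G₁ Λ K A₀ : ℝ) :
    EllDictFirstOrderProfileC c' Fam g g' G₀ G₁ Λ K A₀ 0 ↔ EllDictFirstOrderProfile c' Fam g g' G₀ G₁ Λ K A₀ := by
  unfold EllDictFirstOrderProfileC EllDictFirstOrderProfile
  simp only [Scales.isEllRegimePC_zero_iff]

/-- `Cof = 0`: `EllDictFirstOrderLamC … (fun _ => 0) ↔ EllDictFirstOrderLam …`. [cite: Zhang2022LandauSiegel, §8 (8.23)] -/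
theorem ellDictFirstOrderLamC_zero_iff (c' : ℝ) (Fam : (S : Scales) → Finset (Chr S)) (Adm : Theta → Prop)
    (G₀ G₁ : Theta → ℝ → ℝ × ℝ × ℝ) (Λ : ℝ) (K : Theta → ℝ → ℝ) (A₀ : ℝ) :
    EllDictFirstOrderLamC c' Fam Adm G₀ G₁ Λ K A₀ (fun _ => 0) ↔ EllDictFirstOrderLam c' Fam Adm G₀ G₁ Λ K A₀ := by
  unfold EllDictFirstOrderLamC EllDictFirstOrderLam
  simp only [Scales.isEllRegimeC_zero_iff]

/-- **THE POSITIVITY ENDGAME AT FIXED `A` IN THE `C`-REGIME, PROVED** (as `forAllLarge_not_assumptionA_of_profile`,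
scale record `Scales.scalesAtC A C D`). [cite: Zhang2022LandauSiegel, §2 p. 6, Lemma 2.3, Prop. 2.2 (i), (2.15), (2.31)–(2.32)] -/
theorem forAllLarge_not_assumptionA_of_profileC {c' : ℝ} {Fam : (S : Scales) → Finset (Chr S)}
    {g g' : ℝ → ℂ} {G₀ G₁ Λ K A₀ A₁ cZ A₂ A C : ℝ}
    (hdict : EllDictFirstOrderProfileC c' Fam g g' G₀ G₁ Λ K A₀ C) (h23 : Lemma23FixedAC c' Fam A₁ C)
    (hZ : EllZeroModelFixedAC Fam cZ A₂ C) (h0 : A₀ ≤ A) (h1 : A₁ ≤ A) (h2 : A₂ ≤ A)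
    (hneg : ∃ D₁ : ℕ, ∀ S : Scales, D₁ ≤ S.D → S.IsEllRegimePC A C → ∀ lam : ℝ, |lam| ≤ Λ →
      mainTermFormEll S.ellP (rescale S.shrink g) (rescale' S.shrink g') + (G₀ + lam * G₁) / A
        + K / A ^ 2 < 0) :
    ForAllLarge fun D _ χ => ¬ AssumptionA D χ := by
  obtain ⟨Cd, hZ⟩ := hZ
  obtain ⟨D₁, hneg⟩ := hneg
  have hev := (((hdict A h0).and (h23 A h1)).and (hZ A h2)).and
    (ForAllLarge.of_le (S := fun D _ _ => max D₁ 2 ≤ D) (max D₁ 2) fun D _ χ hD _ _ => hD)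
  refine hev.mono fun D _ χ _ _ hall hA => ?_
  obtain ⟨⟨⟨hd, h23D⟩, hZD⟩, hD⟩ := hall
  have hD2 : 2 ≤ D := le_trans (le_max_right _ _) hD
  have hreg : (Scales.scalesAtC A C D).IsEllRegimePC A C := ⟨rfl, rfl, rfl, rfl, rfl⟩
  have hSD : (Scales.scalesAtC A C D).D = D := rfl
  have hD1 : D₁ ≤ (Scales.scalesAtC A C D).D := le_trans (le_max_left _ _) hD
  have hL2 : 0 < (Scales.scalesAtC A C D).L2 := by
    show 0 < Real.log (D : ℝ) ^ 400
    exact pow_pos (Real.log_pos (by exact_mod_cast lt_of_lt_of_le one_lt_two hD2)) _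
  obtain ⟨lam, hlam, hdS⟩ := hd hA
  have habs := hdS _ hSD hreg
  have hw : WeightsNonnegAt c' (Scales.scalesAtC A C D) (Fam _) :=
    weightsNonnegAt_of hL2 (h23D hA _ hSD hreg) (hZD hA _ hSD hreg).2.1
  have hpos := profileMean_nonneg (χ := χ) hw g ⌈(Scales.scalesAtC A C D).P⌉₊
  have hlt := hneg _ hD1 hreg lam hlam
  have hup := (abs_le.mp habs).2
  linarith

/-- … hence Theorem 1, in the `C`-regime. [cite: Zhang2022LandauSiegel, §1 Theorem 1; §2 p. 6] -/
theorem theorem1_of_ellDictProfileC {c' : ℝ} {Fam : (S : Scales) → Finset (Chr S)}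
    {g g' : ℝ → ℂ} {G₀ G₁ Λ K A₀ A₁ cZ A₂ A C : ℝ}
    (hdict : EllDictFirstOrderProfileC c' Fam g g' G₀ G₁ Λ K A₀ C) (h23 : Lemma23FixedAC c' Fam A₁ C)
    (hZ : EllZeroModelFixedAC Fam cZ A₂ C) (h0 : A₀ ≤ A) (h1 : A₁ ≤ A) (h2 : A₂ ≤ A)
    (hneg : ∃ D₁ : ℕ, ∀ S : Scales, D₁ ≤ S.D → S.IsEllRegimePC A C → ∀ lam : ℝ, |lam| ≤ Λ →
      mainTermFormEll S.ellP (rescale S.shrink g) (rescale' S.shrink g') + (G₀ + lam * G₁) / A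
        + K / A ^ 2 < 0) :
    Theorem1 :=
  Skeleton.theorem1_of_eventually_not_assumptionA
    (forAllLarge_not_assumptionA_of_profileC hdict h23 hZ h0 h1 h2 hneg)

/-- … and for the `K₀` profile, in the `C`-regime. [cite: Zhang2022LandauSiegel, §1 Theorem 1; §2 (2.23)–(2.25)] -/
theorem theorem1_of_ellDictK0C {c' : ℝ} {Fam : (S : Scales) → Finset (Chr S)} {k : Fin 3 → ℝ}
    {u : Fin 3 → ℂ} {G₀ G₁ Λ K A₀ A₁ cZ A₂ A C : ℝ}
    (hdict : EllDictFirstOrderK0C c' Fam k u G₀ G₁ Λ K A₀ C) (h23 : Lemma23FixedAC c' Fam A₁ C)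
    (hZ : EllZeroModelFixedAC Fam cZ A₂ C) (h0 : A₀ ≤ A) (h1 : A₁ ≤ A) (h2 : A₂ ≤ A)
    (hneg : ∃ D₁ : ℕ, ∀ S : Scales, D₁ ≤ S.D → S.IsEllRegimePC A C → ∀ lam : ℝ, |lam| ≤ Λ →
      mainTermFormEll S.ellP (rescale S.shrink (expComb k u)) (rescale' S.shrink (expComb' k u))
        + (G₀ + lam * G₁) / A + K / A ^ 2 < 0) :
    Theorem1 :=
  theorem1_of_ellDictProfileC hdict h23 hZ h0 h1 h2 hneg

/-! ### Glue: a bound on a BOX around the limit regime point discharges the endgame's `D`-uniform hypothesis -/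

/-- **`hneg` from a box bound (printed `t₀`)**: if the completed main term is negative for every `(ℓ, r)` within
`δ` of the limit point `((A+1)/(A+½), A/(A+1))` and every `|λ| ≤ Λ`, then it is negative at every scale record
of the regime with `D ≥ D₁` — by `Scales.eventually_ellP_shrink_near`.  (The box bound is what an interval
computation certifies.) [cite: Zhang2022LandauSiegel, §2 (2.10), (2.30), (2.32)] -/
theorem hneg_of_box {g g' : ℝ → ℂ} {G₀ G₁ Λ K A δ : ℝ} (hA : 0 < A) (hδ : 0 < δ)
    (hbox : ∀ ℓ r : ℝ, |ℓ - (A + 1) / (A + 1 / 2)| < δ → |r - A / (A + 1)| < δ → ∀ lam : ℝ, |lam| ≤ Λ →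
      mainTermFormEll ℓ (rescale r g) (rescale' r g') + (G₀ + lam * G₁) / A + K / A ^ 2 < 0) :
    ∃ D₁ : ℕ, ∀ S : Scales, D₁ ≤ S.D → S.IsEllRegimeP A → ∀ lam : ℝ, |lam| ≤ Λ →
      mainTermFormEll S.ellP (rescale S.shrink g) (rescale' S.shrink g') + (G₀ + lam * G₁) / A
        + K / A ^ 2 < 0 := by
  obtain ⟨D₁, h⟩ := Scales.eventually_ellP_shrink_near hA hδ
  exact ⟨D₁, fun S hD hS lam hlam => hbox _ _ (h S hD hS).1 (h S hD hS).2 lam hlam⟩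

/-- **`hneg` from a box bound in the `C`-regime** (limit point `((A+C+1)/(A+C+½), A/(A+C+1))`;
`Scales.eventually_ellP_shrink_nearC`). [cite: Zhang2022LandauSiegel, §2 (2.10), (2.30), (2.32)] -/
theorem hneg_of_boxC {g g' : ℝ → ℂ} {G₀ G₁ Λ K A C δ : ℝ} (hA : 0 < A) (hC : 0 ≤ C) (hδ : 0 < δ)
    (hbox : ∀ ℓ r : ℝ, |ℓ - (A + C + 1) / (A + C + 1 / 2)| < δ → |r - A / (A + C + 1)| < δ →
      ∀ lam : ℝ, |lam| ≤ Λ →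
        mainTermFormEll ℓ (rescale r g) (rescale' r g') + (G₀ + lam * G₁) / A + K / A ^ 2 < 0) :
    ∃ D₁ : ℕ, ∀ S : Scales, D₁ ≤ S.D → S.IsEllRegimePC A C → ∀ lam : ℝ, |lam| ≤ Λ →
      mainTermFormEll S.ellP (rescale S.shrink g) (rescale' S.shrink g') + (G₀ + lam * G₁) / A
        + K / A ^ 2 < 0 := by
  obtain ⟨D₁, h⟩ := Scales.eventually_ellP_shrink_nearC hA hC hδ
  exact ⟨D₁, fun S hD hS lam hlam => hbox _ _ (h S hD hS).1 (h S hD hS).2 lam hlam⟩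

/-- **Theorem 1 from a BOX certificate (`K₀`, `C`-regime)** — the form a kit/rational-corner certificate
targets: the three registry rows + `A ≥` their floors + a box bound around the limit regime point.
[cite: Zhang2022LandauSiegel, §1 Theorem 1; §2 p. 6, (2.10), (2.30)] -/
theorem theorem1_of_ellDictK0C_box {c' : ℝ} {Fam : (S : Scales) → Finset (Chr S)} {k : Fin 3 → ℝ}
    {u : Fin 3 → ℂ} {G₀ G₁ Λ K A₀ A₁ cZ A₂ A C δ : ℝ}
    (hdict : EllDictFirstOrderK0C c' Fam k u G₀ G₁ Λ K A₀ C) (h23 : Lemma23FixedAC c' Fam A₁ C)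
    (hZ : EllZeroModelFixedAC Fam cZ A₂ C) (h0 : A₀ ≤ A) (h1 : A₁ ≤ A) (h2 : A₂ ≤ A)
    (hA : 0 < A) (hC : 0 ≤ C) (hδ : 0 < δ)
    (hbox : ∀ ℓ r : ℝ, |ℓ - (A + C + 1) / (A + C + 1 / 2)| < δ → |r - A / (A + C + 1)| < δ →
      ∀ lam : ℝ, |lam| ≤ Λ →
        mainTermFormEll ℓ (rescale r (expComb k u)) (rescale' r (expComb' k u)) + (G₀ + lam * G₁) / A
          + K / A ^ 2 < 0) :
    Theorem1 :=
  theorem1_of_ellDictK0C hdict h23 hZ h0 h1 h2 (hneg_of_boxC hA hC hδ hbox)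

end CRegime

/-! ## Part 6 — bookkeeping the cell reads designs through: the (15.2) caps inside E-027, the first-order
decision test on `K₀`, and the model-consistency gate (ls-ref-1 / ls-theory acceptance test #1) -/

/-- **The two (15.2) support caps are conjuncts of E-027** (ls-Bell-plan RULING-2, 18:12:09Z/18:23:58Z (a)(b)):
in PHYSICAL exponents `e₂ = ν₂ − 10τ_T`, `TExponentConstraints` gives `2e₂ ≤ 1 − 2τ_T` (`H₁₂H₂₃`) and
`cut₁ + e₂ ≤ 1 − 2τ_T` (`H₁₄H₂₃`) — both are instances of its (T-iii). [cite: Zhang2022LandauSiegel, §15 (15.2)] -/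
theorem TExponentConstraints.caps {θ : Theta} {τT τt0 τDt0 : ℝ} (h : TExponentConstraints θ τT τt0 τDt0) :
    2 * (θ.nu2 - 10 * τT) ≤ 1 - 2 * τT ∧ θ.cut1 + (θ.nu2 - 10 * τT) ≤ 1 - 2 * τT := by
  obtain ⟨-, -, h3, -, -⟩ := h
  have a₁ := le_max_left θ.cut1 (θ.nu2 - 10 * τT)
  have a₂ := le_max_right θ.cut1 (θ.nu2 - 10 * τT)
  have b := le_max_right θ.nu3 (θ.nu2 - 10 * τT)
  constructor <;> linarith

/-- **The first-order (`order ε = 1/A`) ROBUST CLOSING TEST on a `K₀` design** (ls-Bell-plan 17:09:53Z «`K₀`-POS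
closes iff `G₀(u) + λG₁(u) + 〈gain〉 < 0 ∀|λ| ≤ Λ`»): `gain` = the coefficient of `1/A` in
`F_{ℓ(P)}(rescaled u)` (the knife's slope on the kernel vector — `F₁(u) = 0` on `K₀`), `G₀ + λG₁` = dict-1's
first-order term (`EllDictFirstOrderK0`'s reals).  This is the `A → ∞` PROXY of the endgame hypothesis of
`forAllLarge_not_assumptionA_of_profile` (there, at a FIXED `A`, the certificate is the displayed `D`-uniform
inequality itself).  A DEFINITION. [cite: Zhang2022LandauSiegel, §2 (2.32); §7 (7.2)] -/
def ClosesK0FirstOrder (gain G₀ G₁ Λ : ℝ) : Prop :=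
  ∀ lam : ℝ, |lam| ≤ Λ → gain + G₀ + lam * G₁ < 0

/-- **MODEL-CONSISTENCY GATE `ModelConsistentK0`** (ls-ref-1 17:04:36Z / 18:07:35Z; ls-theory 17:33:45Z
acceptance test #1 of the D-ell-1 brief): at the `⟨A⟩`-model's OWN data `λ = λ_model` the order-`ε`
coefficient on each kernel vector is `≥ 0` — the exact model discrete mean is `≥ 0` at every finite `A`, so a
dict-1 under which the MODEL closes is REFUTED (an order-`ε` class is missing), not a candidate.  A DEFINITION
(the gate is a property OF the delivered `(gain, G₀, G₁, λ_model)`). [cite: Zhang2022LandauSiegel, §2 Lemma 2.3, (2.15), (2.32)] -/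
def ModelConsistentK0 (gain G₀ G₁ lamModel : ℝ) : Prop :=
  0 ≤ gain + G₀ + lamModel * G₁

/-- **ls-ref-1's §7b consequence, in the kernel:** a model-consistent dict-1 whose model point lies in the
admissible box (`|λ_model| ≤ Λ`) FAILS the robust first-order test — a «closes» can only come from a dict-1
that departs from the model at its own data (a (c)-EXHIBIT) or from an input pinning `λ` away from `λ_model`.
[cite: Zhang2022LandauSiegel, §2 Lemma 2.3, (2.32)] -/
theorem not_closesK0FirstOrder_of_modelConsistent {gain G₀ G₁ Λ lamModel : ℝ}
    (h : ModelConsistentK0 gain G₀ G₁ lamModel) (hbox : |lamModel| ≤ Λ) :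
    ¬ ClosesK0FirstOrder gain G₀ G₁ Λ :=
  fun hc => absurd (hc lamModel hbox) (not_lt.mpr h)

/-- The robust test is decided at the corners `λ = ±Λ` (it is linear in `λ`):
`ClosesK0FirstOrder gain G₀ G₁ Λ ↔ gain + G₀ + Λ·|G₁| < 0` (`Λ ≥ 0`). [cite: Zhang2022LandauSiegel, §2 (2.32)] -/
theorem closesK0FirstOrder_iff {gain G₀ G₁ Λ : ℝ} (hΛ : 0 ≤ Λ) :
    ClosesK0FirstOrder gain G₀ G₁ Λ ↔ gain + G₀ + Λ * |G₁| < 0 := by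
  constructor
  · intro h
    rcases le_or_gt 0 G₁ with hG | hG
    · have h' := h Λ (by rw [abs_of_nonneg hΛ])
      rwa [abs_of_nonneg hG]
    · have h' := h (-Λ) (by rw [abs_neg, abs_of_nonneg hΛ])
      rw [abs_of_neg hG]
      linarith
  · intro h lam hlam
    have hmul : lam * G₁ ≤ Λ * |G₁| :=
      calc lam * G₁ ≤ |lam * G₁| := le_abs_self _
        _ = |lam| * |G₁| := abs_mul _ _
        _ ≤ Λ * |G₁| := mul_le_mul_of_nonneg_right hlam (abs_nonneg _)
    linarith

/-! ### The SET form of the first-order test (KILL-draft v0.2 F5/F6: model-admissible SET `𝓜`, two adversarial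
first-order parameters `(λ, c′)` — dipole `λ` and arithmetic detuning `c′`, ls-theory 17:10:30Z (2)(b)(e)) -/

/-- The first-order value of a design read through dict-1 at the datum `p = (λ, c′)`:
`gain + G₀ + λ·G₁ + c′·G₂` (`G₂` = the detuning coefficient `πc′·(−5∂_{b₁} + 2∂_{b₂} − 3∂_{b₃})C(d)` slot of
ls-theory (2)(b); `G₂ = 0` recovers Part 6). [cite: Zhang2022LandauSiegel, §2 (2.13), (2.32)] -/
def firstOrderValue (gain G₀ G₁ G₂ : ℝ) (p : ℝ × ℝ) : ℝ := gain + G₀ + p.1 * G₁ + p.2 * G₂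

/-- **ROBUST CLOSING over a datum set `M`** (the admissible box of `(λ, c′)`): negative at every `p ∈ M`.
A DEFINITION. [cite: Zhang2022LandauSiegel, §2 (2.32)] -/
def ClosesFirstOrderOn (M : Set (ℝ × ℝ)) (gain G₀ G₁ G₂ : ℝ) : Prop :=
  ∀ p ∈ M, firstOrderValue gain G₀ G₁ G₂ p < 0

/-- **MODEL-CONSISTENCY over the model-admissible SET `𝓜`** (KILL-draft v0.2 F5: the model point
`(λ → 0, c′_ar = 0)` is one element; ls-theory rules what else is): the first-order value is `≥ 0` at every
model-admissible datum.  A DEFINITION. [cite: Zhang2022LandauSiegel, §2 Lemma 2.3, (2.15), (2.32)] -/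
def ModelConsistentOn (𝓜 : Set (ℝ × ℝ)) (gain G₀ G₁ G₂ : ℝ) : Prop :=
  ∀ p ∈ 𝓜, 0 ≤ firstOrderValue gain G₀ G₁ G₂ p

/-- **F6 in the kernel:** if dict-1 is model-consistent on `𝓜` and the admissible box `M` MEETS `𝓜`, the robust
test over `M` fails; contrapositively a design that closes over `M ⊇ 𝓜`-points exhibits an `(A)`-consequence
leaving `𝓜` (door (α′)). [cite: Zhang2022LandauSiegel, §2 Lemma 2.3, (2.32)] -/
theorem not_closesFirstOrderOn_of_modelConsistentOn {𝓜 M : Set (ℝ × ℝ)} {gain G₀ G₁ G₂ : ℝ}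
    (h : ModelConsistentOn 𝓜 gain G₀ G₁ G₂) (hmeet : (𝓜 ∩ M).Nonempty) :
    ¬ ClosesFirstOrderOn M gain G₀ G₁ G₂ := by
  obtain ⟨p, hp𝓜, hpM⟩ := hmeet
  exact fun hc => absurd (hc p hpM) (not_lt.mpr (h p hp𝓜))

/-- Part 6's point test is the set test on the segment `{(λ, 0) : |λ| ≤ Λ}` with `G₂` irrelevant.
[cite: Zhang2022LandauSiegel, §2 (2.32)] -/
theorem closesK0FirstOrder_iff_closesFirstOrderOn (gain G₀ G₁ G₂ Λ : ℝ) :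
    ClosesK0FirstOrder gain G₀ G₁ Λ ↔
      ClosesFirstOrderOn {p : ℝ × ℝ | |p.1| ≤ Λ ∧ p.2 = 0} gain G₀ G₁ G₂ := by
  constructor
  · rintro h ⟨lam, c⟩ ⟨hlam, hc⟩
    simp only at hc
    subst hc
    have := h lam hlam
    simp [firstOrderValue]
    linarith
  · intro h lam hlam
    have := h (lam, 0) ⟨hlam, rfl⟩
    simp [firstOrderValue] at this
    linarith

/-- **FIRST-ORDER EMPTINESS of a design family over `M`** (the KILL certificate's kernel target, F6): no design
of the family closes robustly over `M`.  A DEFINITION. [cite: Zhang2022LandauSiegel, §2 (2.32)] -/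
def FirstOrderEmptyOn {ι : Type*} (designs : Set ι) (data : ι → ℝ × ℝ × ℝ × ℝ) (M : Set (ℝ × ℝ)) : Prop :=
  ∀ d ∈ designs, ¬ ClosesFirstOrderOn M (data d).1 (data d).2.1 (data d).2.2.1 (data d).2.2.2

/-- Emptiness from model-consistency, design by design. [cite: Zhang2022LandauSiegel, §2 Lemma 2.3, (2.32)] -/
theorem firstOrderEmptyOn_of_modelConsistentOn {ι : Type*} {designs : Set ι} {data : ι → ℝ × ℝ × ℝ × ℝ}
    {𝓜 M : Set (ℝ × ℝ)} (hmeet : (𝓜 ∩ M).Nonempty)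
    (h : ∀ d ∈ designs, ModelConsistentOn 𝓜 (data d).1 (data d).2.1 (data d).2.2.1 (data d).2.2.2) :
    FirstOrderEmptyOn designs data M :=
  fun d hd => not_closesFirstOrderOn_of_modelConsistentOn (h d hd) hmeet

/-! ## Part 8 — the tie/CS sheet at fixed `A`: the manuscript's (2.17)–(2.20) at free scale, (2.18) and
Cauchy's inequality PROVED, the CS-currency dictionary rows (free-scale shapes of Prop. 2.4 / (10.17),
(2.33), Prop. 2.6 / (11.1)) with first-order slots sharing E-022's `λ`, and the PROVED Cauchy–Schwarz endgame
(Theorem 1 from the rows + a certificate `√(M_D M_J) + √(δ M₂) < X`) — the kernel meaning of «a B-ell design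
closes in OBJ_CS currency» (OBJECTIVE.md §2.1 CS; B-ell KILL-draft §1 tie/G5/G6 clause), twin of Part 5. -/

section CSObjects

variable {D : ℕ} [NeZero D] (χ : DirichletCharacter ℂ D)

/-- **`J₁(s,ψ)` at scale `S` for the design `θ`** ((2.28)–(2.29)): `Σ_n ψχ(n)n^{−s}f̃(log n/log P)` with the
tent `f̃ = f_θ` on the TIED window `[ν₂, ν₁]` (`Repair.tentT θ`; at `θ₀`: `[0.5, 0.504]`, height `1`, (2.28)) —
the printed tent is `T`-free, so the RAW exponents `ν₂, ν₁` of `θ` are used (not the physical `ν₂ − 10τ_T` of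
`H₂`); length `P^{ν₁}` (`f_θ = 0` beyond `ν₁`). [cite: Zhang2022LandauSiegel, §2 (2.28), (2.29)] -/
def J1At (S : Scales) (θ : Theta) (x : Chr S) (s : ℂ) : ℂ :=
  profPoly χ x (tentT θ) ⌈S.P ^ θ.nu1⌉₊ s

/-- **`J₂(s,ψ)` at scale `S` for the design `θ`** ((2.30)): the tent re-read through the functional equation,
`z ↦ f_θ(1 + α̃ − z)`, `α̃ = log(Dt₀)/log P` (`Scales.alphaTilde`), length `P^{1+α̃−ν₂}` — the profile for which
`J₁ − Z(ρ,ψχ)J̄₂` is the approximate-functional-equation defect of (11.1).  At the printed design (`ν₂ = ½`,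
width `0.004`) this is (2.30) VERBATIM: `f̃(z + 0.004 − α̃) = f̃(1 + α̃ − z)` by the symmetry `f̃(w) = f̃(1.004 − w)`
of (2.28); for a general tied window it is the functional-equation dual of `J₁` (the reading under which the
(11.1)-row below is an AFE statement). [cite: Zhang2022LandauSiegel, §2 (2.28), (2.30); §11 (11.1)] -/
def J2At (S : Scales) (θ : Theta) (x : Chr S) (s : ℂ) : ℂ :=
  profPoly χ x (fun z => tentT θ (1 + S.alphaTilde - z)) ⌈S.P ^ (1 + S.alphaTilde - θ.nu2)⌉₊ s

/-- The two-sided value table `𝔥 = u₁ + Z(ρ,ψχ)·ū₂` («`H₁ + Z(ρ,ψχ)H̄₂`», the test function of (2.32), (2.19)).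
[cite: Zhang2022LandauSiegel, §2 (2.19), (2.32)] -/
def twoSided {S : Scales} (u₁ u₂ : Chr S → ℂ → ℂ) : Chr S → ℂ → ℂ :=
  fun x ρ => u₁ x ρ + ZAt χ x ρ * conj (u₂ x ρ)

/-- The approximate-functional-equation defect table `v₁ − Z(ρ,ψχ)·v̄₂` («`J₁ − Z(ρ,ψχ)J̄₂`» of (2.20); on the
line `J̄₂(ρ,ψ) = J₂(1−ρ,ψ̄)`, the quantity of (11.1)). [cite: Zhang2022LandauSiegel, §2 (2.20); §11 (11.1)] -/
def afeDefect {S : Scales} (v₁ v₂ : Chr S → ℂ → ℂ) : Chr S → ℂ → ℂ :=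
  fun x ρ => v₁ x ρ - ZAt χ x ρ * conj (v₂ x ρ)

/-- **`Ξ₁*` at scale `S` on `F`** for value tables `(u₁, u₂; v₁, v₂) = (H₁, H₂; J₁, J₂)`:
`Σ_{ψ∈F}Σ_{ρ∈𝔷(ψ)} 𝔠*(ρ,ψ)(u₁v̄₁ + ū₂v₂)ω(ρ)` (2.17). [cite: Zhang2022LandauSiegel, §2 (2.17)] -/
def xiStar1At (c' : ℝ) (S : Scales) (F : Finset (Chr S)) (u₁ u₂ v₁ v₂ : Chr S → ℂ → ℂ) : ℂ :=
  ∑ x ∈ F, ∑ ρ ∈ Skeleton.finsetOf (zeroSet x),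
    cstar c' S x ρ * (u₁ x ρ * conj (v₁ x ρ) + conj (u₂ x ρ) * v₂ x ρ) * omegaW S ρ

/-- The absolute pairing `Σ_{ψ∈F}Σ_ρ Re𝔠*(ρ,ψ)·‖u‖‖v‖·Re ω(ρ)` — the common shape of `Ξ₂*` (2.19) and `Ξ₃*`
(2.20). [cite: Zhang2022LandauSiegel, §2 (2.19), (2.20)] -/
def absPairing (c' : ℝ) (S : Scales) (F : Finset (Chr S)) (u v : Chr S → ℂ → ℂ) : ℝ :=
  ∑ x ∈ F, ∑ ρ ∈ Skeleton.finsetOf (zeroSet x), (cstar c' S x ρ).re * (‖u x ρ‖ * ‖v x ρ‖) * (omegaW S ρ).re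

/-- **`Ξ₂*` at scale `S`**: `ΣΣ 𝔠*|u₁ + Zū₂||v₁|ω` (2.19). [cite: Zhang2022LandauSiegel, §2 (2.19)] -/
def xiStar2At (c' : ℝ) (S : Scales) (F : Finset (Chr S)) (u₁ u₂ v₁ : Chr S → ℂ → ℂ) : ℝ :=
  absPairing c' S F (twoSided χ u₁ u₂) v₁

/-- **`Ξ₃*` at scale `S`**: `ΣΣ 𝔠*|v₁ − Zv̄₂||u₂|ω` (2.20). [cite: Zhang2022LandauSiegel, §2 (2.20)] -/
def xiStar3At (c' : ℝ) (S : Scales) (F : Finset (Chr S)) (u₂ v₁ v₂ : Chr S → ℂ → ℂ) : ℝ :=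
  absPairing c' S F (afeDefect χ v₁ v₂) u₂

/-- SHAPE **«`|Z(ρ,ψχ)| = 1` at every sampled zero»** (§8 p. 16, used for (2.18) and (8.2); a CONSEQUENCE of
Prop. 2.2 (i) and the primitivity of `ψχ (mod Dp)` — `unitRootAt_scalesAt` below). [cite: Zhang2022LandauSiegel, §2 (2.18); §8 (8.2)] -/
def UnitRootAt (S : Scales) (F : Finset (Chr S)) : Prop :=
  ∀ x ∈ F, ∀ ρ ∈ Skeleton.finsetOf (zeroSet x), ‖ZAt χ x ρ‖ = 1

/-- **`Ξ₁/(𝔞𝔓)` at scale `S` on `F`** — the normalised (2.32)-side mean of the design: the discrete mean of the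
two-sided table `H₁ + ZH̄₂` (`= Ξ₁₁/(𝔞𝔓) + Ξ₁₂/(𝔞𝔓) + 2Re Ξ₁₃/(𝔞𝔓)` by (8.2), `designMeanCS_eq`).
[cite: Zhang2022LandauSiegel, §2 (2.32); §8 (8.1), (8.2)] -/
def designMeanCS (c' : ℝ) (S : Scales) (F : Finset (Chr S)) (θ : Theta) : ℝ :=
  discMean c' S F (twoSided χ (H1At χ S θ) (H2At χ S θ)) / normaliser χ S

/-- **`Ξ_J/(𝔞𝔓)` at scale `S` on `F`** — the normalised (2.33)-side mean of the probe `J₁`.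
[cite: Zhang2022LandauSiegel, §2 (2.33)] -/
def probeMean (c' : ℝ) (S : Scales) (F : Finset (Chr S)) (θ : Theta) : ℝ :=
  discMean c' S F (J1At χ S θ) / normaliser χ S

/-- **`Ξ₁*/(𝔞𝔓)` at scale `S` on `F`** — the normalised cross sum (2.17) of the design against the probe (the
quantity (10.17) evaluates as `𝔡′ + 𝔡 + o(1)`). [cite: Zhang2022LandauSiegel, §2 (2.17); §10 (10.17)] -/
def crossStar (c' : ℝ) (S : Scales) (F : Finset (Chr S)) (θ : Theta) : ℂ :=
  xiStar1At c' S F (H1At χ S θ) (H2At χ S θ) (J1At χ S θ) (J2At χ S θ) / (normaliser χ S : ℂ)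

/-- **The normalised AFE defect `ΣΣ𝔠*|J₁ − ZJ̄₂|²ω/(𝔞𝔓)`** at scale `S` on `F` — the left side of (11.1)
normalised. [cite: Zhang2022LandauSiegel, §11 (11.1)] -/
def defectMean (c' : ℝ) (S : Scales) (F : Finset (Chr S)) (θ : Theta) : ℝ :=
  discMean c' S F (afeDefect χ (J1At χ S θ) (J2At χ S θ)) / normaliser χ S

variable {χ}

/-- The absolute pairing is `≥ 0` under non-negative weights. [cite: Zhang2022LandauSiegel, §2 Lemma 2.3, (2.15)] -/
theorem absPairing_nonneg {c' : ℝ} {S : Scales} {F : Finset (Chr S)} (hw : WeightsNonnegAt c' S F)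
    (u v : Chr S → ℂ → ℂ) : 0 ≤ absPairing c' S F u v := by
  unfold absPairing
  refine Finset.sum_nonneg fun x hx => Finset.sum_nonneg fun ρ hρ => ?_
  have h := hw x hx ρ hρ
  calc (0 : ℝ) ≤ (cstar c' S x ρ).re * (omegaW S ρ).re * (‖u x ρ‖ * ‖v x ρ‖) := mul_nonneg h (by positivity)
    _ = (cstar c' S x ρ).re * (‖u x ρ‖ * ‖v x ρ‖) * (omegaW S ρ).re := by ring

/-- **Cauchy's inequality for the absolute pairing** («by Cauchy's inequality (and Lemma 2.3)», §2 p. 6):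
`(ΣΣ𝔠*‖u‖‖v‖ω)² ≤ (ΣΣ𝔠*‖u‖²ω)(ΣΣ𝔠*‖v‖²ω)` under non-negative weights — so `Ξ₂*² ≤ Ξ₁·Ξ_J` and
`Ξ₃*² ≤ (11.1)·Ξ₁₂`. [cite: Zhang2022LandauSiegel, §2 p. 6, (2.19), (2.32)–(2.33)] -/
theorem absPairing_sq_le {c' : ℝ} {S : Scales} {F : Finset (Chr S)} (hw : WeightsNonnegAt c' S F)
    (u v : Chr S → ℂ → ℂ) :
    absPairing c' S F u v ^ 2 ≤ discMean c' S F u * discMean c' S F v := by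
  set I : Finset ((_ : Chr S) × ℂ) := F.sigma fun x => Skeleton.finsetOf (zeroSet x) with hI
  set w : ((_ : Chr S) × ℂ) → ℝ := fun i => (cstar c' S i.1 i.2).re * (omegaW S i.2).re with hw_def
  have hwI : ∀ i ∈ I, 0 ≤ w i := fun i hi => by
    obtain ⟨hx, hρ⟩ := Finset.mem_sigma.mp hi
    exact hw i.1 hx i.2 hρ
  have hP : absPairing c' S F u v = ∑ i ∈ I, w i * ‖u i.1 i.2‖ * ‖v i.1 i.2‖ := by
    unfold absPairing
    rw [Finset.sum_sigma']
    exact Finset.sum_congr rfl fun i _ => by simp only [hw_def]; ring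
  have hMu : discMean c' S F u = ∑ i ∈ I, w i * ‖u i.1 i.2‖ ^ 2 := by
    unfold discMean
    rw [Finset.sum_sigma']
    exact Finset.sum_congr rfl fun i _ => by simp only [hw_def]; ring
  have hMv : discMean c' S F v = ∑ i ∈ I, w i * ‖v i.1 i.2‖ ^ 2 := by
    unfold discMean
    rw [Finset.sum_sigma']
    exact Finset.sum_congr rfl fun i _ => by simp only [hw_def]; ring
  rw [hP, hMu, hMv]
  refine Finset.sum_sq_le_sum_mul_sum_of_sq_le_mul I
    (fun i hi => mul_nonneg (hwI i hi) (sq_nonneg _)) (fun i hi => mul_nonneg (hwI i hi) (sq_nonneg _))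
    (fun i _ => le_of_eq ?_)
  ring

/-- The termwise bound of the proof of (2.18): `|u₁v̄₁ + ū₂v₂| ≤ |u₁ + Zū₂||v₁| + |v₁ − Zv̄₂||u₂|` for
`|Z| = 1` (the three displays before (2.18)). [cite: Zhang2022LandauSiegel, §2, proof of (2.18)] -/
theorem norm_cross_pt_le {Z u₁ u₂ v₁ v₂ : ℂ} (hZ : ‖Z‖ = 1) :
    ‖u₁ * conj v₁ + conj u₂ * v₂‖ ≤ ‖u₁ + Z * conj u₂‖ * ‖v₁‖ + ‖v₁ - Z * conj v₂‖ * ‖u₂‖ := by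
  have h1 : Z * conj Z = 1 := by
    rw [Complex.mul_conj, Complex.normSq_eq_norm_sq, hZ]; norm_num
  have hid : u₁ * conj v₁ + conj u₂ * v₂ =
      (u₁ + Z * conj u₂) * conj v₁ - (Z * conj v₁ - v₂) * conj u₂ := by ring
  have h2 : Z * conj v₁ - v₂ = Z * conj (v₁ - Z * conj v₂) := by
    simp only [map_sub, map_mul, Complex.conj_conj]
    linear_combination v₂ * h1
  have h3 : ‖Z * conj v₁ - v₂‖ = ‖v₁ - Z * conj v₂‖ := by
    rw [h2, norm_mul, hZ, one_mul, Complex.norm_conj]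
  rw [hid]
  refine (norm_sub_le _ _).trans (le_of_eq ?_)
  rw [norm_mul, norm_mul, Complex.norm_conj, Complex.norm_conj, h3]

/-- **(2.18) at scale `S`, PROVED:** `|Ξ₁*| ≤ Ξ₂* + Ξ₃*` («This yields, by Lemma 2.3, …»: real non-negative
weights `𝔠*ω` let the termwise bound sum), for arbitrary value tables, given `|Z| = 1` at the sampled zeros.
Free-scale twin of the skeleton's `EndgameData.norm_xiStar1_le`. [cite: Zhang2022LandauSiegel, §2 (2.18)] -/
theorem norm_xiStar1At_le {c' : ℝ} {S : Scales} {F : Finset (Chr S)} (hw : WeightsNonnegAt c' S F)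
    (hr : RealWeightsAt c' S F) (hZ : UnitRootAt χ S F) (u₁ u₂ v₁ v₂ : Chr S → ℂ → ℂ) :
    ‖xiStar1At c' S F u₁ u₂ v₁ v₂‖ ≤ xiStar2At χ c' S F u₁ u₂ v₁ + xiStar3At χ c' S F u₂ v₁ v₂ := by
  unfold xiStar1At xiStar2At xiStar3At absPairing
  rw [← Finset.sum_add_distrib]
  refine (norm_sum_le _ _).trans (Finset.sum_le_sum fun x hx => ?_)
  rw [← Finset.sum_add_distrib]
  refine (norm_sum_le _ _).trans (Finset.sum_le_sum fun ρ hρ => ?_)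
  obtain ⟨hc, ho⟩ := hr x hx ρ hρ
  have hwt := hw x hx ρ hρ
  have hcr := norm_cross_pt_le (u₁ := u₁ x ρ) (u₂ := u₂ x ρ) (v₁ := v₁ x ρ) (v₂ := v₂ x ρ) (hZ x hx ρ hρ)
  have hcw : |(cstar c' S x ρ).re| * |(omegaW S ρ).re| = (cstar c' S x ρ).re * (omegaW S ρ).re := by
    rw [← abs_mul]; exact abs_of_nonneg hwt
  rw [norm_mul, norm_mul, norm_eq_abs_re_of_im_eq_zero hc, norm_eq_abs_re_of_im_eq_zero ho]
  calc |(cstar c' S x ρ).re| * ‖u₁ x ρ * conj (v₁ x ρ) + conj (u₂ x ρ) * v₂ x ρ‖ * |(omegaW S ρ).re|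
      = (|(cstar c' S x ρ).re| * |(omegaW S ρ).re|) * ‖u₁ x ρ * conj (v₁ x ρ) + conj (u₂ x ρ) * v₂ x ρ‖ := by
        ring
    _ ≤ (|(cstar c' S x ρ).re| * |(omegaW S ρ).re|) *
          (‖twoSided χ u₁ u₂ x ρ‖ * ‖v₁ x ρ‖ + ‖afeDefect χ v₁ v₂ x ρ‖ * ‖u₂ x ρ‖) :=
        mul_le_mul_of_nonneg_left hcr (by positivity)
    _ = (cstar c' S x ρ).re * (‖twoSided χ u₁ u₂ x ρ‖ * ‖v₁ x ρ‖) * (omegaW S ρ).re +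
          (cstar c' S x ρ).re * (‖afeDefect χ v₁ v₂ x ρ‖ * ‖u₂ x ρ‖) * (omegaW S ρ).re := by
        rw [hcw]; ring

/-- `|a + Zb̄|² = |a|² + |b|² + 2Re(Z⁻¹ab)` for `|Z| = 1` — the pointwise identity behind (8.2)
`Ξ₁ = Ξ₁₁ + Ξ₁₂ + 2Re Ξ₁₃`. [cite: Zhang2022LandauSiegel, §8 (8.2)] -/
theorem normSq_twoSided_pt {Z a b : ℂ} (hZ : ‖Z‖ = 1) :
    ‖a + Z * conj b‖ ^ 2 = ‖a‖ ^ 2 + ‖b‖ ^ 2 + 2 * (Z⁻¹ * (a * b)).re := by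
  have hZ1 : Complex.normSq Z = 1 := by rw [Complex.normSq_eq_norm_sq, hZ, one_pow]
  have hZi : Z⁻¹ = conj Z := by rw [Complex.inv_def, hZ1]; simp
  have hab : a * conj (Z * conj b) = conj Z * (a * b) := by
    rw [map_mul, Complex.conj_conj]; ring
  rw [← Complex.normSq_eq_norm_sq, ← Complex.normSq_eq_norm_sq, ← Complex.normSq_eq_norm_sq,
    Complex.normSq_add, Complex.normSq_mul, Complex.normSq_conj, hZ1, one_mul, hab, hZi]

/-- With real weights, `Re(𝔠*·z·ω) = Re𝔠*·Re z·Re ω`. [cite: Zhang2022LandauSiegel, §2 (2.11), (2.15)] -/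
theorem re_weight_mul {c ω z : ℂ} (hc : c.im = 0) (hω : ω.im = 0) :
    (c * z * ω).re = c.re * z.re * ω.re := by
  have hc' : c = ((c.re : ℝ) : ℂ) := Complex.ext (by simp) (by simp [hc])
  have hω' : ω = ((ω.re : ℝ) : ℂ) := Complex.ext (by simp) (by simp [hω])
  rw [hc', hω']
  simp only [Complex.re_mul_ofReal, Complex.re_ofReal_mul, Complex.ofReal_re]

/-- **(8.2) at scale `S`, PROVED:** with real weights and `|Z| = 1` at the sampled zeros, the discrete mean of
the two-sided table splits as `Ξ(u₁ + Zū₂) = Ξ(u₁) + Ξ(u₂) + 2Re ΣΣ𝔠*Z⁻¹u₁u₂ω` — free-scale twin of the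
skeleton's `xi1_eq`. [cite: Zhang2022LandauSiegel, §8 (8.1)–(8.2), (8.3)–(8.5)] -/
theorem discMean_twoSided {c' : ℝ} {S : Scales} {F : Finset (Chr S)} (hr : RealWeightsAt c' S F)
    (hZ : UnitRootAt χ S F) (u₁ u₂ : Chr S → ℂ → ℂ) :
    discMean c' S F (twoSided χ u₁ u₂) = discMean c' S F u₁ + discMean c' S F u₂ +
      2 * (∑ x ∈ F, ∑ ρ ∈ Skeleton.finsetOf (zeroSet x),
        cstar c' S x ρ * (ZAt χ x ρ)⁻¹ * (u₁ x ρ * u₂ x ρ) * omegaW S ρ).re := by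
  unfold discMean
  rw [Complex.re_sum, Finset.mul_sum, ← Finset.sum_add_distrib, ← Finset.sum_add_distrib]
  refine Finset.sum_congr rfl fun x hx => ?_
  rw [Complex.re_sum, Finset.mul_sum, ← Finset.sum_add_distrib, ← Finset.sum_add_distrib]
  refine Finset.sum_congr rfl fun ρ hρ => ?_
  obtain ⟨hc, ho⟩ := hr x hx ρ hρ
  have key := normSq_twoSided_pt (a := u₁ x ρ) (b := u₂ x ρ) (hZ x hx ρ hρ)
  have hre : (cstar c' S x ρ * (ZAt χ x ρ)⁻¹ * (u₁ x ρ * u₂ x ρ) * omegaW S ρ).re =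
      (cstar c' S x ρ).re * ((ZAt χ x ρ)⁻¹ * (u₁ x ρ * u₂ x ρ)).re * (omegaW S ρ).re := by
    rw [show cstar c' S x ρ * (ZAt χ x ρ)⁻¹ * (u₁ x ρ * u₂ x ρ) * omegaW S ρ =
      cstar c' S x ρ * ((ZAt χ x ρ)⁻¹ * (u₁ x ρ * u₂ x ρ)) * omegaW S ρ by ring]
    exact re_weight_mul hc ho
  simp only [twoSided]
  rw [key, hre]
  ring

/-- **`Ξ₁/(𝔞𝔓) = Ξ₁₁/(𝔞𝔓) + Ξ₁₂/(𝔞𝔓) + 2Re Ξ₁₃/(𝔞𝔓)`** for the design `θ` at scale `S` (real weights,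
`|Z| = 1`): the CS-sheet design mean is the sum of E-022's three blocks `diagMean1 + diagMean2 + crossMean2Re`
— so the tie/CS sheet READS THE SAME dictionary row E-022 as the POS sheet. [cite: Zhang2022LandauSiegel, §8 (8.2)] -/
theorem designMeanCS_eq {c' : ℝ} {S : Scales} {F : Finset (Chr S)} (hr : RealWeightsAt c' S F)
    (hZ : UnitRootAt χ S F) (θ : Theta) :
    designMeanCS χ c' S F θ = diagMean1 χ c' S F θ + diagMean2 χ c' S F θ + crossMean2Re χ c' S F θ := by
  unfold designMeanCS diagMean1 diagMean2 crossMean2Re crossSum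
  rw [discMean_twoSided hr hZ, Complex.div_ofReal_re, add_div, add_div]
  ring

/-- `√(a/N · b/N)·N = √(ab)` for `N > 0`. [folklore] -/
private theorem sqrt_div_mul_self {a b N : ℝ} (hN : 0 < N) : Real.sqrt (a / N * (b / N)) * N = Real.sqrt (a * b) := by
  rw [div_mul_div_comm, Real.sqrt_div' _ (mul_self_nonneg N), Real.sqrt_mul_self hN.le,
    div_mul_cancel₀ _ hN.ne']

/-- **(2.18) + Cauchy, normalised, PROVED:** at every scale record with real non-negative weights and
`|Z| = 1` at the sampled zeros,
`‖Ξ₁*/(𝔞𝔓)‖ ≤ √(Ξ₁/(𝔞𝔓) · Ξ_J/(𝔞𝔓)) + √((11.1)/(𝔞𝔓) · Ξ₁₂/(𝔞𝔓))`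
— the whole analytic skeleton of the manuscript's §2 endgame («a contradiction is immediately derived from
(2.18), Proposition 2.4, 2.5 and 2.6») in one inequality; valid also when `𝔞𝔓 = 0` (all quantities are then
`0`).  No asymptotics, no (A). [cite: Zhang2022LandauSiegel, §2 (2.18), p. 6; §11 p. 23] -/
theorem norm_crossStar_le {c' : ℝ} {S : Scales} {F : Finset (Chr S)} (hw : WeightsNonnegAt c' S F)
    (hr : RealWeightsAt c' S F) (hZ : UnitRootAt χ S F) (θ : Theta) :
    ‖crossStar χ c' S F θ‖ ≤ Real.sqrt (designMeanCS χ c' S F θ * probeMean χ c' S F θ) +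
      Real.sqrt (defectMean χ c' S F θ * diagMean2 χ c' S F θ) := by
  have hN := normaliser_nonneg χ S
  unfold crossStar designMeanCS probeMean defectMean diagMean2
  rcases hN.eq_or_lt with hN0 | hNpos
  · rw [← hN0]
    simp
  · have h218 := norm_xiStar1At_le hw hr hZ (H1At χ S θ) (H2At χ S θ) (J1At χ S θ) (J2At χ S θ)
    have h2 : xiStar2At χ c' S F (H1At χ S θ) (H2At χ S θ) (J1At χ S θ) ≤
        Real.sqrt (discMean c' S F (twoSided χ (H1At χ S θ) (H2At χ S θ)) * discMean c' S F (J1At χ S θ)) :=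
      (Real.le_sqrt (absPairing_nonneg hw _ _)
        (mul_nonneg (discMean_nonneg_of_weights hw _) (discMean_nonneg_of_weights hw _))).mpr
        (absPairing_sq_le hw _ _)
    have h3 : xiStar3At χ c' S F (H2At χ S θ) (J1At χ S θ) (J2At χ S θ) ≤
        Real.sqrt (discMean c' S F (afeDefect χ (J1At χ S θ) (J2At χ S θ)) * discMean c' S F (H2At χ S θ)) :=
      (Real.le_sqrt (absPairing_nonneg hw _ _)
        (mul_nonneg (discMean_nonneg_of_weights hw _) (discMean_nonneg_of_weights hw _))).mpr
        (absPairing_sq_le hw _ _)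
    rw [norm_div, Complex.norm_real, Real.norm_of_nonneg hN, div_le_iff₀ hNpos, add_mul,
      sqrt_div_mul_self hNpos, sqrt_div_mul_self hNpos]
    linarith

end CSObjects

/-! ### `|Z(ρ,ψχ)| = 1` at the sampled zeros, from Prop. 2.2 (i) — PROVED at the regime's scale records -/

section UnitRoot

variable {D : ℕ} [NeZero D] {χ : DirichletCharacter ℂ D}

/-- A product of primitive characters to coprime moduli is primitive (as in the skeleton's assembly: write
`χ₁ = (χ₁χ₂)·χ₂⁻¹`, `𝔣(θθ′) ∣ lcm(𝔣(θ), 𝔣(θ′))`). [folklore] -/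
private theorem isPrimitive_changeLevel_mul' {n m : ℕ} [NeZero n] [NeZero m] (hnm : Nat.Coprime n m)
    {χ₁ : DirichletCharacter ℂ n} {χ₂ : DirichletCharacter ℂ m} (h₁ : χ₁.IsPrimitive)
    (h₂ : χ₂.IsPrimitive) :
    (haveI : NeZero (n * m) := ⟨mul_ne_zero (NeZero.ne n) (NeZero.ne m)⟩
     (DirichletCharacter.changeLevel (dvd_mul_right n m) χ₁ *
      DirichletCharacter.changeLevel (dvd_mul_left m n) χ₂).IsPrimitive) := by
  haveI : NeZero (n * m) := ⟨mul_ne_zero (NeZero.ne n) (NeZero.ne m)⟩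
  set A := DirichletCharacter.changeLevel (dvd_mul_right n m) χ₁ with hA
  set B := DirichletCharacter.changeLevel (dvd_mul_left m n) χ₂ with hB
  have hAc : A.conductor = n := by
    rw [hA, DirichletCharacter.conductor_changeLevel]
    exact (DirichletCharacter.isPrimitive_def _).mp h₁
  have hBc : B.conductor = m := by
    rw [hB, DirichletCharacter.conductor_changeLevel]
    exact (DirichletCharacter.isPrimitive_def _).mp h₂
  rw [DirichletCharacter.isPrimitive_def]
  refine Nat.dvd_antisymm (DirichletCharacter.conductor_dvd_level _) ?_
  have hn : n ∣ (A * B).conductor := by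
    have h := DirichletCharacter.conductor_mul_dvd_lcm_conductor (A * B) B⁻¹
    rw [mul_inv_cancel_right, hAc, DirichletCharacter.conductor_inv, hBc] at h
    exact hnm.dvd_of_dvd_mul_right (h.trans (Nat.lcm_dvd_mul _ m))
  have hm : m ∣ (A * B).conductor := by
    have h := DirichletCharacter.conductor_mul_dvd_lcm_conductor A⁻¹ (A * B)
    rw [inv_mul_cancel_left, DirichletCharacter.conductor_inv, hAc, hBc] at h
    exact hnm.symm.dvd_of_dvd_mul_left (h.trans (Nat.lcm_dvd_mul n _))
  exact hnm.mul_dvd_of_dvd_of_dvd hn hm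

omit [NeZero D] in
/-- `log D ≥ 1` for `D ≥ 3`. [cite: Zhang2022LandauSiegel, §2 (2.1)] -/
theorem one_le_log_of_three_le (hD : 3 ≤ D) : 1 ≤ Real.log (D : ℝ) := by
  have hD' : (3 : ℝ) ≤ D := by exact_mod_cast hD
  have h3 : (1 : ℝ) < Real.log 3 := by
    rw [Real.lt_log_iff_exp_lt (by norm_num)]
    exact Real.exp_one_lt_d9.trans (by norm_num)
  exact le_trans h3.le (Real.log_le_log (by norm_num) hD')

/-- **`|Z(ρ,ψχ)| = 1` at every sampled zero, PROVED** at the scale record `(D^A, D^B)` of the regime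
(`KnifeEdge.scalesAt A B D`) from Prop. 2.2 (i) («on the line»): a zero `ρ ∈ 𝔷(ψ)` has `Im ρ > 2πt₀ − 𝓛₁ > 0`
(`t₀ = 𝓛⁵¹⁹ ≥ 𝓛₁ = 𝓛⁴⁰⁵`, `D ≥ 3`), the modulus `p > P = D^A ≥ D` (`A ≥ 1`) is a prime not dividing `D`, so
`ψχ (mod Dp)` is primitive and `|Z(½ + it, ψχ)| = 1` (`GammaFactor.norm_Zfac_half_eq_one`, §8 p. 16).
[cite: Zhang2022LandauSiegel, §2 Prop. 2.2 (i), (2.14); §4 p. 8; §8 (8.2)] -/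
theorem unitRootAt_scalesAt {A B : ℝ} {F : Finset (Chr (KnifeEdge.scalesAt A B D))}
    (hχ : χ.IsPrimitive) (hD : 3 ≤ D) (hA : 1 ≤ A) (hline : OnLineSimple χ (KnifeEdge.scalesAt A B D) F) :
    UnitRootAt χ (KnifeEdge.scalesAt A B D) F := by
  set S := KnifeEdge.scalesAt A B D with hSdef
  intro x hx ρ hρ
  obtain ⟨h1, h2, h3⟩ := Skeleton.mem_of_mem_finsetOf hρ
  have hprod : ρ ∈ prodZeroSet χ x := ⟨h1, h2, by rw [h3, zero_mul]⟩
  have hre : ρ.re = 1 / 2 := (hline x hx ρ hprod).1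
  have hlog : 1 ≤ Real.log (D : ℝ) := one_le_log_of_three_le hD
  have ht0 : S.t0 = Real.log (D : ℝ) ^ 519 := rfl
  have hL1 : S.L1 = Real.log (D : ℝ) ^ 405 := rfl
  have ht0pos : 0 < S.t0 := by rw [ht0]; positivity
  have hL1le : S.L1 ≤ S.t0 := by rw [ht0, hL1]; exact pow_le_pow_right₀ hlog (by norm_num)
  have him : 0 < ρ.im := by
    have hlt := (abs_lt.mp h2).1
    have hπt : 3 * S.t0 < π * S.t0 := mul_lt_mul_of_pos_right Real.pi_gt_three ht0pos
    linarith
  -- the modulus `p` exceeds `P = exp(A·log D) ≥ D`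
  have hD0 : (0 : ℝ) < D := by exact_mod_cast (by omega : 0 < D)
  have hDP : (D : ℝ) ≤ S.P := by
    show (D : ℝ) ≤ Real.exp (A * Real.log D)
    calc (D : ℝ) = Real.exp (Real.log D) := (Real.exp_log hD0).symm
      _ ≤ Real.exp (A * Real.log D) :=
          Real.exp_le_exp.mpr (le_mul_of_one_le_left (by linarith) hA)
  have hPp : S.P < x.p := by
    have hm := x.mem
    simp only [Scales.primeWindow, Finset.mem_filter, Finset.mem_Ioo] at hm
    exact (Nat.floor_lt (le_trans hD0.le hDP)).mp hm.1.1
  have hDp : D < x.p := by exact_mod_cast lt_of_le_of_lt hDP hPp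
  have hcop : Nat.Coprime D x.p :=
    Nat.coprime_comm.mp ((Nat.Prime.coprime_iff_not_dvd x.prime).mpr
      (Nat.not_dvd_of_pos_of_lt (by omega) hDp))
  haveI := x.neZero
  have hprim := isPrimitive_changeLevel_mul' hcop hχ x.prim
  have hρ' : ρ = 1 / 2 + (ρ.im : ℂ) * I := Complex.ext (by simp [hre]) (by simp)
  have key : ‖ZAt χ x (1 / 2 + (ρ.im : ℂ) * I)‖ = 1 := by
    unfold ZAt
    exact GammaFactor.norm_Zfac_half_eq_one hprim him
  rwa [← hρ'] at key

end UnitRoot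

/-! ### The CS-currency dictionary rows at fixed `A` (shapes; asserted by no one) -/

section CSRows

variable {D : ℕ} [NeZero D] (χ : DirichletCharacter ℂ D)

/-- **The PROBE in the reflection frame at scale `S`**: the tent's tied window `[ν₂, ν₁]` (T-free, (2.28))
multiplied by `L_M/L_R(P) = Scales.shrink` (ls-theory's frame rule, as `thetaRefl` does for the `H`-side lengths;
only `ν₁, ν₂` of the result are read, by `Repair.tentT`). [cite: Zhang2022LandauSiegel, §2 (2.28)–(2.30), (2.10)] -/
def thetaReflJ (S : Scales) (θ : Theta) : Theta :=
  { θ with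
    nu1 := S.shrink * θ.nu1
    nu2 := S.shrink * θ.nu2 }

/-- **The probe slot of the `ℓ`-dictionary**: `C₂₃₃^{(ℓ(P))}` on the reflection-frame probe —
`F_{ℓ(P)}(f)` for the rescaled tent (`C233Ell`; at `ℓ = 1`, `shrink = 1`: the class-`R` value `Repair.C233T`,
`C233Ell_one`).  The zeroth-order dictionary value of `Ξ_J/(𝔞𝔓)` in the cell's convention «`F_ℓ` in all three
constants» (OBJECTIVE §2.2 row ell). [cite: Zhang2022LandauSiegel, §2 (2.33); §10 (10.19); §18 (18.3)] -/
def probeSlot (S : Scales) (θ : Theta) : ℝ := C233Ell S.ellP (thetaReflJ S θ)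

/-- **The cross slot of the `ℓ`-dictionary**: `(𝔡′+𝔡)^{(ℓ(P))}` — the polar `F_{ℓ(P)}`-form of the
reflection-frame glued `H`-profile `𝔤` (`Repair.gluedS (thetaRefl S θ)`, the profile E-022's blocks live on)
against the reflection-frame tent (`Repair.tentT (thetaReflJ S θ)`); when `τ_T = 0` the two frames agree and this is
`dSumEll ℓ(P) (thetaRefl S θ)` (`crossSlot_eq_dSumEll`).  The zeroth-order dictionary value of `Ξ₁*/(𝔞𝔓)` ((10.17):
`Ξ₁* = (𝔡′+𝔡)𝔞𝔓 + o(𝔓)` at the pinned scales). [cite: Zhang2022LandauSiegel, §2 (2.17); §10 (10.1), (10.17)] -/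
def crossSlot (S : Scales) (θ : Theta) : ℂ :=
  mainTermFormEllPolar S.ellP (gluedS (thetaRefl S θ)) (gluedS' (thetaRefl S θ))
    (tentT (thetaReflJ S θ)) (tentT' (thetaReflJ S θ))

/-- The tent reads only `ν₁, ν₂`: when `τ_T = 0` the probe frame and the `H`-frame design have the same tent.
[cite: Zhang2022LandauSiegel, §2 (2.21), (2.28)] -/
theorem tentT_thetaReflJ_of_tauT_eq_zero {S : Scales} (h : S.tauT = 0) (θ : Theta) :
    tentT (thetaReflJ S θ) = tentT (thetaRefl S θ) ∧ tentT' (thetaReflJ S θ) = tentT' (thetaRefl S θ) := by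
  have hν1 : (thetaReflJ S θ).nu1 = (thetaRefl S θ).nu1 := rfl
  have hν2 : (thetaReflJ S θ).nu2 = (thetaRefl S θ).nu2 := by
    show S.shrink * θ.nu2 = S.shrink * (θ.nu2 - 10 * S.tauT)
    rw [h, mul_zero, sub_zero]
  have hsig : (thetaReflJ S θ).sig = (thetaRefl S θ).sig := by unfold Theta.sig; rw [hν1, hν2]
  have hhw : (thetaReflJ S θ).hw = (thetaRefl S θ).hw := by unfold Theta.hw; rw [hν1, hν2]
  have hmid : (thetaReflJ S θ).mid1 = (thetaRefl S θ).mid1 := by unfold Theta.mid1; rw [hν1, hν2]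
  constructor
  · funext z
    simp only [tentT, tentR, hsig, hhw, hmid]
  · funext z
    simp only [tentT', tentR', hν1, hν2, hsig, hmid]

/-- At `τ_T = 0` (no `T`-length in the design: `log T = 0`, or the `P`-side regime) the cross slot is
`dSumEll ℓ(P)` of the reflection-frame design and the probe slot is its `C233Ell ℓ(P)`.
[cite: Zhang2022LandauSiegel, §2 (2.17), (2.33); §10 (10.17)] -/
theorem crossSlot_eq_dSumEll {S : Scales} (h : S.tauT = 0) (θ : Theta) :
    crossSlot S θ = dSumEll S.ellP (thetaRefl S θ) ∧ probeSlot S θ = C233Ell S.ellP (thetaRefl S θ) := by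
  obtain ⟨h1, h2⟩ := tentT_thetaReflJ_of_tauT_eq_zero h θ
  have hθ : tentT (thetaReflJ S θ) = tentT (thetaRefl S θ) := h1
  constructor
  · unfold crossSlot dSumEll; rw [h1, h2]
  · unfold probeSlot C233Ell; rw [h1, h2]

/-- **The CS-side dictionary inequalities at one scale record** (companion of `DictAt`): the normalised probe mean
`Ξ_J/(𝔞𝔓)` is within `K/A²` of `probeSlot + g_J/A` (free-scale, first-order shape of (2.33)/(18.3)); the normalised
cross sum `Ξ₁*/(𝔞𝔓)` is within `K/A²` of `crossSlot + g_X/A` (free-scale, first-order shape of Prop. 2.4's (10.17));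
and the normalised AFE defect (11.1) is at most `δ` (free-scale shape of Prop. 2.6).  `g_J ∈ ℝ`, `g_X ∈ ℂ`, `δ` are
VISIBLE first-order / defect slots (what a derivation must supply — the probe-side analogue of D-ell-1).
[cite: Zhang2022LandauSiegel, §2 Props. 2.4–2.6, (2.33); §10 (10.17); §11 (11.1); §18 (18.3)] -/
def CSProbeDictAt (c' : ℝ) (S : Scales) (F : Finset (Chr S)) (θ : Theta) (gJ : ℝ) (gX : ℂ) (δ K A : ℝ) :
    Prop :=
  |probeMean χ c' S F θ - (probeSlot S θ + gJ / A)| ≤ K / A ^ 2 ∧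
  ‖crossStar χ c' S F θ - (crossSlot S θ + gX / A)‖ ≤ K / A ^ 2 ∧
  defectMean χ c' S F θ ≤ δ

variable {χ}

/-- **«EllCSDictLam» — the first-order dictionary of the tie/CS sheet at fixed `A`** (the CS-currency extension
of E-022 = `EllDictFirstOrderLam`, SAME adversarial `λ`): for every design `θ` of the class `Adm`, every
`A ≥ A₀` and every `B`: eventually in `D`, under (A), for SOME `λ = λ(D,χ)` with `|λ| ≤ Λ`, at every scale record of
the regime `(D^A, D^B)`, on `Fam S`: E-022's three block inequalities (`DictAt` with `G₀ + λG₁`) AND the probe /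
cross / defect inequalities (`CSProbeDictAt` with `G_J⁰ + λG_J¹`, `G_X⁰ + λG_X¹`, `δ(θ,B,A)`), all to `K(θ,B)/A²`.
Every functional is a VISIBLE PARAMETER; the row is a DEFINITION, asserted for no value of them (status of its
conjuncts: E-022 derivation/D-ell-1; probe, cross, defect = the free-scale re-reads of (18.3), (10.17), (11.1) —
not started).  Its POS-sheet projection is `EllCSDictLam.dictLam`.
[cite: Zhang2022LandauSiegel, §2 (2.17), (2.32)–(2.33), Props. 2.4–2.6; §8 (8.23); §10 (10.17); §11 (11.1); §18 (18.3)] -/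
def EllCSDictLam (c' : ℝ) (Fam : (S : Scales) → Finset (Chr S)) (Adm : Theta → Prop)
    (G₀ G₁ : Theta → ℝ → ℝ × ℝ × ℝ) (GJ₀ GJ₁ : Theta → ℝ → ℝ) (GX₀ GX₁ : Theta → ℝ → ℂ) (Λ : ℝ)
    (δf : Theta → ℝ → ℝ → ℝ) (K : Theta → ℝ → ℝ) (A₀ : ℝ) : Prop :=
  ∀ θ : Theta, Adm θ → ∀ A B : ℝ, A₀ ≤ A →
    ForAllLarge fun D _ χ => AssumptionA D χ → ∃ lam : ℝ, |lam| ≤ Λ ∧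
      ∀ S : Scales, S.D = D → S.IsEllRegime A B →
        DictAt χ c' S (Fam S) θ ((G₀ θ B).1 + lam * (G₁ θ B).1) ((G₀ θ B).2.1 + lam * (G₁ θ B).2.1)
            ((G₀ θ B).2.2 + lam * (G₁ θ B).2.2) (K θ B) A ∧
          CSProbeDictAt χ c' S (Fam S) θ (GJ₀ θ B + lam * GJ₁ θ B) (GX₀ θ B + lam * GX₁ θ B) (δf θ B A)
            (K θ B) A

/-- The tie/CS dictionary CONTAINS E-022 in its `λ`-form (same `λ`): its POS-sheet projection.
[cite: Zhang2022LandauSiegel, §8 (8.23)] -/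
theorem EllCSDictLam.dictLam {c' : ℝ} {Fam : (S : Scales) → Finset (Chr S)} {Adm : Theta → Prop}
    {G₀ G₁ : Theta → ℝ → ℝ × ℝ × ℝ} {GJ₀ GJ₁ : Theta → ℝ → ℝ} {GX₀ GX₁ : Theta → ℝ → ℂ} {Λ : ℝ}
    {δf : Theta → ℝ → ℝ → ℝ} {K : Theta → ℝ → ℝ} {A₀ : ℝ}
    (h : EllCSDictLam c' Fam Adm G₀ G₁ GJ₀ GJ₁ GX₀ GX₁ Λ δf K A₀) :
    EllDictFirstOrderLam c' Fam Adm G₀ G₁ Λ K A₀ := by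
  intro θ hθ A B hA
  refine (h θ hθ A B hA).mono fun D _ χ _ _ hD hAss => ?_
  obtain ⟨lam, hlam, hS⟩ := hD hAss
  exact ⟨lam, hlam, fun S hSD hreg => (hS S hSD hreg).1⟩

/-! ### The CS certificate and the PROVED endgame -/

/-- Dictionary upper value of `Ξ₁/(𝔞𝔓)` read through E-022 at `(S, θ, λ, A)`:
`C₂₃₂^{(ℓ(P))}(θ_refl) + (ΣG₀ + λΣG₁)/A + 3K/A²` (three blocks, `ellBlocks_sum`). [cite: Zhang2022LandauSiegel, §2 (2.32); §8 (8.2)] -/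
def csMD (S : Scales) (θ : Theta) (G₀ G₁ : ℝ × ℝ × ℝ) (K A lam : ℝ) : ℝ :=
  C232Ell S.ellP (thetaRefl S θ) + ((G₀.1 + G₀.2.1 + G₀.2.2) + lam * (G₁.1 + G₁.2.1 + G₁.2.2)) / A +
    3 * (K / A ^ 2)

/-- Dictionary upper value of `Ξ₁₂/(𝔞𝔓)` (E-022 block 2) at `(S, θ, λ, A)`. [cite: Zhang2022LandauSiegel, §9 (9.7)] -/
def csM2 (S : Scales) (θ : Theta) (G₀ G₁ : ℝ × ℝ × ℝ) (K A lam : ℝ) : ℝ :=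
  ellBlock2 S.ellP (thetaRefl S θ) + (G₀.2.1 + lam * G₁.2.1) / A + K / A ^ 2

/-- Dictionary upper value of `Ξ_J/(𝔞𝔓)` at `(S, θ, λ, A)`. [cite: Zhang2022LandauSiegel, §2 (2.33)] -/
def csMJ (S : Scales) (θ : Theta) (GJ₀ GJ₁ K A lam : ℝ) : ℝ :=
  probeSlot S θ + (GJ₀ + lam * GJ₁) / A + K / A ^ 2

/-- Dictionary lower value of `‖Ξ₁*/(𝔞𝔓)‖` at `(S, θ, λ, A)`. [cite: Zhang2022LandauSiegel, §2 (2.17), Prop. 2.4; §10 (10.17)] -/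
def csX (S : Scales) (θ : Theta) (GX₀ GX₁ : ℂ) (K A lam : ℝ) : ℝ :=
  ‖crossSlot S θ + (GX₀ + lam * GX₁) / A‖ - K / A ^ 2

/-- **The CS CLOSING INEQUALITY at `(S, θ, λ, A)`** — OBJECTIVE.md's «`|dSum|² > C232·C233`» with the first-order
terms, the `K/A²` tolerances and Prop. 2.6's defect made explicit:
`√(M_D⁺·M_J⁺) + √(δ⁺·M₂⁺) < X` (`x⁺ = max x 0`).  A DEFINITION (what a certificate must establish).
[cite: Zhang2022LandauSiegel, §2 p. 6 (Props. 2.4–2.6, (2.18))] -/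
def CSClosesAt (S : Scales) (θ : Theta) (G₀ G₁ : ℝ × ℝ × ℝ) (GJ₀ GJ₁ : ℝ) (GX₀ GX₁ : ℂ)
    (δ K A lam : ℝ) : Prop :=
  Real.sqrt (max (csMD S θ G₀ G₁ K A lam) 0 * max (csMJ S θ GJ₀ GJ₁ K A lam) 0) +
      Real.sqrt (max δ 0 * max (csM2 S θ G₀ G₁ K A lam) 0) <
    csX S θ GX₀ GX₁ K A lam

/-- The arithmetic of the contradiction: actual normalised means `m ≤ M` (`m_J, m₂ ≥ 0`), the chain
`X ≤ ‖Ξ₁*‖/𝔞𝔓 ≤ √(m_D m_J) + √(m_f m₂)`, and the certificate `√(M_D⁺M_J⁺) + √(δ⁺M₂⁺) < X` are incompatible.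
[cite: Zhang2022LandauSiegel, §2 p. 6] -/
theorem cs_contra {mD mJ m2 mf xs MD MJ M2 δ X : ℝ} (h0J : 0 ≤ mJ) (h02 : 0 ≤ m2)
    (hxs : xs ≤ Real.sqrt (mD * mJ) + Real.sqrt (mf * m2)) (hD : mD ≤ MD) (hJ : mJ ≤ MJ)
    (h2 : m2 ≤ M2) (hf : mf ≤ δ) (hX : X ≤ xs)
    (hcert : Real.sqrt (max MD 0 * max MJ 0) + Real.sqrt (max δ 0 * max M2 0) < X) : False := by
  have a : Real.sqrt (mD * mJ) ≤ Real.sqrt (max MD 0 * max MJ 0) :=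
    Real.sqrt_le_sqrt (mul_le_mul (hD.trans (le_max_left _ _)) (hJ.trans (le_max_left _ _)) h0J
      (le_max_right _ _))
  have b : Real.sqrt (mf * m2) ≤ Real.sqrt (max δ 0 * max M2 0) :=
    Real.sqrt_le_sqrt (mul_le_mul (hf.trans (le_max_left _ _)) (h2.trans (le_max_left _ _)) h02
      (le_max_right _ _))
  linarith

/-- **THE CAUCHY–SCHWARZ ENDGAME AT FIXED `A`, PROVED** (free-scale twin of the skeleton's
`eventually_not_assumptionA_of_props`, §2 p. 6).  If the tie/CS dictionary `EllCSDictLam` holds from `A₀`,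
Lemma 2.3 at fixed `A` (`Lemma23FixedA`, ell-E13) from `A₁`, and the zero model (`EllZeroModelFixedA`, E-020 —
only «on the line» is used: non-negative real weights AND `|Z(ρ,ψχ)| = 1`) from `A₂`, all on the same `Fam`, and if
for an admissible design `θ` at some `A ≥ max(A₀, A₁, A₂, 1)` and `B` the CS closing inequality `CSClosesAt` holds at
every large-`D` scale record `(D^A, D^B)` for EVERY `|λ| ≤ Λ`, then (A) fails for every real primitive character to
every large modulus: at the record, `X ≤ ‖Ξ₁*‖/𝔞𝔓 ≤ √(Ξ₁Ξ_J)/𝔞𝔓 + √((11.1)·Ξ₁₂)/𝔞𝔓 ≤ √(M_D⁺M_J⁺) + √(δ⁺M₂⁺) < X`.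
The three `Prop` hypotheses are registry rows asserted by no one; this is what «a tie design closes in OBJ_CS
currency at `(A, B)`» MEANS in the kernel. [cite: Zhang2022LandauSiegel, §2 p. 6, (2.17)–(2.20), (2.32)–(2.33), Props. 2.4–2.6] -/
theorem forAllLarge_not_assumptionA_of_csDict {c' : ℝ} {Fam : (S : Scales) → Finset (Chr S)}
    {Adm : Theta → Prop} {G₀ G₁ : Theta → ℝ → ℝ × ℝ × ℝ} {GJ₀ GJ₁ : Theta → ℝ → ℝ}
    {GX₀ GX₁ : Theta → ℝ → ℂ} {Λ : ℝ} {δf : Theta → ℝ → ℝ → ℝ} {K : Theta → ℝ → ℝ}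
    {A₀ A₁ cZ A₂ A B : ℝ} {θ : Theta}
    (hdict : EllCSDictLam c' Fam Adm G₀ G₁ GJ₀ GJ₁ GX₀ GX₁ Λ δf K A₀) (h23 : Lemma23FixedA c' Fam A₁)
    (hZ : EllZeroModelFixedA Fam cZ A₂) (hθ : Adm θ) (h0 : A₀ ≤ A) (h1 : A₁ ≤ A) (h2 : A₂ ≤ A)
    (hA : 1 ≤ A)
    (hcert : ∃ D₁ : ℕ, ∀ S : Scales, D₁ ≤ S.D → S.IsEllRegime A B → ∀ lam : ℝ, |lam| ≤ Λ →
      CSClosesAt S θ (G₀ θ B) (G₁ θ B) (GJ₀ θ B) (GJ₁ θ B) (GX₀ θ B) (GX₁ θ B) (δf θ B A) (K θ B) A lam) :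
    ForAllLarge fun D _ χ => ¬ AssumptionA D χ := by
  obtain ⟨C, hZ⟩ := hZ
  obtain ⟨D₁, hcert⟩ := hcert
  have hev := (((hdict θ hθ A B h0).and (h23 A h1)).and (hZ A h2)).and
    (ForAllLarge.of_le (S := fun D _ _ => max D₁ 3 ≤ D) (max D₁ 3) fun D _ χ hD _ _ => hD)
  refine hev.mono fun D _ χ _ hχp hall hA' => ?_
  obtain ⟨⟨⟨hd, h23D⟩, hZD⟩, hD⟩ := hall
  have hD3 : 3 ≤ D := le_trans (le_max_right _ _) hD
  set S := KnifeEdge.scalesAt A B D with hSdef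
  have hreg : S.IsEllRegime A B := ⟨⟨rfl, rfl, rfl, rfl, rfl⟩, rfl⟩
  have hregP : S.IsEllRegimeP A := hreg.1
  have hSD : S.D = D := rfl
  have hD1 : D₁ ≤ S.D := le_trans (le_max_left _ _) hD
  have hL2 : 0 < S.L2 := by
    show 0 < Real.log (D : ℝ) ^ 400
    exact pow_pos (by linarith [one_le_log_of_three_le hD3]) _
  obtain ⟨lam, hlam, hdS⟩ := hd hA'
  obtain ⟨⟨e1, e2, e3⟩, hJ, hXr, hdef⟩ := hdS S hSD hreg
  have hline := (hZD hA' S hSD hregP).2.1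
  have h23S := h23D hA' S hSD hregP
  have hw : WeightsNonnegAt c' S (Fam S) := weightsNonnegAt_of hL2 h23S hline
  have hr : RealWeightsAt c' S (Fam S) := realWeightsAt_of hL2 h23S hline
  have hU : UnitRootAt χ S (Fam S) := unitRootAt_scalesAt hχp hD3 hA hline
  have hchain := norm_crossStar_le hw hr hU θ
  have hdes := designMeanCS_eq (c' := c') hr hU θ
  have hN := normaliser_nonneg χ S
  have hblocks := ellBlocks_sum S.ellP (thetaRefl S θ)
  -- the probe and side-2 means are ≥ 0 (non-negative weights)
  have h0J : 0 ≤ probeMean χ c' S (Fam S) θ := div_nonneg (discMean_nonneg_of_weights hw _) hN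
  have h02 : 0 ≤ diagMean2 χ c' S (Fam S) θ := div_nonneg (discMean_nonneg_of_weights hw _) hN
  -- their dictionary upper values
  have hMD : designMeanCS χ c' S (Fam S) θ ≤ csMD S θ (G₀ θ B) (G₁ θ B) (K θ B) A lam := by
    rw [hdes, csMD, ← hblocks]
    have u1 := (abs_le.mp e1).2
    have u2 := (abs_le.mp e2).2
    have u3 := (abs_le.mp e3).2
    have hsplit : ((G₀ θ B).1 + (G₀ θ B).2.1 + (G₀ θ B).2.2 +
        lam * ((G₁ θ B).1 + (G₁ θ B).2.1 + (G₁ θ B).2.2)) / A =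
        ((G₀ θ B).1 + lam * (G₁ θ B).1) / A + ((G₀ θ B).2.1 + lam * (G₁ θ B).2.1) / A +
          ((G₀ θ B).2.2 + lam * (G₁ θ B).2.2) / A := by ring
    rw [hsplit]
    linarith
  have hMJ : probeMean χ c' S (Fam S) θ ≤ csMJ S θ (GJ₀ θ B) (GJ₁ θ B) (K θ B) A lam := by
    have := (abs_le.mp hJ).2
    rw [csMJ]; linarith
  have hM2 : diagMean2 χ c' S (Fam S) θ ≤ csM2 S θ (G₀ θ B) (G₁ θ B) (K θ B) A lam := by
    have := (abs_le.mp e2).2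
    rw [csM2]; linarith
  have hX : csX S θ (GX₀ θ B) (GX₁ θ B) (K θ B) A lam ≤ ‖crossStar χ c' S (Fam S) θ‖ := by
    have := norm_sub_norm_le (crossSlot S θ + (GX₀ θ B + lam * GX₁ θ B) / A) (crossStar χ c' S (Fam S) θ)
    rw [norm_sub_rev] at this
    rw [csX]; linarith
  exact cs_contra h0J h02 hchain hMD hMJ hM2 hdef hX (hcert S hD1 hreg lam hlam)

/-- **… hence Theorem 1 of the manuscript** from the tie/CS rows + a CS certificate
(`Skeleton.theorem1_of_eventually_not_assumptionA`). [cite: Zhang2022LandauSiegel, §1 Theorem 1; §2 p. 6] -/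
theorem theorem1_of_ellCSDict {c' : ℝ} {Fam : (S : Scales) → Finset (Chr S)}
    {Adm : Theta → Prop} {G₀ G₁ : Theta → ℝ → ℝ × ℝ × ℝ} {GJ₀ GJ₁ : Theta → ℝ → ℝ}
    {GX₀ GX₁ : Theta → ℝ → ℂ} {Λ : ℝ} {δf : Theta → ℝ → ℝ → ℝ} {K : Theta → ℝ → ℝ}
    {A₀ A₁ cZ A₂ A B : ℝ} {θ : Theta}
    (hdict : EllCSDictLam c' Fam Adm G₀ G₁ GJ₀ GJ₁ GX₀ GX₁ Λ δf K A₀) (h23 : Lemma23FixedA c' Fam A₁)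
    (hZ : EllZeroModelFixedA Fam cZ A₂) (hθ : Adm θ) (h0 : A₀ ≤ A) (h1 : A₁ ≤ A) (h2 : A₂ ≤ A)
    (hA : 1 ≤ A)
    (hcert : ∃ D₁ : ℕ, ∀ S : Scales, D₁ ≤ S.D → S.IsEllRegime A B → ∀ lam : ℝ, |lam| ≤ Λ →
      CSClosesAt S θ (G₀ θ B) (G₁ θ B) (GJ₀ θ B) (GJ₁ θ B) (GX₀ θ B) (GX₁ θ B) (δf θ B A) (K θ B) A lam) :
    Theorem1 :=
  Skeleton.theorem1_of_eventually_not_assumptionA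
    (forAllLarge_not_assumptionA_of_csDict hdict h23 hZ hθ h0 h1 h2 hA hcert)

/-- **… and Theorem 2.** [cite: Zhang2022LandauSiegel, §1 Theorem 2] -/
theorem theorem2_of_ellCSDict {c' : ℝ} {Fam : (S : Scales) → Finset (Chr S)}
    {Adm : Theta → Prop} {G₀ G₁ : Theta → ℝ → ℝ × ℝ × ℝ} {GJ₀ GJ₁ : Theta → ℝ → ℝ}
    {GX₀ GX₁ : Theta → ℝ → ℂ} {Λ : ℝ} {δf : Theta → ℝ → ℝ → ℝ} {K : Theta → ℝ → ℝ}
    {A₀ A₁ cZ A₂ A B : ℝ} {θ : Theta}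
    (hdict : EllCSDictLam c' Fam Adm G₀ G₁ GJ₀ GJ₁ GX₀ GX₁ Λ δf K A₀) (h23 : Lemma23FixedA c' Fam A₁)
    (hZ : EllZeroModelFixedA Fam cZ A₂) (hθ : Adm θ) (h0 : A₀ ≤ A) (h1 : A₁ ≤ A) (h2 : A₂ ≤ A)
    (hA : 1 ≤ A)
    (hcert : ∃ D₁ : ℕ, ∀ S : Scales, D₁ ≤ S.D → S.IsEllRegime A B → ∀ lam : ℝ, |lam| ≤ Λ →
      CSClosesAt S θ (G₀ θ B) (G₁ θ B) (GJ₀ θ B) (GJ₁ θ B) (GX₀ θ B) (GX₁ θ B) (δf θ B A) (K θ B) A lam) :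
    Theorem2 :=
  Skeleton.theorem2_of_theorem1 (theorem1_of_ellCSDict hdict h23 hZ hθ h0 h1 h2 hA hcert)

/-! ### Glue: the CS certificate as a function of the frame point `(ℓ, r, τ_T)`, and from a BOX around the
limit regime point (what an interval computation certifies) to the `D`-uniform hypothesis -/

/-- The reflection-frame design as a function of the frame data `r = L_M/L_R`, `τ = τ_T`
(`thetaRefl S θ = thetaReflAt S.shrink S.tauT θ`, `thetaRefl_eq_at`). [cite: Zhang2022LandauSiegel, §2 (2.10), (2.21)] -/
def thetaReflAt (r τ : ℝ) (θ : Theta) : Theta :=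
  { θ with
    nu1 := r * θ.nu1
    nu2 := r * (θ.nu2 - 10 * τ)
    nu3 := r * θ.nu3
    cut1 := r * θ.cut1 }

/-- The reflection-frame probe as a function of `r = L_M/L_R` (`thetaReflJ S θ = thetaReflJAt S.shrink θ`).
[cite: Zhang2022LandauSiegel, §2 (2.10), (2.28)] -/
def thetaReflJAt (r : ℝ) (θ : Theta) : Theta :=
  { θ with
    nu1 := r * θ.nu1
    nu2 := r * θ.nu2 }

/-- `thetaRefl` is `thetaReflAt` at the record's frame data. [cite: Zhang2022LandauSiegel, §2 (2.10), (2.21)] -/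
theorem thetaRefl_eq_at (S : Scales) (θ : Theta) : thetaRefl S θ = thetaReflAt S.shrink S.tauT θ := rfl

/-- `thetaReflJ` is `thetaReflJAt` at the record's frame data. [cite: Zhang2022LandauSiegel, §2 (2.10), (2.28)] -/
theorem thetaReflJ_eq_at (S : Scales) (θ : Theta) : thetaReflJ S θ = thetaReflJAt S.shrink θ := rfl

/-- **The CS closing inequality as a function of the frame point `(ℓ, r, τ)`** — the same expression as
`CSClosesAt` with `ℓ(P) ↦ ℓ`, `L_M/L_R ↦ r`, `τ_T ↦ τ` (in the regime `(D^A, D^B)`: `τ = B/A`, and `(ℓ, r) →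
((A+1)/(A+½), A/(A+1))`); `CSClosesAt S … ↔ CSClosesWith S.ellP S.shrink S.tauT …` (`csClosesAt_iff`).  This is
the object a kit certificate bounds on a box. [cite: Zhang2022LandauSiegel, §2 p. 6, (2.10), (2.30)] -/
def CSClosesWith (ℓ r τ : ℝ) (θ : Theta) (G₀ G₁ : ℝ × ℝ × ℝ) (GJ₀ GJ₁ : ℝ) (GX₀ GX₁ : ℂ)
    (δ K A lam : ℝ) : Prop :=
  Real.sqrt
        (max (C232Ell ℓ (thetaReflAt r τ θ) +
              ((G₀.1 + G₀.2.1 + G₀.2.2) + lam * (G₁.1 + G₁.2.1 + G₁.2.2)) / A + 3 * (K / A ^ 2)) 0 *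
          max (C233Ell ℓ (thetaReflJAt r θ) + (GJ₀ + lam * GJ₁) / A + K / A ^ 2) 0) +
      Real.sqrt (max δ 0 * max (ellBlock2 ℓ (thetaReflAt r τ θ) + (G₀.2.1 + lam * G₁.2.1) / A + K / A ^ 2) 0) <
    ‖mainTermFormEllPolar ℓ (gluedS (thetaReflAt r τ θ)) (gluedS' (thetaReflAt r τ θ))
          (tentT (thetaReflJAt r θ)) (tentT' (thetaReflJAt r θ)) + (GX₀ + lam * GX₁) / A‖ - K / A ^ 2

/-- `CSClosesAt` is `CSClosesWith` at the record's frame point `(ℓ(P), L_M/L_R, τ_T)`.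
[cite: Zhang2022LandauSiegel, §2 (2.10), (2.30)] -/
theorem csClosesAt_iff (S : Scales) (θ : Theta) (G₀ G₁ : ℝ × ℝ × ℝ) (GJ₀ GJ₁ : ℝ) (GX₀ GX₁ : ℂ)
    (δ K A lam : ℝ) :
    CSClosesAt S θ G₀ G₁ GJ₀ GJ₁ GX₀ GX₁ δ K A lam ↔
      CSClosesWith S.ellP S.shrink S.tauT θ G₀ G₁ GJ₀ GJ₁ GX₀ GX₁ δ K A lam :=
  Iff.rfl

/-- **The `D`-uniform CS hypothesis from a BOX certificate:** if the CS closing inequality holds at every frame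
point `(ℓ, r)` within `δ₀` of the limit regime point `((A+1)/(A+½), A/(A+1))` with `τ = B/A`, for every
`|λ| ≤ Λ`, then it holds at every scale record of the regime `(D^A, D^B)` with `D ≥ D₁`
(`Scales.eventually_ellP_shrink_near`, `IsEllRegime.tauT_eq`). [cite: Zhang2022LandauSiegel, §2 (2.10), (2.30)] -/
theorem csCert_of_box {θ : Theta} {G₀ G₁ : ℝ × ℝ × ℝ} {GJ₀ GJ₁ : ℝ} {GX₀ GX₁ : ℂ} {δ K A B Λ δ₀ : ℝ}
    (hA : 0 < A) (hδ₀ : 0 < δ₀)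
    (hbox : ∀ ℓ r : ℝ, |ℓ - (A + 1) / (A + 1 / 2)| < δ₀ → |r - A / (A + 1)| < δ₀ → ∀ lam : ℝ, |lam| ≤ Λ →
      CSClosesWith ℓ r (B / A) θ G₀ G₁ GJ₀ GJ₁ GX₀ GX₁ δ K A lam) :
    ∃ D₁ : ℕ, ∀ S : Scales, D₁ ≤ S.D → S.IsEllRegime A B → ∀ lam : ℝ, |lam| ≤ Λ →
      CSClosesAt S θ G₀ G₁ GJ₀ GJ₁ GX₀ GX₁ δ K A lam := by
  obtain ⟨D₁, h⟩ := Scales.eventually_ellP_shrink_near hA hδ₀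
  refine ⟨max D₁ 2, fun S hD hS lam hlam => ?_⟩
  have hD2 : 2 ≤ S.D := le_trans (le_max_right _ _) hD
  have hlog : Real.log S.D ≠ 0 :=
    (Real.log_pos (by exact_mod_cast lt_of_lt_of_le one_lt_two hD2)).ne'
  obtain ⟨h1, h2⟩ := h S (le_trans (le_max_left _ _) hD) hS.1
  rw [csClosesAt_iff, hS.tauT_eq hlog hA.ne']
  exact hbox _ _ h1 h2 lam hlam

/-- **Theorem 1 from the tie/CS rows + a BOX certificate** — the form a kit / rational-corner certificate targets.
[cite: Zhang2022LandauSiegel, §1 Theorem 1; §2 p. 6, (2.10), (2.30)] -/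
theorem theorem1_of_ellCSDict_box {c' : ℝ} {Fam : (S : Scales) → Finset (Chr S)}
    {Adm : Theta → Prop} {G₀ G₁ : Theta → ℝ → ℝ × ℝ × ℝ} {GJ₀ GJ₁ : Theta → ℝ → ℝ}
    {GX₀ GX₁ : Theta → ℝ → ℂ} {Λ : ℝ} {δf : Theta → ℝ → ℝ → ℝ} {K : Theta → ℝ → ℝ}
    {A₀ A₁ cZ A₂ A B δ₀ : ℝ} {θ : Theta}
    (hdict : EllCSDictLam c' Fam Adm G₀ G₁ GJ₀ GJ₁ GX₀ GX₁ Λ δf K A₀) (h23 : Lemma23FixedA c' Fam A₁)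
    (hZ : EllZeroModelFixedA Fam cZ A₂) (hθ : Adm θ) (h0 : A₀ ≤ A) (h1 : A₁ ≤ A) (h2 : A₂ ≤ A)
    (hA : 1 ≤ A) (hδ₀ : 0 < δ₀)
    (hbox : ∀ ℓ r : ℝ, |ℓ - (A + 1) / (A + 1 / 2)| < δ₀ → |r - A / (A + 1)| < δ₀ → ∀ lam : ℝ, |lam| ≤ Λ →
      CSClosesWith ℓ r (B / A) θ (G₀ θ B) (G₁ θ B) (GJ₀ θ B) (GJ₁ θ B) (GX₀ θ B) (GX₁ θ B) (δf θ B A)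
        (K θ B) A lam) :
    Theorem1 :=
  theorem1_of_ellCSDict hdict h23 hZ hθ h0 h1 h2 hA (csCert_of_box (by linarith) hδ₀ hbox)

end CSRows

/-! ## Part 9 — the tie/CS sheet in the `C`-regime `t₀ = D^C·𝓛⁵¹⁹` (`C = 0`: Part 8; `C = Cof B = 2B`: the cell's
«`t₀ = T²`» T-room sheets, RULING-2): the rows, the PROVED endgame and the box glue, twin of Part 7 for Part 8 -/

section CSRegimeC

variable {D : ℕ} [NeZero D]

/-- **The scale record `(D^A, D^B, D^C·𝓛⁵¹⁹)`** (a constructor for the regime `IsEllRegimeC A B C`; the CS sheet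
needs `T` because `H₂`'s physical length is `P^{ν₂}T⁻¹⁰`). [cite: Zhang2022LandauSiegel, §2 (2.6), (2.8), (2.15), (2.21)] -/
def scalesAtBC (A B C : ℝ) (D : ℕ) : Scales where
  D := D
  logP := A * Real.log D
  logT := B * Real.log D
  t0 := Real.exp (C * Real.log D) * Real.log D ^ 519
  L1 := Real.log D ^ 405
  L2 := Real.log D ^ 400
  eta := (Real.log D ^ 68)⁻¹

/-- `scalesAtBC A B C D` is a record of the regime `(D^A, D^B, D^C·𝓛⁵¹⁹)`. [cite: Zhang2022LandauSiegel, §2 (2.6), (2.8)] -/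
theorem isEllRegimeC_scalesAtBC (A B C : ℝ) (D : ℕ) : (scalesAtBC A B C D).IsEllRegimeC A B C :=
  ⟨⟨rfl, rfl, rfl, rfl, rfl⟩, rfl⟩

/-- In the regime `(D^A, D^B, D^C·𝓛⁵¹⁹)`, `τ_T = B/A` (`log D ≠ 0`, `A ≠ 0`). [cite: Zhang2022LandauSiegel, §2 (2.6); §6] -/
theorem _root_.Literature.NumberTheory.LFunctions.Zhang2022.EllScales.Scales.IsEllRegimeC.tauT_eq
    {S : Scales} {A B C : ℝ} (h : S.IsEllRegimeC A B C) (hD : Real.log S.D ≠ 0) (hA : A ≠ 0) :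
    S.tauT = B / A := by
  obtain ⟨⟨hP, -, -, -, -⟩, hT⟩ := h
  rw [Scales.tauT, hP, hT]
  field_simp

variable {χ : DirichletCharacter ℂ D}

/-- **`|Z(ρ,ψχ)| = 1` at every sampled zero in the `C`-regime, PROVED** (any record with `log P = A·log D`,
`t₀ = D^C·𝓛⁵¹⁹ ≥ 𝓛⁵¹⁹ ≥ 𝓛₁` for `C ≥ 0`, `A ≥ 1`, `D ≥ 3`), from Prop. 2.2 (i) as in `unitRootAt_scalesAt`.
[cite: Zhang2022LandauSiegel, §2 Prop. 2.2 (i), (2.14); §4 p. 8; §8 (8.2)] -/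
theorem unitRootAt_of_regimePC {S : Scales} {F : Finset (Chr S)} {A C : ℝ} (hχ : χ.IsPrimitive)
    (hD : 3 ≤ D) (hSD : S.D = D) (hS : S.IsEllRegimePC A C) (hA : 1 ≤ A) (hC : 0 ≤ C)
    (hline : OnLineSimple χ S F) : UnitRootAt χ S F := by
  intro x hx ρ hρ
  obtain ⟨h1, h2, h3⟩ := Skeleton.mem_of_mem_finsetOf hρ
  have hprod : ρ ∈ prodZeroSet χ x := ⟨h1, h2, by rw [h3, zero_mul]⟩
  have hre : ρ.re = 1 / 2 := (hline x hx ρ hprod).1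
  obtain ⟨hP, ht0, hL1, -, -⟩ := hS
  rw [hSD] at hP ht0 hL1
  have hlog : 1 ≤ Real.log (D : ℝ) := one_le_log_of_three_le hD
  have hL1' : S.L1 = Real.log (D : ℝ) ^ 405 := by rw [hL1]; rfl
  have hexp : 1 ≤ Real.exp (C * Real.log (D : ℝ)) :=
    Real.one_le_exp (mul_nonneg hC (by linarith))
  have hLpos : 0 < Real.log (D : ℝ) ^ 519 := by positivity
  have ht0pos : 0 < S.t0 := by rw [ht0]; positivity
  have hL1le : S.L1 ≤ S.t0 := by
    rw [ht0, hL1']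
    calc Real.log (D : ℝ) ^ 405 ≤ Real.log (D : ℝ) ^ 519 := pow_le_pow_right₀ hlog (by norm_num)
      _ = 1 * Real.log (D : ℝ) ^ 519 := (one_mul _).symm
      _ ≤ Real.exp (C * Real.log (D : ℝ)) * Real.log (D : ℝ) ^ 519 :=
          mul_le_mul_of_nonneg_right hexp hLpos.le
  have him : 0 < ρ.im := by
    have hlt := (abs_lt.mp h2).1
    have hπt : 3 * S.t0 < π * S.t0 := mul_lt_mul_of_pos_right Real.pi_gt_three ht0pos
    linarith
  have hD0 : (0 : ℝ) < D := by exact_mod_cast (by omega : 0 < D)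
  have hDP : (D : ℝ) ≤ S.P := by
    rw [Scales.P, hP]
    calc (D : ℝ) = Real.exp (Real.log D) := (Real.exp_log hD0).symm
      _ ≤ Real.exp (A * Real.log D) :=
          Real.exp_le_exp.mpr (le_mul_of_one_le_left (by linarith) hA)
  have hPp : S.P < x.p := by
    have hm := x.mem
    simp only [Scales.primeWindow, Finset.mem_filter, Finset.mem_Ioo] at hm
    exact (Nat.floor_lt (le_trans hD0.le hDP)).mp hm.1.1
  have hDp : D < x.p := by exact_mod_cast lt_of_le_of_lt hDP hPp
  have hcop : Nat.Coprime D x.p :=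
    Nat.coprime_comm.mp ((Nat.Prime.coprime_iff_not_dvd x.prime).mpr
      (Nat.not_dvd_of_pos_of_lt (by omega) hDp))
  haveI := x.neZero
  have hprim := isPrimitive_changeLevel_mul' hcop hχ x.prim
  have hρ' : ρ = 1 / 2 + (ρ.im : ℂ) * I := Complex.ext (by simp [hre]) (by simp)
  have key : ‖ZAt χ x (1 / 2 + (ρ.im : ℂ) * I)‖ = 1 := by
    unfold ZAt
    exact GammaFactor.norm_Zfac_half_eq_one hprim him
  rwa [← hρ'] at key

/-- **The tie/CS dictionary in the `C`-regime with `C = Cof B`** (`Cof B = 2B`: «`t₀ = T²`»; `Cof = 0`: Part 8's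
`EllCSDictLam`, `ellCSDictLamC_zero_iff`): as `EllCSDictLam`, at the records `(D^A, D^B, D^{Cof B}·𝓛⁵¹⁹)`.
A DEFINITION; asserted for no value of its functionals.
[cite: Zhang2022LandauSiegel, §2 (2.17), (2.32)–(2.33), Props. 2.4–2.6; §8 (8.23); §10 (10.17); §11 (11.1); §18 (18.3)] -/
def EllCSDictLamC (c' : ℝ) (Fam : (S : Scales) → Finset (Chr S)) (Adm : Theta → Prop)
    (G₀ G₁ : Theta → ℝ → ℝ × ℝ × ℝ) (GJ₀ GJ₁ : Theta → ℝ → ℝ) (GX₀ GX₁ : Theta → ℝ → ℂ) (Λ : ℝ)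
    (δf : Theta → ℝ → ℝ → ℝ) (K : Theta → ℝ → ℝ) (A₀ : ℝ) (Cof : ℝ → ℝ) : Prop :=
  ∀ θ : Theta, Adm θ → ∀ A B : ℝ, A₀ ≤ A →
    ForAllLarge fun D _ χ => AssumptionA D χ → ∃ lam : ℝ, |lam| ≤ Λ ∧
      ∀ S : Scales, S.D = D → S.IsEllRegimeC A B (Cof B) →
        DictAt χ c' S (Fam S) θ ((G₀ θ B).1 + lam * (G₁ θ B).1) ((G₀ θ B).2.1 + lam * (G₁ θ B).2.1)
            ((G₀ θ B).2.2 + lam * (G₁ θ B).2.2) (K θ B) A ∧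
          CSProbeDictAt χ c' S (Fam S) θ (GJ₀ θ B + lam * GJ₁ θ B) (GX₀ θ B + lam * GX₁ θ B) (δf θ B A)
            (K θ B) A

/-- `Cof = 0`: `EllCSDictLamC … (fun _ => 0) ↔ EllCSDictLam …`. [cite: Zhang2022LandauSiegel, §2 (2.17), (2.32)–(2.33)] -/
theorem ellCSDictLamC_zero_iff (c' : ℝ) (Fam : (S : Scales) → Finset (Chr S)) (Adm : Theta → Prop)
    (G₀ G₁ : Theta → ℝ → ℝ × ℝ × ℝ) (GJ₀ GJ₁ : Theta → ℝ → ℝ) (GX₀ GX₁ : Theta → ℝ → ℂ) (Λ : ℝ)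
    (δf : Theta → ℝ → ℝ → ℝ) (K : Theta → ℝ → ℝ) (A₀ : ℝ) :
    EllCSDictLamC c' Fam Adm G₀ G₁ GJ₀ GJ₁ GX₀ GX₁ Λ δf K A₀ (fun _ => 0) ↔
      EllCSDictLam c' Fam Adm G₀ G₁ GJ₀ GJ₁ GX₀ GX₁ Λ δf K A₀ := by
  unfold EllCSDictLamC EllCSDictLam
  simp only [Scales.isEllRegimeC_zero_iff]

/-- The `C`-regime tie/CS dictionary contains E-022's `C`-regime `λ`-form (same `λ`, same `Cof`).
[cite: Zhang2022LandauSiegel, §8 (8.23)] -/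
theorem EllCSDictLamC.dictLamC {c' : ℝ} {Fam : (S : Scales) → Finset (Chr S)} {Adm : Theta → Prop}
    {G₀ G₁ : Theta → ℝ → ℝ × ℝ × ℝ} {GJ₀ GJ₁ : Theta → ℝ → ℝ} {GX₀ GX₁ : Theta → ℝ → ℂ} {Λ : ℝ}
    {δf : Theta → ℝ → ℝ → ℝ} {K : Theta → ℝ → ℝ} {A₀ : ℝ} {Cof : ℝ → ℝ}
    (h : EllCSDictLamC c' Fam Adm G₀ G₁ GJ₀ GJ₁ GX₀ GX₁ Λ δf K A₀ Cof) :
    EllDictFirstOrderLamC c' Fam Adm G₀ G₁ Λ K A₀ Cof := by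
  intro θ hθ A B hA
  refine (h θ hθ A B hA).mono fun D _ χ _ _ hD hAss => ?_
  obtain ⟨lam, hlam, hS⟩ := hD hAss
  exact ⟨lam, hlam, fun S hSD hreg => (hS S hSD hreg).1⟩

/-- **THE CAUCHY–SCHWARZ ENDGAME AT FIXED `A` IN THE `C`-REGIME, PROVED** (as
`forAllLarge_not_assumptionA_of_csDict`, at the record `scalesAtBC A B C D`, `C = Cof B ≥ 0`).
[cite: Zhang2022LandauSiegel, §2 p. 6, (2.17)–(2.20), (2.32)–(2.33), Props. 2.4–2.6] -/
theorem forAllLarge_not_assumptionA_of_csDictC {c' : ℝ} {Fam : (S : Scales) → Finset (Chr S)}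
    {Adm : Theta → Prop} {G₀ G₁ : Theta → ℝ → ℝ × ℝ × ℝ} {GJ₀ GJ₁ : Theta → ℝ → ℝ}
    {GX₀ GX₁ : Theta → ℝ → ℂ} {Λ : ℝ} {δf : Theta → ℝ → ℝ → ℝ} {K : Theta → ℝ → ℝ}
    {A₀ A₁ cZ A₂ A B : ℝ} {Cof : ℝ → ℝ} {θ : Theta}
    (hdict : EllCSDictLamC c' Fam Adm G₀ G₁ GJ₀ GJ₁ GX₀ GX₁ Λ δf K A₀ Cof)
    (h23 : Lemma23FixedAC c' Fam A₁ (Cof B)) (hZ : EllZeroModelFixedAC Fam cZ A₂ (Cof B)) (hθ : Adm θ)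
    (h0 : A₀ ≤ A) (h1 : A₁ ≤ A) (h2 : A₂ ≤ A) (hA : 1 ≤ A) (hC : 0 ≤ Cof B)
    (hcert : ∃ D₁ : ℕ, ∀ S : Scales, D₁ ≤ S.D → S.IsEllRegimeC A B (Cof B) → ∀ lam : ℝ, |lam| ≤ Λ →
      CSClosesAt S θ (G₀ θ B) (G₁ θ B) (GJ₀ θ B) (GJ₁ θ B) (GX₀ θ B) (GX₁ θ B) (δf θ B A) (K θ B) A lam) :
    ForAllLarge fun D _ χ => ¬ AssumptionA D χ := by
  obtain ⟨Cd, hZ⟩ := hZ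
  obtain ⟨D₁, hcert⟩ := hcert
  have hev := (((hdict θ hθ A B h0).and (h23 A h1)).and (hZ A h2)).and
    (ForAllLarge.of_le (S := fun D _ _ => max D₁ 3 ≤ D) (max D₁ 3) fun D _ χ hD _ _ => hD)
  refine hev.mono fun D _ χ _ hχp hall hA' => ?_
  obtain ⟨⟨⟨hd, h23D⟩, hZD⟩, hD⟩ := hall
  have hD3 : 3 ≤ D := le_trans (le_max_right _ _) hD
  set S := scalesAtBC A B (Cof B) D with hSdef
  have hreg : S.IsEllRegimeC A B (Cof B) := ⟨⟨rfl, rfl, rfl, rfl, rfl⟩, rfl⟩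
  have hregP : S.IsEllRegimePC A (Cof B) := hreg.1
  have hSD : S.D = D := rfl
  have hD1 : D₁ ≤ S.D := le_trans (le_max_left _ _) hD
  have hL2 : 0 < S.L2 := by
    show 0 < Real.log (D : ℝ) ^ 400
    exact pow_pos (by linarith [one_le_log_of_three_le hD3]) _
  obtain ⟨lam, hlam, hdS⟩ := hd hA'
  obtain ⟨⟨e1, e2, e3⟩, hJ, hXr, hdef⟩ := hdS S hSD hreg
  have hline := (hZD hA' S hSD hregP).2.1
  have h23S := h23D hA' S hSD hregP
  have hw : WeightsNonnegAt c' S (Fam S) := weightsNonnegAt_of hL2 h23S hline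
  have hr : RealWeightsAt c' S (Fam S) := realWeightsAt_of hL2 h23S hline
  have hU : UnitRootAt χ S (Fam S) := unitRootAt_of_regimePC hχp hD3 hSD hregP hA hC hline
  have hchain := norm_crossStar_le hw hr hU θ
  have hdes := designMeanCS_eq (c' := c') hr hU θ
  have hN := normaliser_nonneg χ S
  have hblocks := ellBlocks_sum S.ellP (thetaRefl S θ)
  have h0J : 0 ≤ probeMean χ c' S (Fam S) θ := div_nonneg (discMean_nonneg_of_weights hw _) hN
  have h02 : 0 ≤ diagMean2 χ c' S (Fam S) θ := div_nonneg (discMean_nonneg_of_weights hw _) hN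
  have hMD : designMeanCS χ c' S (Fam S) θ ≤ csMD S θ (G₀ θ B) (G₁ θ B) (K θ B) A lam := by
    rw [hdes, csMD, ← hblocks]
    have u1 := (abs_le.mp e1).2
    have u2 := (abs_le.mp e2).2
    have u3 := (abs_le.mp e3).2
    have hsplit : ((G₀ θ B).1 + (G₀ θ B).2.1 + (G₀ θ B).2.2 +
        lam * ((G₁ θ B).1 + (G₁ θ B).2.1 + (G₁ θ B).2.2)) / A =
        ((G₀ θ B).1 + lam * (G₁ θ B).1) / A + ((G₀ θ B).2.1 + lam * (G₁ θ B).2.1) / A +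
          ((G₀ θ B).2.2 + lam * (G₁ θ B).2.2) / A := by ring
    rw [hsplit]
    linarith
  have hMJ : probeMean χ c' S (Fam S) θ ≤ csMJ S θ (GJ₀ θ B) (GJ₁ θ B) (K θ B) A lam := by
    have := (abs_le.mp hJ).2
    rw [csMJ]; linarith
  have hM2 : diagMean2 χ c' S (Fam S) θ ≤ csM2 S θ (G₀ θ B) (G₁ θ B) (K θ B) A lam := by
    have := (abs_le.mp e2).2
    rw [csM2]; linarith
  have hX : csX S θ (GX₀ θ B) (GX₁ θ B) (K θ B) A lam ≤ ‖crossStar χ c' S (Fam S) θ‖ := by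
    have := norm_sub_norm_le (crossSlot S θ + (GX₀ θ B + lam * GX₁ θ B) / A) (crossStar χ c' S (Fam S) θ)
    rw [norm_sub_rev] at this
    rw [csX]; linarith
  exact cs_contra h0J h02 hchain hMD hMJ hM2 hdef hX (hcert S hD1 hreg lam hlam)

/-- … hence Theorem 1, tie/CS sheet in the `C`-regime. [cite: Zhang2022LandauSiegel, §1 Theorem 1; §2 p. 6] -/
theorem theorem1_of_ellCSDictC {c' : ℝ} {Fam : (S : Scales) → Finset (Chr S)}
    {Adm : Theta → Prop} {G₀ G₁ : Theta → ℝ → ℝ × ℝ × ℝ} {GJ₀ GJ₁ : Theta → ℝ → ℝ}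
    {GX₀ GX₁ : Theta → ℝ → ℂ} {Λ : ℝ} {δf : Theta → ℝ → ℝ → ℝ} {K : Theta → ℝ → ℝ}
    {A₀ A₁ cZ A₂ A B : ℝ} {Cof : ℝ → ℝ} {θ : Theta}
    (hdict : EllCSDictLamC c' Fam Adm G₀ G₁ GJ₀ GJ₁ GX₀ GX₁ Λ δf K A₀ Cof)
    (h23 : Lemma23FixedAC c' Fam A₁ (Cof B)) (hZ : EllZeroModelFixedAC Fam cZ A₂ (Cof B)) (hθ : Adm θ)
    (h0 : A₀ ≤ A) (h1 : A₁ ≤ A) (h2 : A₂ ≤ A) (hA : 1 ≤ A) (hC : 0 ≤ Cof B)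
    (hcert : ∃ D₁ : ℕ, ∀ S : Scales, D₁ ≤ S.D → S.IsEllRegimeC A B (Cof B) → ∀ lam : ℝ, |lam| ≤ Λ →
      CSClosesAt S θ (G₀ θ B) (G₁ θ B) (GJ₀ θ B) (GJ₁ θ B) (GX₀ θ B) (GX₁ θ B) (δf θ B A) (K θ B) A lam) :
    Theorem1 :=
  Skeleton.theorem1_of_eventually_not_assumptionA
    (forAllLarge_not_assumptionA_of_csDictC hdict h23 hZ hθ h0 h1 h2 hA hC hcert)

/-- … and Theorem 2. [cite: Zhang2022LandauSiegel, §1 Theorem 2] -/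
theorem theorem2_of_ellCSDictC {c' : ℝ} {Fam : (S : Scales) → Finset (Chr S)}
    {Adm : Theta → Prop} {G₀ G₁ : Theta → ℝ → ℝ × ℝ × ℝ} {GJ₀ GJ₁ : Theta → ℝ → ℝ}
    {GX₀ GX₁ : Theta → ℝ → ℂ} {Λ : ℝ} {δf : Theta → ℝ → ℝ → ℝ} {K : Theta → ℝ → ℝ}
    {A₀ A₁ cZ A₂ A B : ℝ} {Cof : ℝ → ℝ} {θ : Theta}
    (hdict : EllCSDictLamC c' Fam Adm G₀ G₁ GJ₀ GJ₁ GX₀ GX₁ Λ δf K A₀ Cof)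
    (h23 : Lemma23FixedAC c' Fam A₁ (Cof B)) (hZ : EllZeroModelFixedAC Fam cZ A₂ (Cof B)) (hθ : Adm θ)
    (h0 : A₀ ≤ A) (h1 : A₁ ≤ A) (h2 : A₂ ≤ A) (hA : 1 ≤ A) (hC : 0 ≤ Cof B)
    (hcert : ∃ D₁ : ℕ, ∀ S : Scales, D₁ ≤ S.D → S.IsEllRegimeC A B (Cof B) → ∀ lam : ℝ, |lam| ≤ Λ →
      CSClosesAt S θ (G₀ θ B) (G₁ θ B) (GJ₀ θ B) (GJ₁ θ B) (GX₀ θ B) (GX₁ θ B) (δf θ B A) (K θ B) A lam) :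
    Theorem2 :=
  Skeleton.theorem2_of_theorem1 (theorem1_of_ellCSDictC hdict h23 hZ hθ h0 h1 h2 hA hC hcert)

/-- **The `D`-uniform CS hypothesis from a BOX certificate in the `C`-regime** (limit point
`((A+C+1)/(A+C+½), A/(A+C+1))`, `τ = B/A`; `Scales.eventually_ellP_shrink_nearC`, `IsEllRegimeC.tauT_eq`).
[cite: Zhang2022LandauSiegel, §2 (2.10), (2.30)] -/
theorem csCert_of_boxC {θ : Theta} {G₀ G₁ : ℝ × ℝ × ℝ} {GJ₀ GJ₁ : ℝ} {GX₀ GX₁ : ℂ} {δ K A B C Λ δ₀ : ℝ}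
    (hA : 0 < A) (hC : 0 ≤ C) (hδ₀ : 0 < δ₀)
    (hbox : ∀ ℓ r : ℝ, |ℓ - (A + C + 1) / (A + C + 1 / 2)| < δ₀ → |r - A / (A + C + 1)| < δ₀ →
      ∀ lam : ℝ, |lam| ≤ Λ → CSClosesWith ℓ r (B / A) θ G₀ G₁ GJ₀ GJ₁ GX₀ GX₁ δ K A lam) :
    ∃ D₁ : ℕ, ∀ S : Scales, D₁ ≤ S.D → S.IsEllRegimeC A B C → ∀ lam : ℝ, |lam| ≤ Λ →
      CSClosesAt S θ G₀ G₁ GJ₀ GJ₁ GX₀ GX₁ δ K A lam := by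
  obtain ⟨D₁, h⟩ := Scales.eventually_ellP_shrink_nearC hA hC hδ₀
  refine ⟨max D₁ 2, fun S hD hS lam hlam => ?_⟩
  have hD2 : 2 ≤ S.D := le_trans (le_max_right _ _) hD
  have hlog : Real.log S.D ≠ 0 :=
    (Real.log_pos (by exact_mod_cast lt_of_lt_of_le one_lt_two hD2)).ne'
  obtain ⟨h1, h2⟩ := h S (le_trans (le_max_left _ _) hD) hS.1
  rw [csClosesAt_iff, hS.tauT_eq hlog hA.ne']
  exact hbox _ _ h1 h2 lam hlam

/-- **Theorem 1 from the `C`-regime tie/CS rows + a BOX certificate.** [cite: Zhang2022LandauSiegel, §1 Theorem 1; §2 p. 6, (2.10), (2.30)] -/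
theorem theorem1_of_ellCSDictC_box {c' : ℝ} {Fam : (S : Scales) → Finset (Chr S)}
    {Adm : Theta → Prop} {G₀ G₁ : Theta → ℝ → ℝ × ℝ × ℝ} {GJ₀ GJ₁ : Theta → ℝ → ℝ}
    {GX₀ GX₁ : Theta → ℝ → ℂ} {Λ : ℝ} {δf : Theta → ℝ → ℝ → ℝ} {K : Theta → ℝ → ℝ}
    {A₀ A₁ cZ A₂ A B δ₀ : ℝ} {Cof : ℝ → ℝ} {θ : Theta}
    (hdict : EllCSDictLamC c' Fam Adm G₀ G₁ GJ₀ GJ₁ GX₀ GX₁ Λ δf K A₀ Cof)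
    (h23 : Lemma23FixedAC c' Fam A₁ (Cof B)) (hZ : EllZeroModelFixedAC Fam cZ A₂ (Cof B)) (hθ : Adm θ)
    (h0 : A₀ ≤ A) (h1 : A₁ ≤ A) (h2 : A₂ ≤ A) (hA : 1 ≤ A) (hC : 0 ≤ Cof B) (hδ₀ : 0 < δ₀)
    (hbox : ∀ ℓ r : ℝ, |ℓ - (A + Cof B + 1) / (A + Cof B + 1 / 2)| < δ₀ → |r - A / (A + Cof B + 1)| < δ₀ →
      ∀ lam : ℝ, |lam| ≤ Λ →
        CSClosesWith ℓ r (B / A) θ (G₀ θ B) (G₁ θ B) (GJ₀ θ B) (GJ₁ θ B) (GX₀ θ B) (GX₁ θ B) (δf θ B A)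
          (K θ B) A lam) :
    Theorem1 :=
  theorem1_of_ellCSDictC hdict h23 hZ hθ h0 h1 h2 hA hC (csCert_of_boxC (by linarith) hC hδ₀ hbox)

end CSRegimeC

end EllRegime

end Literature.NumberTheory.LFunctions.Zhang2022

end
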